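import Literature.NumberTheory.Sieve.BombieriFriedlanderIwaniecLemma1DI11FromKuznetsovBound
import Mathlib.Analysis.SpecialFunctions.Gamma.Basic
import HarnessLib

/-!
# The Kuznetsov-shaped bound `H91At` from Kuznetsov's formula and the large sieve (Deshouillers–Iwaniec §9.1 at `s = 1`)

This file proves, sorry-free, the computation of §9.1 of Deshouillers–Iwaniec
[DeshouillersIwaniec1982, pp. 278–280, (9.2)–(9.8)] at `s = 1`: the bound `BFI.L1.H91At ε` (for
every `ε > 0`) — the only hypothesis of `…Lemma1DI11FromKuznetsovBound`, hence of the whole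
Bombieri–Friedlander–Iwaniec cone in the tree — from the AUTOMORPHIC INPUTS of that section, taken
as explicit hypotheses on ABSTRACT spectral data:

* `KuzPlus`, `KuzMinus` — Kuznetsov's formula for `Γ₀(r)` at the cusp pair `(∞, 0)`, both signs
  [DeshouillersIwaniec1982, Theorem 1 (1.19)–(1.20); Drappeau2017, Lemma 4.5 (4.15)–(4.16)], written
  on the Kloosterman side in classical terms (`S(m, ±n r̄; c) = kl c r n (±m)`, `(c, r) = 1`) and on
  the spectral side with abstract arrays of normalised Fourier coefficients (`SpecData`) and abstract
  Bessel transforms (`KuzTransforms`);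
* `TransformBound` — the bounds for the Bessel transforms of a test function supported in `[X, 2X]`,
  in the shape of [DeshouillersIwaniec1982, Lemma 7.1] (see "Faithfulness of hypothesis (W)" below;
  cf. [Drappeau2017, Lemma 4.4 (4.14)]);
* `LSMaassInf`, `LSMaassZero`, `LSEisInf`, `LSEisZero`, `LSHolInf`, `LSHolZero` — the large-sieve
  inequalities for the three spectra at the cusps `∞` and `0` [DeshouillersIwaniec1982, Theorem 2
  (1.28)–(1.30); Drappeau2017, Prop. 4.7 (4.19)–(4.21)];
* `ExcFive` — the weighted large sieve for the exceptional spectrum at an individual level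
  [DeshouillersIwaniec1982, Theorem 5 (1.38); Drappeau2017, Lemma 4.8];
* `ExcSeven` — Theorem 7 of Deshouillers–Iwaniec: the same on average over the level, for a (twisted)
  initial segment [DeshouillersIwaniec1982, Theorem 7 (1.41); Drappeau2017, Lemma 4.10].

As Drappeau puts it [Drappeau2017, p. 10]: "we do not use any information about the Fourier
coefficients … other than the fact that Kuznetsov's formula holds … The main feature of the Kuznetsov
formula which is used is the decay properties of the integral transforms, and the fact that it separates
the variables `m` and `n` in a way that combines very nicely with the Cauchy–Schwarz inequality."
Accordingly nothing automorphic is constructed here: the theorem holds for ANY data satisfying the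
hypotheses, and the genuine Kuznetsov formula for `Γ₀(r)` (with its Maass cusp forms, Eisenstein series
and holomorphic forms, and the Bessel transforms `φ̃, φ̌, φ̇`) is one such instance.

Main results:

* `BFI.L1.H91At_of_kuznetsov : KuzPlus D W → KuzMinus D W → TransformBound W → LSMaassInf D → … →
  ExcSeven D → ∀ ε > 0, H91At ε`;
* `BombieriFriedlanderIwaniecTheorem5_of_kuznetsov`, `…Theorem1_of_kuznetsov`,
  `…Theorem10_of_kuznetsov`, `bfi_wellFactorable_level_of_kuznetsov`, `twinSieve_bfi_of_kuznetsov`: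
  the BFI cone from the same hypotheses (through the `_of_H91` results of
  `…Lemma1DI11FromKuznetsovBound`).

## Faithfulness of hypothesis (W) (revised 2026-08-16)

Hypothesis `TransformBound W` asks, for `φ` smooth with support in `[X, 2X]` and `|φ^{(j)}| ≤ X^{-j}`
(`j ≤ 4`), that `|φ̃(t)|, |φ̌(t)|, |φ̇(k)| ≤ A Λ(X) ω_X(t)` with `Λ(X) = (1 + |log X|)/(1 + X)` and
`ω_X(t) = min(1, ((1 + X)/(1 + |t|))³)`, and that `|φ̃(iy)|, |φ̌(iy)| ≤ A Λ(X)(1 + X^{-2y})` for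
`0 < y ≤ 1/4`.  This is the content of [DeshouillersIwaniec1982, Lemma 7.1]: (7.2) `≪ Λ(X)` for all
real `t`, the polynomial decay (7.3)–(7.4) in `|t| ≥ 1` with at most two extra powers of `1 + X`, and
(7.1) for the exceptional parameters — EXCEPT that we keep the factor `1 + |log X|` of (7.2) also in
the exceptional bound.  A first version of this file transcribed instead the decay factor
`min(1, (1 + X^{3/2})/(1 + |t|³))` printed in [Drappeau2017, (4.14)] for all three transforms, and
(7.1) without the logarithm; both are too strong to be satisfiable by the genuine transforms, so that
the hypothesis has been WEAKENED to the present form (the theorem is correspondingly stronger):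

* for the holomorphic transform `φ̇(k) = 4 i^k ∫ J_{k−1}(x) φ(x) dx/x` and `X → ∞`, take `φ ≍ 1` on
  `[1.05 X, 1.95 X]` and `k − 1 = 3X/2`: since `∫₀^∞ J_ν(x) dx/x = 1/ν`, `J_ν(x) ≤ (ex/2ν)^ν/ν!` is
  exponentially small on `x ≤ 0.7ν`, and the oscillatory tail `x ≥ 1.3ν` contributes `O(ν^{-3/2})`,
  one gets `|φ̇(k)| = 4/ν + O(ν^{-3/2}) ≍ 1/X`, whereas `Λ(X)(1 + X^{3/2})/(1 + k³) ≍ X^{-5/2} log X`.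
  The weight `ω_X(k) = min(1, ((1+X)/(1+k))³)` equals `≍ 1` there, consistently with
  [DeshouillersIwaniec1982, (9.4)], whose `L_reg` carries the factor `(1 + X + …)²` that absorbs
  `∑_{k ≤ 1+X} 1/X · (k² + …)`; for `φ̃, φ̌` (imaginary order, no turning point) the truth is better.
* `φ̃(iy) → φ̃(0)` as `y → 0⁺` (dominated convergence in the Mehler–Sonine representation), and
  `|φ̃(0)| ≍ log(1/X)` for `φ ≥ 0` and `X → 0`; so no bound `A(1 + X^{-2y})/(1 + X)` can hold
  uniformly in `0 < y ≤ 1/4`, while `A Λ(X)(1 + X^{-2y})` does (split the `ξ`-integral at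
  `ch ξ = 1/X`).  The extra `1 + |log X| ≤ (1 + 2/ε)(X + X⁻¹)^ε` is absorbed in `final_exc`.

With the weights `ω_X` the dyadic-shell bound reads `∑_j min(1, (1+X)³/8^j) 4^{j+1} ≤ 14 (1+X)²`
(`regFac`), which is exactly the `(1 + X + √(M/R'))(1 + X + √(N/R'))/(1 + X)` of (9.4).

## The argument ([DeshouillersIwaniec1982, §9.1], made explicit)

1. (9.2) For each level `r ∼ R` the finite `c`-sum of `kuzSum` is the full Kloosterman side (the test
   function vanishes beyond the cutoff, `phi_xK_eq_zero`), and Kuznetsov's formula turns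
   `∑_{n,m} β_{n,r} e(θm) ∑_c …` into bilinear spectral sums `∑_f w_f A_f B_f` with
   `A_f = ∑_m e(θm) conj(√m ρ_{f∞}(m))`, `B_f = ∑_n β_{n,r} √n ρ_{f0}(±n)` (`bilinear_core`,
   `sign_data`).
2. (9.3)–(9.4) Termwise `|w_f A_f B_f| ≤ c ω_f (λ|A_f|² + λ⁻¹|B_f|²)/2` (AM–GM with a free parameter
   instead of Cauchy–Schwarz); the one-sided weighted sums are bounded by the large sieve through the
   dyadic shells `2^j − 1 ≤ |t| < 2^{j+1} − 1` (`weighted_sum_le_of_largeSieve`,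
   `weighted_lintegral_le_of_largeSieve`): `∑_j min(1, B/8^j) 4^{j+1} ≤ 14 B^{2/3}`,
   `∑_j min(1, B/8^j) ≤ 3 + log B`, `B = (1 + X)³`.
3. (9.5)–(9.8) For the exceptional spectrum `|φ̃(iy)| ≤ A Λ(X) (1 + X^{-2y})` and
   `X^{-2y} ≤ Y₁^y Y₂^y` with `Y₂ = max(1, R/N)`, `Y₁ = max(1, X⁻²/Y₂)`; the `m`-side is bounded by
   Theorem 7 (after writing `(a, u] = [1, u] ∖ [1, a]`, `exc_A_bound`), the `n`-side by Theorem 5.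
4. Summing over `r ∼ R`, optimising `λ, λ'` (`le_sqrt_mul_sqrt_of_forall_param`) and the conversions
   `final_reg` (to `L_reg`) and `final_exc` (to `L_reg + L_exc`, `exc_algebra`) give `H91At ε` with an
   explicit constant.

## References

* [DeshouillersIwaniec1982] J.-M. Deshouillers, H. Iwaniec, *Kloosterman sums and Fourier coefficients
  of cusp forms*, Invent. Math. 70 (1982), 219–288: Theorem 1 (1.19)–(1.20) p. 228, Theorem 2
  (1.28)–(1.30) p. 230, Theorems 5–7 (1.38)–(1.41) pp. 232–233, Lemma 7.1, §9.1 (9.2)–(9.8)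
  pp. 278–280.
* [Drappeau2017] S. Drappeau, *Sums of Kloosterman sums in arithmetic progressions, and the error term
  in the dispersion method*, Proc. LMS 114 (2017), 684–732 (arXiv:1504.05549): Lemma 4.4 (4.14),
  Lemma 4.5 (4.15)–(4.22), Prop. 4.7, Lemma 4.8, Lemma 4.10, Prop. 4.12.
* [BombieriFriedlanderIwaniecActa1986] E. Bombieri, J. Friedlander, H. Iwaniec, *Primes in arithmetic
  progressions to large moduli*, Acta Math. 156 (1986), 203–251: Theorems 1, 5, 10.
-/

noncomputable section

open Finset Real MeasureTheory
open scoped ContDiff FourierTransform Topology ENNReal NNReal ComplexConjugate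

namespace Literature.NumberTheory.Sieve

namespace BFI

namespace L1


/-! ### AM–GM with a free parameter and the `√`-optimisation -/

/-- `ab ≤ (λa² + λ⁻¹b²)/2` for `λ > 0`. [folklore] -/
theorem mul_le_amgm_param {a b lam : ℝ} (hl : 0 < lam) :
    a * b ≤ (lam * a ^ 2 + lam⁻¹ * b ^ 2) / 2 := by
  have key : (lam * a ^ 2 + lam⁻¹ * b ^ 2) / 2 - a * b = (lam * a - b) ^ 2 / (2 * lam) := by
    field_simp
    ring
  have : 0 ≤ (lam * a - b) ^ 2 / (2 * lam) := by positivity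
  linarith

/-- If `S ≤ (λU + λ⁻¹V)/2` for every `λ > 0` (`U, V ≥ 0`) then `S ≤ √U √V`. [folklore] -/
theorem le_sqrt_mul_sqrt_of_forall_param {S U V : ℝ} (hU : 0 ≤ U) (hV : 0 ≤ V)
    (h : ∀ lam : ℝ, 0 < lam → S ≤ (lam * U + lam⁻¹ * V) / 2) :
    S ≤ Real.sqrt U * Real.sqrt V := by
  -- for every `δ > 0`, `S ≤ √(U+δ) √(V+δ)`
  have hmain : ∀ δ : ℝ, 0 < δ → S ≤ Real.sqrt (U + δ) * Real.sqrt (V + δ) := by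
    intro δ hδ
    have hU' : 0 < U + δ := by linarith
    have hV' : 0 < V + δ := by linarith
    set lam := Real.sqrt (V + δ) / Real.sqrt (U + δ) with hlam
    have hsU := Real.sqrt_pos.2 hU'
    have hsV := Real.sqrt_pos.2 hV'
    have hl : 0 < lam := div_pos hsV hsU
    refine (h lam hl).trans ?_
    have h1 : lam * U ≤ lam * (U + δ) := by nlinarith
    have h2 : lam⁻¹ * V ≤ lam⁻¹ * (V + δ) := by
      have := inv_pos.2 hl; nlinarith
    have hmU := Real.mul_self_sqrt hU'.le
    have hmV := Real.mul_self_sqrt hV'.le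
    have e1 : lam * (U + δ) = Real.sqrt (U + δ) * Real.sqrt (V + δ) := by
      rw [hlam, div_mul_eq_mul_div, div_eq_iff hsU.ne']
      linear_combination Real.sqrt (V + δ) * hmU.symm
    have e2 : lam⁻¹ * (V + δ) = Real.sqrt (U + δ) * Real.sqrt (V + δ) := by
      rw [hlam, inv_div, div_mul_eq_mul_div, div_eq_iff hsV.ne']
      linear_combination Real.sqrt (U + δ) * hmV.symm
    linarith
  -- let `δ → 0⁺`
  have ht : Filter.Tendsto (fun δ : ℝ => Real.sqrt (U + δ) * Real.sqrt (V + δ)) (𝓝[>] 0)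
      (𝓝 (Real.sqrt U * Real.sqrt V)) := by
    have hc : Continuous fun δ : ℝ => Real.sqrt (U + δ) * Real.sqrt (V + δ) := by fun_prop
    have := hc.tendsto 0
    simp only [add_zero] at this
    exact this.mono_left nhdsWithin_le_nhds
  refine ge_of_tendsto ht ?_
  filter_upwards [self_mem_nhdsWithin] with δ hδ using hmain δ hδ

/-! ### Norms of `HasSum` limits from uniform bounds on partial sums -/

/-- If the partial sums of a `HasSum` family are bounded in norm by `B`, so is the sum. [folklore] -/
theorem norm_le_of_hasSum_of_forall_sum {ι : Type*} {f : ι → ℂ} {v : ℂ} (h : HasSum f v) {B : ℝ}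
    (hB : ∀ s : Finset ι, ‖∑ i ∈ s, f i‖ ≤ B) : ‖v‖ ≤ B :=
  le_of_tendsto' h.norm hB

/-- If `∑_{i ∈ s} ‖f i‖ ≤ B` for every finite `s`, then `‖∑' f‖ ≤ B` for a `HasSum` family. [folklore] -/
theorem norm_le_of_hasSum_of_forall_sum_norm {ι : Type*} {f : ι → ℂ} {v : ℂ} (h : HasSum f v) {B : ℝ}
    (hB : ∀ s : Finset ι, ∑ i ∈ s, ‖f i‖ ≤ B) : ‖v‖ ≤ B :=
  norm_le_of_hasSum_of_forall_sum h fun s => (norm_sum_le _ _).trans (hB s)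

/-! ### Dyadic shell sums -/

/-- For `B ≥ 1` there is `j₀` with `B ≤ 8^{j₀}` and `8^j < B` for `j < j₀`. [folklore] -/
theorem exists_pow_eight_ge (B : ℝ) :
    ∃ j₀ : ℕ, B ≤ (8 : ℝ) ^ j₀ ∧ ∀ j < j₀, (8 : ℝ) ^ j < B := by
  classical
  have hex : ∃ j : ℕ, B ≤ (8 : ℝ) ^ j := by
    obtain ⟨j, hj⟩ := pow_unbounded_of_one_lt B (by norm_num : (1 : ℝ) < 8)
    exact ⟨j, hj.le⟩
  refine ⟨Nat.find hex, Nat.find_spec hex, fun j hj => ?_⟩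
  have := Nat.find_min hex hj
  exact not_le.1 this

/-- `(x³)^{1/3} = x` for `x ≥ 0`. [folklore] -/
theorem pow_three_rpow_third {x : ℝ} (hx : 0 ≤ x) : (x ^ (3 : ℕ)) ^ ((1 : ℝ) / 3) = x := by
  rw [show ((1 : ℝ) / 3) = ((3 : ℕ) : ℝ)⁻¹ by norm_num]
  exact Real.pow_rpow_inv_natCast hx three_ne_zero

/-- `∑_{j<J} min(1, B/8^j) 4^{j+1} ≤ 14 B^{2/3}` for `B ≥ 1`. [folklore] -/
theorem sum_min_mul_four_pow_le {B : ℝ} (hB : 1 ≤ B) (J : ℕ) :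
    ∑ j ∈ Finset.range J, min 1 (B / 8 ^ j) * 4 ^ (j + 1) ≤ 14 * B ^ ((2 : ℝ) / 3) := by
  obtain ⟨j₀, hj₀, hlt⟩ := exists_pow_eight_ge B
  have hB0 : 0 < B := by linarith
  have hB23 : 0 < B ^ ((2 : ℝ) / 3) := Real.rpow_pos_of_pos hB0 _
  -- key facts: `4^{j₀} ≤ 4 B^{2/3}` and `B^{1/3} ≤ 2^{j₀}`
  have h8 : ∀ j : ℕ, ((8 : ℝ) ^ j) = ((2 : ℝ) ^ j) ^ (3 : ℕ) := by
    intro j; rw [← pow_mul, mul_comm, pow_mul]; norm_num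
  have hB13 : B ^ ((1 : ℝ) / 3) ≤ (2 : ℝ) ^ j₀ := by
    have : B ≤ ((2 : ℝ) ^ j₀) ^ (3 : ℕ) := by rw [← h8]; exact hj₀
    calc B ^ ((1 : ℝ) / 3) ≤ (((2 : ℝ) ^ j₀) ^ (3 : ℕ)) ^ ((1 : ℝ) / 3) :=
          Real.rpow_le_rpow hB0.le this (by norm_num)
      _ = (2 : ℝ) ^ j₀ := pow_three_rpow_third (by positivity)
  have h4j₀ : (4 : ℝ) ^ j₀ ≤ 4 * B ^ ((2 : ℝ) / 3) := by
    rcases Nat.eq_zero_or_pos j₀ with h0 | hpos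
    · subst h0; simp; linarith [Real.one_le_rpow hB (by norm_num : (0:ℝ) ≤ 2 / 3)]
    · have hl : (8 : ℝ) ^ (j₀ - 1) < B := hlt _ (Nat.sub_lt hpos one_pos)
      have : ((2 : ℝ) ^ (j₀ - 1)) ^ (3 : ℕ) < B := by rw [← h8]; exact hl
      have h2 : (2 : ℝ) ^ (j₀ - 1) < B ^ ((1 : ℝ) / 3) := by
        calc (2 : ℝ) ^ (j₀ - 1) = (((2 : ℝ) ^ (j₀ - 1)) ^ (3 : ℕ)) ^ ((1 : ℝ) / 3) :=
              (pow_three_rpow_third (by positivity)).symm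
          _ < B ^ ((1 : ℝ) / 3) := Real.rpow_lt_rpow (by positivity) this (by norm_num)
      have h4 : (4 : ℝ) ^ (j₀ - 1) < B ^ ((2 : ℝ) / 3) := by
        have e4 : (4 : ℝ) ^ (j₀ - 1) = ((2 : ℝ) ^ (j₀ - 1)) ^ (2 : ℕ) := by
          rw [← pow_mul, mul_comm, pow_mul]; norm_num
        have eB : B ^ ((2 : ℝ) / 3) = (B ^ ((1 : ℝ) / 3)) ^ (2 : ℕ) := by
          rw [← Real.rpow_natCast, ← Real.rpow_mul hB0.le]; norm_num
        rw [e4, eB]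
        exact pow_lt_pow_left₀ h2 (by positivity) two_ne_zero
      have : (4 : ℝ) ^ j₀ = 4 * 4 ^ (j₀ - 1) := by
        rw [← pow_succ']; congr 1; omega
      rw [this]; linarith
  -- split the range at `j₀`
  have hterm1 : ∀ j ∈ Finset.range J, min 1 (B / 8 ^ j) * 4 ^ (j + 1) ≤
      (if j < j₀ then (4 : ℝ) ^ (j + 1) else 4 * B * (1 / 2) ^ j) := by
    intro j _
    split_ifs with hj
    · have : min 1 (B / 8 ^ j) ≤ 1 := min_le_left _ _
      have h4 : (0 : ℝ) ≤ 4 ^ (j + 1) := by positivity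
      nlinarith
    · have : min 1 (B / 8 ^ j) ≤ B / 8 ^ j := min_le_right _ _
      have h4 : (0 : ℝ) ≤ 4 ^ (j + 1) := by positivity
      calc min 1 (B / 8 ^ j) * 4 ^ (j + 1) ≤ B / 8 ^ j * 4 ^ (j + 1) := by nlinarith
        _ = 4 * B * (1 / 2) ^ j := by
          have e8 : (8 : ℝ) ^ j = 4 ^ j * 2 ^ j := by rw [← mul_pow]; norm_num
          rw [e8, one_div_pow, pow_succ]
          field_simp
  refine (Finset.sum_le_sum hterm1).trans ?_
  rw [Finset.sum_ite]
  -- first part: `∑_{j<J, j<j₀} 4^{j+1} ≤ ∑_{j<j₀} 4^{j+1} = (4^{j₀+1}-4)/3`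
  have hp1 : ∑ j ∈ (Finset.range J).filter (fun j => j < j₀), (4 : ℝ) ^ (j + 1) ≤ 4 / 3 * 4 ^ j₀ := by
    calc ∑ j ∈ (Finset.range J).filter (fun j => j < j₀), (4 : ℝ) ^ (j + 1)
        ≤ ∑ j ∈ Finset.range j₀, (4 : ℝ) ^ (j + 1) := by
          apply Finset.sum_le_sum_of_subset_of_nonneg
          · intro j; simp only [Finset.mem_filter, Finset.mem_range]; exact fun h => h.2
          · intros; positivity
      _ = 4 * ∑ j ∈ Finset.range j₀, (4 : ℝ) ^ j := by
          rw [Finset.mul_sum]; refine Finset.sum_congr rfl fun j _ => by ring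
      _ = 4 * ((4 ^ j₀ - 1) / 3) := by
          rw [geom_sum_eq (by norm_num : (4 : ℝ) ≠ 1)]; norm_num
      _ ≤ 4 / 3 * 4 ^ j₀ := by nlinarith [pow_pos (by norm_num : (0:ℝ) < 4) j₀]
  -- second part: `∑_{j<J, j ≥ j₀} 4B(1/2)^j ≤ 4B · 2 (1/2)^{j₀}`
  have hp2 : ∑ j ∈ (Finset.range J).filter (fun j => ¬ j < j₀), 4 * B * ((1 : ℝ) / 2) ^ j ≤
      8 * B * (1 / 2) ^ j₀ := by
    have hsub : (Finset.range J).filter (fun j => ¬ j < j₀) ⊆ Finset.Ico j₀ (max J j₀) := by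
      intro j; simp only [Finset.mem_filter, Finset.mem_range, Finset.mem_Ico, not_lt]
      exact fun h => ⟨h.2, lt_max_of_lt_left h.1⟩
    calc ∑ j ∈ (Finset.range J).filter (fun j => ¬ j < j₀), 4 * B * ((1 : ℝ) / 2) ^ j
        ≤ ∑ j ∈ Finset.Ico j₀ (max J j₀), 4 * B * ((1 : ℝ) / 2) ^ j :=
          Finset.sum_le_sum_of_subset_of_nonneg hsub (by intros; positivity)
      _ = 4 * B * ∑ j ∈ Finset.Ico j₀ (max J j₀), ((1 : ℝ) / 2) ^ j := by rw [Finset.mul_sum]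
      _ = 4 * B * (∑ i ∈ Finset.range (max J j₀ - j₀), ((1 : ℝ) / 2) ^ (j₀ + i)) := by
          rw [Finset.sum_Ico_eq_sum_range]
      _ = 4 * B * ((1 / 2) ^ j₀ * ∑ i ∈ Finset.range (max J j₀ - j₀), ((1 : ℝ) / 2) ^ i) := by
          congr 1; rw [Finset.mul_sum]; refine Finset.sum_congr rfl fun i _ => by rw [pow_add]
      _ ≤ 4 * B * ((1 / 2) ^ j₀ * 2) := by
          have hg : ∑ i ∈ Finset.range (max J j₀ - j₀), ((1 : ℝ) / 2) ^ i ≤ 2 := by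
            rw [geom_sum_eq (by norm_num : (1 / 2 : ℝ) ≠ 1)]
            have : (0 : ℝ) < (1 / 2) ^ (max J j₀ - j₀) := by positivity
            rw [div_le_iff_of_neg (by norm_num)]
            linarith
          have : (0 : ℝ) ≤ (1 / 2) ^ j₀ := by positivity
          have : 0 ≤ 4 * B := by linarith
          gcongr
      _ = 8 * B * (1 / 2) ^ j₀ := by ring
  -- `B (1/2)^{j₀} ≤ B^{2/3}` from `B^{1/3} ≤ 2^{j₀}`
  have hp2' : 8 * B * ((1 : ℝ) / 2) ^ j₀ ≤ 8 * B ^ ((2 : ℝ) / 3) := by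
    have h2pos : (0 : ℝ) < 2 ^ j₀ := by positivity
    have e : B * ((1 : ℝ) / 2) ^ j₀ = B / 2 ^ j₀ := by rw [one_div_pow]; ring
    rw [mul_assoc, e]
    have : B / 2 ^ j₀ ≤ B ^ ((2 : ℝ) / 3) := by
      rw [div_le_iff₀ h2pos]
      calc B = B ^ ((2 : ℝ) / 3) * B ^ ((1 : ℝ) / 3) := by
            rw [← Real.rpow_add hB0]; norm_num
        _ ≤ B ^ ((2 : ℝ) / 3) * 2 ^ j₀ := by gcongr
    linarith
  linarith

/-- `log 8 > 2`. [folklore] -/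
theorem two_lt_log_eight : (2 : ℝ) < Real.log 8 := by
  have : Real.log 8 = 3 * Real.log 2 := by
    rw [show (8 : ℝ) = 2 ^ 3 by norm_num, Real.log_pow]; norm_num
  rw [this]
  linarith [Real.log_two_gt_d9]

/-- `∑_{j<J} min(1, B/8^j) ≤ 3 + log B` for `B ≥ 1`. [folklore] -/
theorem sum_min_le {B : ℝ} (hB : 1 ≤ B) (J : ℕ) :
    ∑ j ∈ Finset.range J, min 1 (B / 8 ^ j) ≤ 3 + Real.log B := by
  obtain ⟨j₀, hj₀, hlt⟩ := exists_pow_eight_ge B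
  have hB0 : 0 < B := by linarith
  have hlogB : 0 ≤ Real.log B := Real.log_nonneg hB
  -- `j₀ ≤ 1 + log B / 2`
  have hj₀le : (j₀ : ℝ) ≤ 1 + Real.log B / 2 := by
    rcases Nat.eq_zero_or_pos j₀ with h0 | hpos
    · subst h0; simp; linarith
    · have hl : (8 : ℝ) ^ (j₀ - 1) < B := hlt _ (Nat.sub_lt hpos one_pos)
      have := Real.log_lt_log (by positivity) hl
      rw [Real.log_pow] at this
      have h8 := two_lt_log_eight
      have hc : ((j₀ - 1 : ℕ) : ℝ) = j₀ - 1 := by rw [Nat.cast_sub hpos]; simp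
      rw [hc] at this
      nlinarith
  have hterm : ∀ j ∈ Finset.range J, min 1 (B / 8 ^ j) ≤
      (if j < j₀ then (1 : ℝ) else B * (1 / 8) ^ j) := by
    intro j _
    split_ifs
    · exact min_le_left _ _
    · refine (min_le_right _ _).trans_eq ?_
      rw [one_div_pow, mul_one_div]
  refine (Finset.sum_le_sum hterm).trans ?_
  rw [Finset.sum_ite, Finset.sum_const, nsmul_eq_mul, mul_one]
  have hp1 : (((Finset.range J).filter (fun j => j < j₀)).card : ℝ) ≤ j₀ := by
    have : (Finset.range J).filter (fun j => j < j₀) ⊆ Finset.range j₀ := by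
      intro j; simp only [Finset.mem_filter, Finset.mem_range]; exact fun h => h.2
    have := Finset.card_le_card this
    rw [Finset.card_range] at this
    exact_mod_cast this
  have hp2 : ∑ j ∈ (Finset.range J).filter (fun j => ¬ j < j₀), B * ((1 : ℝ) / 8) ^ j ≤ 8 / 7 := by
    have hsub : (Finset.range J).filter (fun j => ¬ j < j₀) ⊆ Finset.Ico j₀ (max J j₀) := by
      intro j; simp only [Finset.mem_filter, Finset.mem_range, Finset.mem_Ico, not_lt]
      exact fun h => ⟨h.2, lt_max_of_lt_left h.1⟩
    calc ∑ j ∈ (Finset.range J).filter (fun j => ¬ j < j₀), B * ((1 : ℝ) / 8) ^ j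
        ≤ ∑ j ∈ Finset.Ico j₀ (max J j₀), B * ((1 : ℝ) / 8) ^ j :=
          Finset.sum_le_sum_of_subset_of_nonneg hsub (by intros; positivity)
      _ = B * ∑ j ∈ Finset.Ico j₀ (max J j₀), ((1 : ℝ) / 8) ^ j := by rw [Finset.mul_sum]
      _ = B * (∑ i ∈ Finset.range (max J j₀ - j₀), ((1 : ℝ) / 8) ^ (j₀ + i)) := by
          rw [Finset.sum_Ico_eq_sum_range]
      _ = B * (1 / 8) ^ j₀ * ∑ i ∈ Finset.range (max J j₀ - j₀), ((1 : ℝ) / 8) ^ i := by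
          rw [Finset.mul_sum, Finset.mul_sum]; refine Finset.sum_congr rfl fun i _ => by rw [pow_add]; ring
      _ ≤ 1 * (8 / 7) := by
          have hg : ∑ i ∈ Finset.range (max J j₀ - j₀), ((1 : ℝ) / 8) ^ i ≤ 8 / 7 := by
            rw [geom_sum_eq (by norm_num : (1 / 8 : ℝ) ≠ 1)]
            have : (0 : ℝ) < (1 / 8) ^ (max J j₀ - j₀) := by positivity
            rw [div_le_iff_of_neg (by norm_num)]
            linarith
          have h1 : B * ((1 : ℝ) / 8) ^ j₀ ≤ 1 := by
            rw [one_div_pow, mul_one_div, div_le_one (by positivity)]; exact hj₀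
          have h0 : 0 ≤ B * ((1 : ℝ) / 8) ^ j₀ := by positivity
          have hg0 : 0 ≤ ∑ i ∈ Finset.range (max J j₀ - j₀), ((1 : ℝ) / 8) ^ i :=
            Finset.sum_nonneg fun i _ => by positivity
          exact mul_le_mul h1 hg hg0 zero_le_one
      _ = 8 / 7 := by ring
  linarith

/-! ### Shells `2^j − 1 ≤ |t| < 2^{j+1} − 1` and the weighted large sieve -/

/-- The shell index of `t`: `j = ⌊log₂(⌊|t|⌋ + 1)⌋`, so that `2^j − 1 ≤ |t| < 2^{j+1} − 1`. [folklore] -/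
def shellIdx (t : ℝ) : ℕ := Nat.log 2 (⌊|t|⌋₊ + 1)

/-- `2^j − 1 ≤ |t| < 2^{j+1} − 1` for `j = shellIdx t`. [folklore] -/
theorem shellIdx_bounds (t : ℝ) :
    (2 : ℝ) ^ shellIdx t - 1 ≤ |t| ∧ |t| < (2 : ℝ) ^ (shellIdx t + 1) - 1 := by
  unfold shellIdx
  set n := ⌊|t|⌋₊ + 1 with hn
  have hn0 : n ≠ 0 := by omega
  have h1 : 2 ^ Nat.log 2 n ≤ n := Nat.pow_log_le_self 2 hn0
  have h2 : n < 2 ^ (Nat.log 2 n + 1) := Nat.lt_pow_succ_log_self one_lt_two n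
  have hfl : (⌊|t|⌋₊ : ℝ) ≤ |t| := Nat.floor_le (abs_nonneg t)
  have hfl' : |t| < ⌊|t|⌋₊ + 1 := Nat.lt_floor_add_one _
  constructor
  · have : (2 : ℝ) ^ Nat.log 2 n ≤ n := by exact_mod_cast h1
    rw [hn] at this; push_cast at this; linarith
  · have h2' : n + 1 ≤ 2 ^ (Nat.log 2 n + 1) := h2
    have : ((n + 1 : ℕ) : ℝ) ≤ (2 : ℝ) ^ (Nat.log 2 n + 1) := by exact_mod_cast h2'
    rw [hn] at this; push_cast at this; linarith

/-- On the shell `j`, `min(1, B/(1+|t|)³) ≤ min(1, B/8^j)`. [folklore] -/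
theorem weight_le_of_shell {B : ℝ} (hB : 0 ≤ B) {t : ℝ} {j : ℕ} (hj : (2 : ℝ) ^ j - 1 ≤ |t|) :
    min 1 (B / (1 + |t|) ^ 3) ≤ min 1 (B / 8 ^ j) := by
  refine min_le_min le_rfl ?_
  have h8 : (8 : ℝ) ^ j = ((2 : ℝ) ^ j) ^ 3 := by rw [← pow_mul, mul_comm, pow_mul]; norm_num
  rw [h8]
  apply div_le_div_of_nonneg_left hB (by positivity)
  exact pow_le_pow_left₀ (by positivity) (by linarith) 3

/-- **Weighted large sieve by dyadic shells (discrete spectra).**  If the partial sums of the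
non-negative `g` over `{|t_f| ≤ T}` are `≤ K(T² + D)` for every `T ≥ 1`, then
`∑_f min(1, B/(1+|t_f|)³) g_f ≤ K (14 B^{2/3} + (3 + log B) D)`. [cite: DeshouillersIwaniec1982, §9.1 p. 279] -/
theorem weighted_sum_le_of_largeSieve {α : Type*} (F : Finset α) (tv g : α → ℝ)
    (hg : ∀ f ∈ F, 0 ≤ g f) {K D B : ℝ} (hK : 0 ≤ K) (hD : 0 ≤ D) (hB : 1 ≤ B)
    (hLS : ∀ T : ℝ, 1 ≤ T → ∑ f ∈ F.filter (fun f => |tv f| ≤ T), g f ≤ K * (T ^ 2 + D)) :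
    ∑ f ∈ F, min 1 (B / (1 + |tv f|) ^ 3) * g f ≤
      K * (14 * B ^ ((2 : ℝ) / 3) + (3 + Real.log B) * D) := by
  classical
  have hB0 : 0 ≤ B := by linarith
  set sh : α → ℕ := fun f => shellIdx (tv f) with hsh
  -- fiberwise decomposition
  rw [← Finset.sum_fiberwise_of_maps_to (g := sh) (fun f hf => Finset.mem_image_of_mem sh hf)]
  -- each fiber
  have hfib : ∀ j ∈ F.image sh, ∑ f ∈ F.filter (fun f => sh f = j), min 1 (B / (1 + |tv f|) ^ 3) * g f ≤
      K * (min 1 (B / 8 ^ j) * (4 ^ (j + 1) + D)) := by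
    intro j _
    calc ∑ f ∈ F.filter (fun f => sh f = j), min 1 (B / (1 + |tv f|) ^ 3) * g f
        ≤ ∑ f ∈ F.filter (fun f => sh f = j), min 1 (B / 8 ^ j) * g f := by
          apply Finset.sum_le_sum
          intro f hf
          rw [Finset.mem_filter] at hf
          have hb := (shellIdx_bounds (tv f)).1
          rw [show shellIdx (tv f) = j from hf.2] at hb
          exact mul_le_mul_of_nonneg_right (weight_le_of_shell hB0 hb) (hg f hf.1)
      _ = min 1 (B / 8 ^ j) * ∑ f ∈ F.filter (fun f => sh f = j), g f := by rw [Finset.mul_sum]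
      _ ≤ min 1 (B / 8 ^ j) * ∑ f ∈ F.filter (fun f => |tv f| ≤ (2 : ℝ) ^ (j + 1)), g f := by
          apply mul_le_mul_of_nonneg_left _ (le_min zero_le_one (by positivity))
          apply Finset.sum_le_sum_of_subset_of_nonneg
          · intro f hf
            rw [Finset.mem_filter] at hf ⊢
            refine ⟨hf.1, ?_⟩
            have hb := (shellIdx_bounds (tv f)).2
            rw [show shellIdx (tv f) = j from hf.2] at hb
            linarith
          · intro f hf _; exact hg f (Finset.mem_filter.1 hf).1
      _ ≤ min 1 (B / 8 ^ j) * (K * (((2 : ℝ) ^ (j + 1)) ^ 2 + D)) := by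
          apply mul_le_mul_of_nonneg_left _ (le_min zero_le_one (by positivity))
          exact hLS _ (one_le_pow₀ (by norm_num))
      _ = K * (min 1 (B / 8 ^ j) * (4 ^ (j + 1) + D)) := by
          have : ((2 : ℝ) ^ (j + 1)) ^ 2 = 4 ^ (j + 1) := by
            rw [← pow_mul, mul_comm, pow_mul]; norm_num
          rw [this]; ring
  refine (Finset.sum_le_sum hfib).trans ?_
  rw [← Finset.mul_sum]
  apply mul_le_mul_of_nonneg_left _ hK
  -- pass to a full range
  obtain ⟨J, hJ⟩ : ∃ J : ℕ, F.image sh ⊆ Finset.range J :=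
    ⟨(F.image sh).sup id + 1, fun j hj => Finset.mem_range.2 (Nat.lt_succ_of_le (Finset.le_sup (f := id) hj))⟩
  calc ∑ j ∈ F.image sh, min 1 (B / 8 ^ j) * (4 ^ (j + 1) + D)
      ≤ ∑ j ∈ Finset.range J, min 1 (B / 8 ^ j) * (4 ^ (j + 1) + D) :=
        Finset.sum_le_sum_of_subset_of_nonneg hJ fun j _ _ =>
          mul_nonneg (le_min zero_le_one (by positivity)) (by positivity)
    _ = ∑ j ∈ Finset.range J, min 1 (B / 8 ^ j) * 4 ^ (j + 1) +
          (∑ j ∈ Finset.range J, min 1 (B / 8 ^ j)) * D := by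
        rw [Finset.sum_mul, ← Finset.sum_add_distrib]
        refine Finset.sum_congr rfl fun j _ => by ring
    _ ≤ 14 * B ^ ((2 : ℝ) / 3) + (3 + Real.log B) * D := by
        have h1 := sum_min_mul_four_pow_le hB J
        have h2 := sum_min_le hB J
        nlinarith

/-- The shells as sets. [folklore] -/
def shellSet (j : ℕ) : Set ℝ := {t | (2 : ℝ) ^ j - 1 ≤ |t| ∧ |t| < (2 : ℝ) ^ (j + 1) - 1}

/-- The shells are measurable. [folklore] -/
theorem measurableSet_shellSet (j : ℕ) : MeasurableSet (shellSet j) := by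
  unfold shellSet
  apply MeasurableSet.inter
  · exact measurableSet_le measurable_const continuous_abs.measurable
  · exact measurableSet_lt continuous_abs.measurable measurable_const

/-- `t ∈ shellSet j ↔ shellIdx t = j`. [folklore] -/
theorem mem_shellSet_iff (t : ℝ) (j : ℕ) : t ∈ shellSet j ↔ shellIdx t = j := by
  have hb := shellIdx_bounds t
  constructor
  · rintro ⟨h1, h2⟩
    -- both `j` and `shellIdx t` bracket `|t|`
    by_contra hne
    rcases Nat.lt_or_gt_of_ne hne with h | h
    · -- shellIdx t < j
      have : shellIdx t + 1 ≤ j := h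
      have hp : (2 : ℝ) ^ (shellIdx t + 1) ≤ 2 ^ j := pow_le_pow_right₀ (by norm_num) this
      linarith [hb.2]
    · have : j + 1 ≤ shellIdx t := h
      have hp : (2 : ℝ) ^ (j + 1) ≤ 2 ^ shellIdx t := pow_le_pow_right₀ (by norm_num) this
      linarith [hb.1]
  · rintro rfl; exact hb

/-- The shells are pairwise disjoint. [folklore] -/
theorem pairwise_disjoint_shellSet : Pairwise (Function.onFun Disjoint shellSet) := by
  intro i j hij
  rw [Function.onFun, Set.disjoint_left]
  intro t hi hj
  rw [mem_shellSet_iff] at hi hj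
  exact hij (hi.symm.trans hj)

/-- The shells cover `ℝ`. [folklore] -/
theorem iUnion_shellSet : (⋃ j, shellSet j) = Set.univ := by
  ext t
  simp only [Set.mem_iUnion, Set.mem_univ, iff_true]
  exact ⟨shellIdx t, (mem_shellSet_iff t _).2 rfl⟩

/-- **Weighted large sieve by dyadic shells (continuous spectrum, `lintegral` form).**
[cite: DeshouillersIwaniec1982, §9.1 p. 279] -/
theorem weighted_lintegral_le_of_largeSieve (G : ℝ → ℝ≥0∞) {K D B : ℝ} (hK : 0 ≤ K) (hD : 0 ≤ D)
    (hB : 1 ≤ B)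
    (hLS : ∀ T : ℝ, 1 ≤ T → ∫⁻ t in Set.Icc (-T) T, G t ≤ ENNReal.ofReal (K * (T ^ 2 + D))) :
    ∫⁻ t, ENNReal.ofReal (min 1 (B / (1 + |t|) ^ 3)) * G t ≤
      ENNReal.ofReal (K * (14 * B ^ ((2 : ℝ) / 3) + (3 + Real.log B) * D)) := by
  have hB0 : 0 ≤ B := by linarith
  have hsplit : ∫⁻ t, ENNReal.ofReal (min 1 (B / (1 + |t|) ^ 3)) * G t =
      ∑' j, ∫⁻ t in shellSet j, ENNReal.ofReal (min 1 (B / (1 + |t|) ^ 3)) * G t := by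
    rw [← MeasureTheory.lintegral_iUnion measurableSet_shellSet pairwise_disjoint_shellSet,
      iUnion_shellSet, MeasureTheory.setLIntegral_univ]
  rw [hsplit]
  -- each shell
  have hshell : ∀ j : ℕ, ∫⁻ t in shellSet j, ENNReal.ofReal (min 1 (B / (1 + |t|) ^ 3)) * G t ≤
      ENNReal.ofReal (K * (min 1 (B / 8 ^ j) * (4 ^ (j + 1) + D))) := by
    intro j
    calc ∫⁻ t in shellSet j, ENNReal.ofReal (min 1 (B / (1 + |t|) ^ 3)) * G t
        ≤ ∫⁻ t in shellSet j, ENNReal.ofReal (min 1 (B / 8 ^ j)) * G t := by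
          apply MeasureTheory.setLIntegral_mono' (measurableSet_shellSet j)
          intro t ht
          exact mul_le_mul_of_nonneg_right (ENNReal.ofReal_le_ofReal (weight_le_of_shell hB0 ht.1))
            bot_le
      _ = ENNReal.ofReal (min 1 (B / 8 ^ j)) * ∫⁻ t in shellSet j, G t := by
          rw [MeasureTheory.lintegral_const_mul' _ _ ENNReal.ofReal_ne_top]
      _ ≤ ENNReal.ofReal (min 1 (B / 8 ^ j)) * ∫⁻ t in Set.Icc (-(2 : ℝ) ^ (j + 1)) ((2 : ℝ) ^ (j + 1)), G t := by
          refine mul_le_mul_of_nonneg_left ?_ bot_le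
          apply MeasureTheory.lintegral_mono_set
          intro t ht
          have h2 := ht.2
          rw [Set.mem_Icc, ← abs_le]
          linarith
      _ ≤ ENNReal.ofReal (min 1 (B / 8 ^ j)) * ENNReal.ofReal (K * (((2 : ℝ) ^ (j + 1)) ^ 2 + D)) := by
          refine mul_le_mul_of_nonneg_left ?_ bot_le
          exact hLS _ (one_le_pow₀ (by norm_num))
      _ = ENNReal.ofReal (K * (min 1 (B / 8 ^ j) * (4 ^ (j + 1) + D))) := by
          rw [← ENNReal.ofReal_mul (le_min zero_le_one (by positivity))]
          have : ((2 : ℝ) ^ (j + 1)) ^ 2 = 4 ^ (j + 1) := by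
            rw [← pow_mul, mul_comm, pow_mul]; norm_num
          rw [this]; congr 1; ring
  refine (ENNReal.tsum_le_tsum hshell).trans ?_
  rw [ENNReal.tsum_eq_iSup_nat]
  refine iSup_le fun J => ?_
  rw [← ENNReal.ofReal_sum_of_nonneg (fun j _ => by
    exact mul_nonneg hK (mul_nonneg (le_min zero_le_one (by positivity)) (by positivity)))]
  apply ENNReal.ofReal_le_ofReal
  rw [← Finset.mul_sum]
  apply mul_le_mul_of_nonneg_left _ hK
  calc ∑ j ∈ Finset.range J, min 1 (B / 8 ^ j) * (4 ^ (j + 1) + D)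
      = ∑ j ∈ Finset.range J, min 1 (B / 8 ^ j) * 4 ^ (j + 1) +
          (∑ j ∈ Finset.range J, min 1 (B / 8 ^ j)) * D := by
        rw [Finset.sum_mul, ← Finset.sum_add_distrib]
        refine Finset.sum_congr rfl fun j _ => by ring
    _ ≤ 14 * B ^ ((2 : ℝ) / 3) + (3 + Real.log B) * D := by
        have h1 := sum_min_mul_four_pow_le hB J
        have h2 := sum_min_le hB J
        nlinarith




/-! ### Abstract spectral data and the Kuznetsov package (DI §1.1–1.3 / Drappeau §4.1–4.2) -/

/-- **Abstract spectral data at one level** `q` (for `Γ₀(q)`, trivial nebentypus, the cusps `∞` and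
`0 ≅ 1/1`): index types for the discrete spectrum (`ι`: Maass cusp forms with real spectral parameter
`t_f`; `ιe`: the exceptional ones, `t_f = i y_f`, `0 < y_f ≤ 1/4` by Selberg's `λ₁ ≥ 3/16`
[DeshouillersIwaniec1982, Theorem 4]), the number `nc` of singular cusps (continuous spectrum), the
holomorphic cusp forms `ιh` with their weights `wt`, and the ARRAYS of normalised Fourier coefficients
entering Kuznetsov's formula: `P f m` resp. `Q f n` stand for `√m ρ_{f∞}(m)` resp. `√|n| ρ_{f0}(n)`
(Drappeau's normalisation, [Drappeau2017, (4.17)–(4.22)]), `Pe, Qe` the same for exceptional forms,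
`PE 𝔠 t m`, `QE 𝔠 t n` for `√m ρ_{𝔠∞}(m, t)`, `√|n| ρ_{𝔠0}(n, t)` (Eisenstein series at `1/2 + it`,
measurable in `t`), `PH, QH` for `√m ρ_{f∞}(m)`, `√n ρ_{f0}(n)` of holomorphic forms.  Nothing is
assumed about these arrays beyond the hypotheses `KuzPlus`, …, `ExcSeven` below (cf. [Drappeau2017,
p. 10]: "we do not use any information about the Fourier coefficients … other than the fact that
Kuznetsov's formula holds").
[cite: DeshouillersIwaniec1982, §1.1–1.2 (1.15)–(1.20); Drappeau2017, §4.1.3] -/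
structure SpecData where
  /-- Maass cusp forms with real spectral parameter. -/
  ι : Type
  /-- The spectral parameters `t_f ∈ ℝ` (`λ_f = 1/4 + t_f²`). -/
  t : ι → ℝ
  /-- Exceptional Maass cusp forms (`λ_f < 1/4`). -/
  ιe : Type
  /-- `y_f = |Im t_f|`, `λ_f = 1/4 − y_f²`. -/
  y : ιe → ℝ
  /-- Selberg's bound `λ₁ ≥ 3/16`: `0 < y_f ≤ 1/4`. -/
  hy : ∀ f, 0 < y f ∧ y f ≤ 1 / 4
  /-- Number of singular cusps (continuous spectrum). -/
  nc : ℕ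
  /-- Holomorphic cusp forms (an orthonormal basis in each weight). -/
  ιh : Type
  /-- The weight of a holomorphic form. -/
  wt : ιh → ℕ
  /-- `√m ρ_{f∞}(m)`. -/
  P : ι → ℕ → ℂ
  /-- `√|n| ρ_{f0}(n)`, `n ∈ ℤ`. -/
  Q : ι → ℤ → ℂ
  /-- `√m ρ_{f∞}(m)`, exceptional `f`. -/
  Pe : ιe → ℕ → ℂ
  /-- `√|n| ρ_{f0}(n)`, exceptional `f`. -/
  Qe : ιe → ℤ → ℂ
  /-- `√m ρ_{𝔠∞}(m, t)`. -/
  PE : Fin nc → ℝ → ℕ → ℂ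
  /-- `√|n| ρ_{𝔠0}(n, t)`. -/
  QE : Fin nc → ℝ → ℤ → ℂ
  /-- Measurability in `t`. -/
  mPE : ∀ 𝔠 m, Measurable fun t => PE 𝔠 t m
  /-- Measurability in `t`. -/
  mQE : ∀ 𝔠 n, Measurable fun t => QE 𝔠 t n
  /-- `√m ρ_{f∞}(m)`, holomorphic `f`. -/
  PH : ιh → ℕ → ℂ
  /-- `√n ρ_{f0}(n)`, holomorphic `f`. -/
  QH : ιh → ℕ → ℂ

/-- **Abstract Kuznetsov–Bessel transforms** `φ ↦ φ̃(t)` (`Tpl`, sign `+`, real `t`), `φ ↦ φ̌(t)`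
(`Tmi`, sign `−`), their values at the exceptional parameters `t = iy` (`TplX φ y`, `TmiX φ y`), and
`φ ↦ φ̇(k)` (`Thol`); in reality [Drappeau2017, (4.12)–(4.13) with `κ = 0`]
`φ̃(t) = (2πi/sinh πt) ∫ (J_{2it} − J_{−2it})(x) φ(x) dx/x`, `φ̌(t) = 8 cosh(πt) ∫ K_{2it}(x) φ(x) dx/x`,
`φ̇(k) = 4 i^k ∫ J_{k−1}(x) φ(x) dx/x` ([DeshouillersIwaniec1982, (1.21)–(1.23)] up to normalisation).
Only the bounds `TransformBound` are ever used. [cite: Drappeau2017, §4.1.3 (4.12)–(4.13)] -/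
structure KuzTransforms where
  /-- `φ̃(t)`, `t ∈ ℝ`. -/
  Tpl : (ℝ → ℂ) → ℝ → ℂ
  /-- `φ̌(t)`, `t ∈ ℝ`. -/
  Tmi : (ℝ → ℂ) → ℝ → ℂ
  /-- `φ̃(iy)`. -/
  TplX : (ℝ → ℂ) → ℝ → ℂ
  /-- `φ̌(iy)`. -/
  TmiX : (ℝ → ℂ) → ℝ → ℂ
  /-- `φ̇(k)`. -/
  Thol : (ℝ → ℂ) → ℕ → ℂ

/-- Admissible test functions for Kuznetsov's formula: smooth with compact support in `(0, ∞)`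
([DeshouillersIwaniec1982, Theorem 1]; [Drappeau2017, (4.11)] allows more). [cite: DeshouillersIwaniec1982, §1.2 Theorem 1] -/
def KuzAdmissible (φ : ℝ → ℂ) : Prop :=
  ContDiff ℝ ∞ φ ∧ HasCompactSupport φ ∧ tsupport φ ⊆ Set.Ioi 0

/-- The **Kloosterman side** of Kuznetsov's formula at level `r` for the cusp pair `(∞, 0)` of `Γ₀(r)`
in classical terms: the summand `c ↦ (c√r)⁻¹ φ(4π√(mn)/(c√r)) S(h, n r̄; c)` for `c ≥ 1`, `(c, r) = 1`
(and `0` otherwise), where `S(h, n r̄; c) = kl c r n h` is the Kloosterman sum `S_{∞0}(h, n; c√r)` of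
`Γ₀(r)` for Iwaniec's scaling matrix `σ₀ = (0, −1/√r; √r, 0)` [Iwaniec, GSM 53, p. 35; in the tree:
`Automorphic.Fuchsian.cuspKloosterman_Gamma0`], equivalently DI's `S_{∞,1/s}` at `s = 1`
[DeshouillersIwaniec1982, (1.6)]; `h = m` for the sign `+` and `h = −m` for the sign `−`
(`S(−m, n r̄; c) = S_{∞0}(m, −n; c√r)`). [cite: DeshouillersIwaniec1982, (1.6), (9.2)] -/
def kloosSide (r : ℕ) (φ : ℝ → ℂ) (m n : ℕ) (h : ℤ) (c : ℕ) : ℂ :=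
  if 1 ≤ c ∧ r.Coprime c then ((((c : ℝ) * Real.sqrt r)⁻¹ : ℝ) : ℂ) * φ (xK m n r c) * kl c r n h else 0

/-- **Hypothesis (K+): Kuznetsov's formula, sign `+`** [Drappeau2017, Lemma 4.5 (4.15) with `κ = 0`,
`q ↦ r`, trivial character, `𝔞 = ∞`, `𝔟 = 0`; DeshouillersIwaniec1982, Theorem 1 (1.19)], for the
abstract data `D r` and transforms `W`, for every level `r ≥ 1`, every admissible `φ` and all
`m, n ≥ 1`:
`∑_{(c,r)=1} (c√r)⁻¹ φ(4π√(mn)/(c√r)) S_{∞0}(m, n; c√r) = 𝓜 + 𝓜_exc + 𝓔 + 𝓗` with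
`𝓜 = ∑_f φ̃(t_f)/cosh(πt_f) · conj(√m ρ_{f∞}(m)) √n ρ_{f0}(n)` (regular `f`), `𝓜_exc` the same over
the exceptional forms (`t_f = iy_f`, `cosh(πt_f) = cos(πy_f)`),
`𝓔 = ∑_𝔠 (1/4π) ∫ φ̃(t)/cosh(πt) conj(√m ρ_{𝔠∞}(m,t)) √n ρ_{𝔠0}(n,t) dt`,
`𝓗 = ∑_f φ̇(k_f) Γ(k_f) conj(√m ρ_{f∞}(m)) √n ρ_{f0}(n)`, all series converging (`HasSum`) and the
Eisenstein integrands integrable. [cite: Drappeau2017, Lemma 4.5 (4.15), (4.17)–(4.19); DeshouillersIwaniec1982, Theorem 1 (1.19)] -/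
def KuzPlus (D : ℕ → SpecData) (W : KuzTransforms) : Prop :=
  ∀ r : ℕ, 1 ≤ r → ∀ φ : ℝ → ℂ, KuzAdmissible φ → ∀ m n : ℕ, 1 ≤ m → 1 ≤ n →
    ∃ vM vX vH : ℂ,
      HasSum (fun f : (D r).ι => W.Tpl φ ((D r).t f) / (Real.cosh (π * (D r).t f) : ℂ) *
        conj ((D r).P f m) * (D r).Q f n) vM ∧
      HasSum (fun f : (D r).ιe => W.TplX φ ((D r).y f) / (Real.cos (π * (D r).y f) : ℂ) *
        conj ((D r).Pe f m) * (D r).Qe f n) vX ∧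
      (∀ 𝔠, Integrable (fun t : ℝ => W.Tpl φ t / (Real.cosh (π * t) : ℂ) *
        conj ((D r).PE 𝔠 t m) * (D r).QE 𝔠 t n)) ∧
      HasSum (fun f : (D r).ιh => W.Thol φ ((D r).wt f) * (Real.Gamma ((D r).wt f) : ℂ) *
        conj ((D r).PH f m) * (D r).QH f n) vH ∧
      HasSum (kloosSide r φ m n m) (vM + vX +
        (∑ 𝔠, (1 / (4 * π) : ℂ) * ∫ t : ℝ, W.Tpl φ t / (Real.cosh (π * t) : ℂ) *
          conj ((D r).PE 𝔠 t m) * (D r).QE 𝔠 t n) + vH)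

/-- **Hypothesis (K−): Kuznetsov's formula, sign `−`** [Drappeau2017, Lemma 4.5 (4.16) with `κ = 0`;
DeshouillersIwaniec1982, Theorem 1 (1.20)]: for `r ≥ 1`, admissible `φ`, `m, n ≥ 1`,
`∑_{(c,r)=1} (c√r)⁻¹ φ(4π√(mn)/(c√r)) S_{∞0}(m, −n; c√r) = 𝓜' + 𝓜'_exc + 𝓔'` with `φ̌` in place of
`φ̃`, the coefficients `ρ_{f0}(−n)`, `ρ_{𝔠0}(−n, t)`, and no holomorphic term.
[cite: Drappeau2017, Lemma 4.5 (4.16), (4.21)–(4.22); DeshouillersIwaniec1982, Theorem 1 (1.20)] -/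
def KuzMinus (D : ℕ → SpecData) (W : KuzTransforms) : Prop :=
  ∀ r : ℕ, 1 ≤ r → ∀ φ : ℝ → ℂ, KuzAdmissible φ → ∀ m n : ℕ, 1 ≤ m → 1 ≤ n →
    ∃ vM vX : ℂ,
      HasSum (fun f : (D r).ι => W.Tmi φ ((D r).t f) / (Real.cosh (π * (D r).t f) : ℂ) *
        conj ((D r).P f m) * (D r).Q f (-(n : ℤ))) vM ∧
      HasSum (fun f : (D r).ιe => W.TmiX φ ((D r).y f) / (Real.cos (π * (D r).y f) : ℂ) *
        conj ((D r).Pe f m) * (D r).Qe f (-(n : ℤ))) vX ∧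
      (∀ 𝔠, Integrable (fun t : ℝ => W.Tmi φ t / (Real.cosh (π * t) : ℂ) *
        conj ((D r).PE 𝔠 t m) * (D r).QE 𝔠 t (-(n : ℤ)))) ∧
      HasSum (kloosSide r φ m n (-(m : ℤ))) (vM + vX +
        ∑ 𝔠, (1 / (4 * π) : ℂ) * ∫ t : ℝ, W.Tmi φ t / (Real.cosh (π * t) : ℂ) *
          conj ((D r).PE 𝔠 t m) * (D r).QE 𝔠 t (-(n : ℤ)))

/-- The size factor `Λ(X) = (1 + |log X|)/(1 + X)` of the transform bounds. [cite: DeshouillersIwaniec1982, Lemma 7.1 (7.2); Drappeau2017, Lemma 4.4 (4.14)] -/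
def LamT (X : ℝ) : ℝ := (1 + |Real.log X|) / (1 + X)

/-- The decay factor `ω_X(t) = min(1, ((1 + X)/(1 + |t|))³)` of the transform bounds: no decay for
`|t| ≤ X`, cubic decay beyond (the shape of [DeshouillersIwaniec1982, Lemma 7.1 (7.2)–(7.4)]: bounded by
`Λ(X)` for all `t`, and by `|t|^{-3}`-type bounds with at most two extra powers of `1 + X` for `|t| ≥ 1`;
see "Faithfulness of hypothesis (W)" in the module docstring for why the printed decay factor
`min(1, (1+X^{3/2})/(1+|t|³))` of [Drappeau2017, (4.14)] is NOT used).
[cite: DeshouillersIwaniec1982, Lemma 7.1 (7.2)–(7.4)] -/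
def omegaT (X t : ℝ) : ℝ := min 1 ((1 + X) ^ 3 / (1 + |t|) ^ 3)

/-- **Hypothesis (W): the transform bounds** in the shape of [DeshouillersIwaniec1982, Lemma 7.1]
(cf. [Drappeau2017, Lemma 4.4]): for `φ` smooth, supported in `[X, 2X]`, `|φ^{(j)}| ≤ X^{-j}`
(`j ≤ 4`): `|φ̃(t)|, |φ̌(t)|, |φ̇(k)| ≤ A Λ(X) ω_X(t)` for real `t` (resp. `t = k`), where
`Λ(X) = (1+|log X|)/(1+X)` ((7.2)) and `ω_X(t) = min(1, ((1+X)/(1+|t|))³)` (the decay (7.3)–(7.4) in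
`|t|`, with the powers of `1 + X` that the holomorphic transform requires), and, for the exceptional
parameters `t = iy`, `0 < y ≤ 1/4`: `|φ̃(iy)|, |φ̌(iy)| ≤ A Λ(X) (1 + X^{−2y})` ((7.1) up to the factor
`1 + |log X|`, which is necessary as `y → 0⁺`), with an absolute constant `A`.  This is WEAKER than
(implied by) the literal transcription of [Drappeau2017, (4.14)] and of [DeshouillersIwaniec1982, (7.1)];
see "Faithfulness of hypothesis (W)" in the module docstring.
[cite: DeshouillersIwaniec1982, Lemma 7.1 (7.1)–(7.4); Drappeau2017, Lemma 4.4 (4.14)] -/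
def TransformBoundAt (W : KuzTransforms) (A : ℝ) : Prop :=
  ∀ X : ℝ, 0 < X → ∀ φ : ℝ → ℂ, ContDiff ℝ ∞ φ →
    (∀ x, φ x ≠ 0 → x ∈ Set.Icc X (2 * X)) →
    (∀ j ≤ 4, ∀ x, ‖iteratedDeriv j φ x‖ ≤ X ^ (-(j : ℝ))) →
    (∀ t : ℝ, ‖W.Tpl φ t‖ ≤ A * LamT X * omegaT X t) ∧ (∀ t : ℝ, ‖W.Tmi φ t‖ ≤ A * LamT X * omegaT X t) ∧
    (∀ k : ℕ, ‖W.Thol φ k‖ ≤ A * LamT X * omegaT X k) ∧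
    (∀ y : ℝ, 0 < y → y ≤ 1 / 4 →
      ‖W.TplX φ y‖ ≤ A * LamT X * (1 + X ^ (-2 * y)) ∧ ‖W.TmiX φ y‖ ≤ A * LamT X * (1 + X ^ (-2 * y)))

/-- `TransformBound`: some absolute constant `A ≥ 0` works in `TransformBoundAt`. [cite: DeshouillersIwaniec1982, Lemma 7.1; Drappeau2017, Lemma 4.4 (4.14)] -/
def TransformBound (W : KuzTransforms) : Prop :=
  ∃ A : ℝ, 0 ≤ A ∧ TransformBoundAt W A

/-- `‖a‖² = ∑_{n ∼ N} |a_n|²` over the dyadic range. [folklore] -/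
def l2sq (N : ℝ) (a : ℕ → ℂ) : ℝ := ∑ n ∈ dyadic N, ‖a n‖ ^ 2

/-- **Hypothesis (LS, cusp `∞`, discrete spectrum)** [Drappeau2017, Prop. 4.7 (4.20), `𝔞 = ∞`,
`μ(∞) = 1/r`, `q₀ = 1`; DeshouillersIwaniec1982, Theorem 2 (1.29)]: for `T ≥ 1`, `N ≥ 1/2`,
`∑_{|t_f| ≤ T} (cosh πt_f)⁻¹ |∑_{n∼N} a_n √n ρ_{f∞}(n)|² ≤ K_ε (T² + N^{1+ε}/r) ‖a‖²` (the sum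
including the exceptional forms, for which `cosh(πt_f) = cos(πy_f)`), here for all finite subfamilies.
[cite: Drappeau2017, Prop. 4.7 (4.20); DeshouillersIwaniec1982, Theorem 2 (1.29)] -/
def LSMaassInfAt (D : ℕ → SpecData) (ε K : ℝ) : Prop :=
  ∀ r : ℕ, 1 ≤ r → ∀ T N : ℝ, 1 ≤ T → 1 / 2 ≤ N → ∀ a : ℕ → ℂ,
    ∀ F : Finset (D r).ι, (∀ f ∈ F, |(D r).t f| ≤ T) → ∀ Fe : Finset (D r).ιe,
      ∑ f ∈ F, ‖∑ n ∈ dyadic N, a n * (D r).P f n‖ ^ 2 / Real.cosh (π * (D r).t f) +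
        ∑ f ∈ Fe, ‖∑ n ∈ dyadic N, a n * (D r).Pe f n‖ ^ 2 / Real.cos (π * (D r).y f) ≤
        K * (T ^ 2 + N ^ (1 + ε) / r) * l2sq N a

/-- `LSMaassInf`: for every `ε > 0` some constant `K ≥ 0` works in `LSMaassInfAt`. [cite: Drappeau2017, §4.2; DeshouillersIwaniec1982, §1.2–1.3] -/
def LSMaassInf (D : ℕ → SpecData) : Prop :=
  ∀ ε : ℝ, 0 < ε → ∃ K : ℝ, 0 ≤ K ∧ LSMaassInfAt D ε K

/-- **Hypothesis (LS, cusp `0`, discrete spectrum, both signs)** [Drappeau2017, Prop. 4.7 (4.20) with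
`ρ_{f𝔞}(±n)`, `𝔞 = 0`, `μ(0) = 1/r`; DeshouillersIwaniec1982, Theorem 2 (1.29)].
[cite: Drappeau2017, Prop. 4.7 (4.20); DeshouillersIwaniec1982, Theorem 2 (1.29)] -/
def LSMaassZeroAt (D : ℕ → SpecData) (ε K : ℝ) : Prop :=
  ∀ r : ℕ, 1 ≤ r → ∀ T N : ℝ, 1 ≤ T → 1 / 2 ≤ N → ∀ a : ℕ → ℂ,
    ∀ s : ℤ, (s = 1 ∨ s = -1) →
    ∀ F : Finset (D r).ι, (∀ f ∈ F, |(D r).t f| ≤ T) → ∀ Fe : Finset (D r).ιe,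
      ∑ f ∈ F, ‖∑ n ∈ dyadic N, a n * (D r).Q f (s * n)‖ ^ 2 / Real.cosh (π * (D r).t f) +
        ∑ f ∈ Fe, ‖∑ n ∈ dyadic N, a n * (D r).Qe f (s * n)‖ ^ 2 / Real.cos (π * (D r).y f) ≤
        K * (T ^ 2 + N ^ (1 + ε) / r) * l2sq N a

/-- `LSMaassZero`: for every `ε > 0` some constant `K ≥ 0` works in `LSMaassZeroAt`. [cite: Drappeau2017, §4.2; DeshouillersIwaniec1982, §1.2–1.3] -/
def LSMaassZero (D : ℕ → SpecData) : Prop :=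
  ∀ ε : ℝ, 0 < ε → ∃ K : ℝ, 0 ≤ K ∧ LSMaassZeroAt D ε K

/-- **Hypothesis (LS, cusp `∞`, continuous spectrum)** [Drappeau2017, Prop. 4.7 (4.21), `𝔞 = ∞`;
DeshouillersIwaniec1982, Theorem 2 (1.30)]:
`∑_𝔠 ∫_{-T}^{T} (cosh πt)⁻¹ |∑_{n∼N} a_n √n ρ_{𝔠∞}(n, t)|² dt ≤ K_ε (T² + N^{1+ε}/r) ‖a‖²`
(integrand integrable). [cite: Drappeau2017, Prop. 4.7 (4.21); DeshouillersIwaniec1982, Theorem 2 (1.30)] -/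
def LSEisInfAt (D : ℕ → SpecData) (ε K : ℝ) : Prop :=
  ∀ r : ℕ, 1 ≤ r → ∀ T N : ℝ, 1 ≤ T → 1 / 2 ≤ N → ∀ a : ℕ → ℂ,
    IntegrableOn (fun t : ℝ => ∑ 𝔠, ‖∑ n ∈ dyadic N, a n * (D r).PE 𝔠 t n‖ ^ 2 / Real.cosh (π * t))
        (Set.Icc (-T) T) ∧
      ∫ t in Set.Icc (-T) T, ∑ 𝔠, ‖∑ n ∈ dyadic N, a n * (D r).PE 𝔠 t n‖ ^ 2 / Real.cosh (π * t) ≤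
        K * (T ^ 2 + N ^ (1 + ε) / r) * l2sq N a

/-- `LSEisInf`: for every `ε > 0` some constant `K ≥ 0` works in `LSEisInfAt`. [cite: Drappeau2017, §4.2; DeshouillersIwaniec1982, §1.2–1.3] -/
def LSEisInf (D : ℕ → SpecData) : Prop :=
  ∀ ε : ℝ, 0 < ε → ∃ K : ℝ, 0 ≤ K ∧ LSEisInfAt D ε K

/-- **Hypothesis (LS, cusp `0`, continuous spectrum, both signs)** [Drappeau2017, Prop. 4.7 (4.21)
with `ρ_{𝔠𝔞}(±n, t)`, `𝔞 = 0`; DeshouillersIwaniec1982, Theorem 2 (1.30)].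
[cite: Drappeau2017, Prop. 4.7 (4.21); DeshouillersIwaniec1982, Theorem 2 (1.30)] -/
def LSEisZeroAt (D : ℕ → SpecData) (ε K : ℝ) : Prop :=
  ∀ r : ℕ, 1 ≤ r → ∀ T N : ℝ, 1 ≤ T → 1 / 2 ≤ N → ∀ a : ℕ → ℂ,
    ∀ s : ℤ, (s = 1 ∨ s = -1) →
    IntegrableOn (fun t : ℝ => ∑ 𝔠, ‖∑ n ∈ dyadic N, a n * (D r).QE 𝔠 t (s * n)‖ ^ 2 / Real.cosh (π * t))
        (Set.Icc (-T) T) ∧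
      ∫ t in Set.Icc (-T) T, ∑ 𝔠, ‖∑ n ∈ dyadic N, a n * (D r).QE 𝔠 t (s * n)‖ ^ 2 / Real.cosh (π * t) ≤
        K * (T ^ 2 + N ^ (1 + ε) / r) * l2sq N a

/-- `LSEisZero`: for every `ε > 0` some constant `K ≥ 0` works in `LSEisZeroAt`. [cite: Drappeau2017, §4.2; DeshouillersIwaniec1982, §1.2–1.3] -/
def LSEisZero (D : ℕ → SpecData) : Prop :=
  ∀ ε : ℝ, 0 < ε → ∃ K : ℝ, 0 ≤ K ∧ LSEisZeroAt D ε K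

/-- **Hypothesis (LS, cusp `∞`, holomorphic forms)** [Drappeau2017, Prop. 4.7 (4.19), `𝔞 = ∞`;
DeshouillersIwaniec1982, Theorem 2 (1.28)]:
`∑_{k ≤ T} Γ(k) ∑_{f ∈ B_k} |∑_{n∼N} a_n √n ρ_{f∞}(n)|² ≤ K_ε (T² + N^{1+ε}/r) ‖a‖²`.
[cite: Drappeau2017, Prop. 4.7 (4.19); DeshouillersIwaniec1982, Theorem 2 (1.28)] -/
def LSHolInfAt (D : ℕ → SpecData) (ε K : ℝ) : Prop :=
  ∀ r : ℕ, 1 ≤ r → ∀ T N : ℝ, 1 ≤ T → 1 / 2 ≤ N → ∀ a : ℕ → ℂ,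
    ∀ F : Finset (D r).ιh, (∀ f ∈ F, ((D r).wt f : ℝ) ≤ T) →
      ∑ f ∈ F, Real.Gamma ((D r).wt f) * ‖∑ n ∈ dyadic N, a n * (D r).PH f n‖ ^ 2 ≤
        K * (T ^ 2 + N ^ (1 + ε) / r) * l2sq N a

/-- `LSHolInf`: for every `ε > 0` some constant `K ≥ 0` works in `LSHolInfAt`. [cite: Drappeau2017, §4.2; DeshouillersIwaniec1982, §1.2–1.3] -/
def LSHolInf (D : ℕ → SpecData) : Prop :=
  ∀ ε : ℝ, 0 < ε → ∃ K : ℝ, 0 ≤ K ∧ LSHolInfAt D ε K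

/-- **Hypothesis (LS, cusp `0`, holomorphic forms)** [Drappeau2017, Prop. 4.7 (4.19), `𝔞 = 0`;
DeshouillersIwaniec1982, Theorem 2 (1.28)]. [cite: Drappeau2017, Prop. 4.7 (4.19); DeshouillersIwaniec1982, Theorem 2 (1.28)] -/
def LSHolZeroAt (D : ℕ → SpecData) (ε K : ℝ) : Prop :=
  ∀ r : ℕ, 1 ≤ r → ∀ T N : ℝ, 1 ≤ T → 1 / 2 ≤ N → ∀ a : ℕ → ℂ,
    ∀ F : Finset (D r).ιh, (∀ f ∈ F, ((D r).wt f : ℝ) ≤ T) →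
      ∑ f ∈ F, Real.Gamma ((D r).wt f) * ‖∑ n ∈ dyadic N, a n * (D r).QH f n‖ ^ 2 ≤
        K * (T ^ 2 + N ^ (1 + ε) / r) * l2sq N a

/-- `LSHolZero`: for every `ε > 0` some constant `K ≥ 0` works in `LSHolZeroAt`. [cite: Drappeau2017, §4.2; DeshouillersIwaniec1982, §1.2–1.3] -/
def LSHolZero (D : ℕ → SpecData) : Prop :=
  ∀ ε : ℝ, 0 < ε → ∃ K : ℝ, 0 ≤ K ∧ LSHolZeroAt D ε K

/-- **Hypothesis (E5): the weighted large sieve for the exceptional spectrum at an individual level**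
[Drappeau2017, Lemma 4.8 with `𝔞 = 0`, `μ(0) = 1/r`, `q₀ = 1`; DeshouillersIwaniec1982, Theorem 5
(1.38)], both signs (for an even–odd eigenbasis `ρ_{f0}(−n) = ±ρ_{f0}(n)`): for `Y ≥ 1`, `N ≥ 1/2`,
`∑_{f exc} Y^{2|t_f|} |∑_{n∼N} a_n √n ρ_{f0}(±n)|² ≤ K_ε (1 + √(NY/r)) (1 + √(N/r) N^ε) ‖a‖²`
(Drappeau prints the second factor as `1 + (q₀ μ N)^{1/2+ε} = 1 + (N/r)^{1/2+ε} ≤ 1 + √(N/r) N^ε`,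
so the present form is implied by the printed one).
[cite: Drappeau2017, Lemma 4.8; DeshouillersIwaniec1982, Theorem 5 (1.38)] -/
def ExcFiveAt (D : ℕ → SpecData) (ε K : ℝ) : Prop :=
  ∀ r : ℕ, 1 ≤ r → ∀ Y N : ℝ, 1 ≤ Y → 1 / 2 ≤ N → ∀ a : ℕ → ℂ,
    ∀ s : ℤ, (s = 1 ∨ s = -1) → ∀ Fe : Finset (D r).ιe,
      ∑ f ∈ Fe, Y ^ (2 * (D r).y f) * ‖∑ n ∈ dyadic N, a n * (D r).Qe f (s * n)‖ ^ 2 ≤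
        K * (1 + Real.sqrt (N * Y / r)) * (1 + Real.sqrt (N / r) * N ^ ε) * l2sq N a

/-- `ExcFive`: for every `ε > 0` some constant `K ≥ 0` works in `ExcFiveAt`. [cite: Drappeau2017, §4.2; DeshouillersIwaniec1982, §1.2–1.3] -/
def ExcFive (D : ℕ → SpecData) : Prop :=
  ∀ ε : ℝ, 0 < ε → ∃ K : ℝ, 0 ≤ K ∧ ExcFiveAt D ε K

/-- **Hypothesis (E7): Deshouillers–Iwaniec's Theorem 7** — the weighted large sieve for the
exceptional spectrum at the cusp `∞` ON AVERAGE OVER THE LEVEL, for the characteristic sequence of an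
initial segment `1 ≤ n ≤ N` [DeshouillersIwaniec1982, Theorem 7 (1.41): for `Q, N, Y ≥ 1`,
`∑_{q ≤ Q} ∑_{f exc} Y^{2|t_f|} |∑_{n ≤ N} ρ_{f∞}(n)|² ≪_ε (QN)^ε (Q + N + √(NY)) N`; Drappeau2017,
Lemma 4.10], twisted by `e(θn)`: the twist is the freedom in the choice of the scaling matrix at `∞`,
`σ_∞ ↦ σ_∞ (1 θ; 0 1)`, chosen independently of the level — the coefficients relative to the
translated scaling matrix are `e(θn) ρ_{f∞}(n)` ([Drappeau2017, statement of Prop. 4.12 and the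
proof of Prop. 4.13, `σ_∞ = (1 ξ₁−t; 0 1)`; Lemma 4.9: "the scaling matrices are chosen independently
of `q`"]). [cite: DeshouillersIwaniec1982, Theorem 7 (1.41); Drappeau2017, Lemma 4.10, Prop. 4.12] -/
def ExcSevenAt (D : ℕ → SpecData) (ε K : ℝ) : Prop :=
  ∀ θ : ℝ, ∀ Qv N Y : ℝ, 1 ≤ Qv → 1 ≤ N → 1 ≤ Y →
    ∀ Fe : (q : ℕ) → Finset (D q).ιe,
      ∑ q ∈ Finset.Icc 1 ⌊Qv⌋₊, ∑ f ∈ Fe q, Y ^ (2 * (D q).y f) *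
          ‖∑ n ∈ Finset.Icc 1 ⌊N⌋₊, ((𝐞 (θ * n) : Circle) : ℂ) * (D q).Pe f n‖ ^ 2 ≤
        K * (Qv * N) ^ ε * (Qv + N + Real.sqrt (N * Y)) * N

/-- `ExcSeven`: for every `ε > 0` some constant `K ≥ 0` works in `ExcSevenAt`. [cite: Drappeau2017, §4.2; DeshouillersIwaniec1982, §1.2–1.3] -/
def ExcSeven (D : ℕ → SpecData) : Prop :=
  ∀ ε : ℝ, 0 < ε → ∃ K : ℝ, 0 ≤ K ∧ ExcSevenAt D ε K




/-! ### The bilinear rearrangement (DI §9.1 (9.2)–(9.3)): inserting Kuznetsov's formula -/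

/-- Expanding a weighted product of two finite sums. [folklore] -/
theorem weight_mul_sum_mul_sum (w : ℂ) (Sm Sn : Finset ℕ) (α β : ℕ → ℂ) (x y : ℕ → ℂ) :
    w * (∑ m ∈ Sm, α m * x m) * (∑ n ∈ Sn, β n * y n) =
      ∑ n ∈ Sn, ∑ m ∈ Sm, β n * α m * (w * x m * y n) := by
  rw [Finset.mul_sum]
  refine Finset.sum_congr rfl fun n _ => ?_
  rw [Finset.mul_sum, Finset.sum_mul]
  refine Finset.sum_congr rfl fun m _ => ?_
  ring

/-- `HasSum` of the bilinear form `w_f (∑_m α_m conj p_f(m)) (∑_n β_n q_f(n))` from the `HasSum`s of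
its entries. [folklore] -/
theorem hasSum_bilinear {κ : Type*} (Sm Sn : Finset ℕ) (α β : ℕ → ℂ) (w : κ → ℂ) (p q : κ → ℕ → ℂ)
    (v : ℕ → ℕ → ℂ) (hv : ∀ m ∈ Sm, ∀ n ∈ Sn, HasSum (fun f => w f * conj (p f m) * q f n) (v m n)) :
    HasSum (fun f => w f * (∑ m ∈ Sm, α m * conj (p f m)) * (∑ n ∈ Sn, β n * q f n))
      (∑ n ∈ Sn, ∑ m ∈ Sm, β n * α m * v m n) := by
  have h := hasSum_sum fun n (hn : n ∈ Sn) =>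
    hasSum_sum fun m (hm : m ∈ Sm) => (hv m hm n hn).mul_left (β n * α m)
  have e : (fun f => w f * (∑ m ∈ Sm, α m * conj (p f m)) * (∑ n ∈ Sn, β n * q f n)) =
      fun f => ∑ n ∈ Sn, ∑ m ∈ Sm, β n * α m * (w f * conj (p f m) * q f n) := by
    funext f
    exact weight_mul_sum_mul_sum (w f) Sm Sn α β (fun m => conj (p f m)) (fun n => q f n)
  rw [e]
  exact h

/-- **The abstract bilinear rearrangement.**  If for every `m ∈ S_m`, `n ∈ S_n` a quantity `K(m,n)`
(the Kloosterman side) equals a "spectral" sum `∑_f w_f conj(p_f(m)) q_f(n)` (three discrete families,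
`HasSum`) plus `∑_𝔠 (1/4π) ∫ w(t) conj(p_𝔠(t,m)) q_𝔠(t,n) dt`, then
`∑_{n,m} β_n α_m K(m,n)` is the corresponding combination of the BILINEAR forms
`w_f (∑_m α_m conj p_f(m)) (∑_n β_n q_f(n))`. [cite: DeshouillersIwaniec1982, §9.1 (9.2)–(9.3) p. 279] -/
theorem bilinear_core {ι ιe ιh : Type*} {nc : ℕ} (Sm Sn : Finset ℕ) (α β : ℕ → ℂ)
    (wM : ι → ℂ) (Pm Qn : ι → ℕ → ℂ) (wX : ιe → ℂ) (Pem Qen : ιe → ℕ → ℂ)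
    (wE : ℝ → ℂ) (PEm QEn : Fin nc → ℝ → ℕ → ℂ) (wH : ιh → ℂ) (PHm QHn : ιh → ℕ → ℂ)
    (vM vX vH Kc : ℕ → ℕ → ℂ)
    (hM : ∀ m ∈ Sm, ∀ n ∈ Sn, HasSum (fun f => wM f * conj (Pm f m) * Qn f n) (vM m n))
    (hX : ∀ m ∈ Sm, ∀ n ∈ Sn, HasSum (fun f => wX f * conj (Pem f m) * Qen f n) (vX m n))
    (hH : ∀ m ∈ Sm, ∀ n ∈ Sn, HasSum (fun f => wH f * conj (PHm f m) * QHn f n) (vH m n))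
    (hE : ∀ m ∈ Sm, ∀ n ∈ Sn, ∀ 𝔠, Integrable (fun t => wE t * conj (PEm 𝔠 t m) * QEn 𝔠 t n))
    (htot : ∀ m ∈ Sm, ∀ n ∈ Sn, Kc m n = vM m n + vX m n +
        (∑ 𝔠, (1 / (4 * π) : ℂ) * ∫ t, wE t * conj (PEm 𝔠 t m) * QEn 𝔠 t n) + vH m n) :
    HasSum (fun f => wM f * (∑ m ∈ Sm, α m * conj (Pm f m)) * (∑ n ∈ Sn, β n * Qn f n))
        (∑ n ∈ Sn, ∑ m ∈ Sm, β n * α m * vM m n) ∧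
    HasSum (fun f => wX f * (∑ m ∈ Sm, α m * conj (Pem f m)) * (∑ n ∈ Sn, β n * Qen f n))
        (∑ n ∈ Sn, ∑ m ∈ Sm, β n * α m * vX m n) ∧
    HasSum (fun f => wH f * (∑ m ∈ Sm, α m * conj (PHm f m)) * (∑ n ∈ Sn, β n * QHn f n))
        (∑ n ∈ Sn, ∑ m ∈ Sm, β n * α m * vH m n) ∧
    (∀ 𝔠, Integrable (fun t => wE t * (∑ m ∈ Sm, α m * conj (PEm 𝔠 t m)) * (∑ n ∈ Sn, β n * QEn 𝔠 t n))) ∧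
    ∑ n ∈ Sn, ∑ m ∈ Sm, β n * α m * Kc m n =
      (∑ n ∈ Sn, ∑ m ∈ Sm, β n * α m * vM m n) + (∑ n ∈ Sn, ∑ m ∈ Sm, β n * α m * vX m n) +
      (∑ 𝔠, (1 / (4 * π) : ℂ) *
        ∫ t, wE t * (∑ m ∈ Sm, α m * conj (PEm 𝔠 t m)) * (∑ n ∈ Sn, β n * QEn 𝔠 t n)) +
      (∑ n ∈ Sn, ∑ m ∈ Sm, β n * α m * vH m n) := by
  refine ⟨hasSum_bilinear Sm Sn α β wM Pm Qn vM hM, hasSum_bilinear Sm Sn α β wX Pem Qen vX hX,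
    hasSum_bilinear Sm Sn α β wH PHm QHn vH hH, ?_, ?_⟩
  · intro 𝔠
    have e : (fun t => wE t * (∑ m ∈ Sm, α m * conj (PEm 𝔠 t m)) * (∑ n ∈ Sn, β n * QEn 𝔠 t n)) =
        fun t => ∑ n ∈ Sn, ∑ m ∈ Sm, β n * α m * (wE t * conj (PEm 𝔠 t m) * QEn 𝔠 t n) := by
      funext t
      exact weight_mul_sum_mul_sum (wE t) Sm Sn α β (fun m => conj (PEm 𝔠 t m)) (fun n => QEn 𝔠 t n)
    rw [e]
    exact integrable_finsetSum _ fun n hn => integrable_finsetSum _ fun m hm =>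
      (hE m hm n hn 𝔠).const_mul _
  · -- the identity
    have hE' : ∀ 𝔠, ∫ t, wE t * (∑ m ∈ Sm, α m * conj (PEm 𝔠 t m)) * (∑ n ∈ Sn, β n * QEn 𝔠 t n) =
        ∑ n ∈ Sn, ∑ m ∈ Sm, β n * α m * ∫ t, wE t * conj (PEm 𝔠 t m) * QEn 𝔠 t n := by
      intro 𝔠
      have e : (fun t => wE t * (∑ m ∈ Sm, α m * conj (PEm 𝔠 t m)) * (∑ n ∈ Sn, β n * QEn 𝔠 t n)) =
          fun t => ∑ n ∈ Sn, ∑ m ∈ Sm, β n * α m * (wE t * conj (PEm 𝔠 t m) * QEn 𝔠 t n) := by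
        funext t
        exact weight_mul_sum_mul_sum (wE t) Sm Sn α β (fun m => conj (PEm 𝔠 t m)) (fun n => QEn 𝔠 t n)
      rw [e, integral_finsetSum _ (fun n hn => integrable_finsetSum _ fun m hm =>
        (hE m hm n hn 𝔠).const_mul _)]
      refine Finset.sum_congr rfl fun n hn => ?_
      rw [integral_finsetSum _ (fun m hm => (hE m hm n hn 𝔠).const_mul _)]
      refine Finset.sum_congr rfl fun m hm => ?_
      exact integral_const_mul _ _
    have step1 : ∑ n ∈ Sn, ∑ m ∈ Sm, β n * α m * Kc m n =
        ∑ n ∈ Sn, ∑ m ∈ Sm, (β n * α m * vM m n + β n * α m * vX m n +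
          β n * α m * (∑ 𝔠, ((1 / (4 * π) : ℂ) * ∫ t, wE t * conj (PEm 𝔠 t m) * QEn 𝔠 t n)) +
          β n * α m * vH m n) := by
      refine Finset.sum_congr rfl fun n hn => Finset.sum_congr rfl fun m hm => ?_
      rw [htot m hm n hn]; ring
    rw [step1]
    simp only [Finset.sum_add_distrib]
    congr 1
    congr 1
    -- the Eisenstein part
    symm
    calc ∑ 𝔠, (1 / (4 * π) : ℂ) * ∫ t, wE t * (∑ m ∈ Sm, α m * conj (PEm 𝔠 t m)) * (∑ n ∈ Sn, β n * QEn 𝔠 t n)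
        = ∑ 𝔠, (1 / (4 * π) : ℂ) * ∑ n ∈ Sn, ∑ m ∈ Sm, β n * α m * ∫ t, wE t * conj (PEm 𝔠 t m) * QEn 𝔠 t n := by
          refine Finset.sum_congr rfl fun 𝔠 _ => by rw [hE' 𝔠]
      _ = ∑ n ∈ Sn, ∑ m ∈ Sm, β n * α m *
            ∑ 𝔠, (1 / (4 * π) : ℂ) * ∫ t, wE t * conj (PEm 𝔠 t m) * QEn 𝔠 t n := by
          simp only [Finset.mul_sum]
          rw [Finset.sum_comm]
          refine Finset.sum_congr rfl fun n _ => ?_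
          rw [Finset.sum_comm]
          refine Finset.sum_congr rfl fun m _ => Finset.sum_congr rfl fun 𝔠 _ => by ring




/-! ### Bounding the bilinear spectral sums: AM–GM termwise, uniform partial sums -/

/-- `∑_F k (λ a_f + λ⁻¹ b_f)/2 = k (λ ∑ a + λ⁻¹ ∑ b)/2`. [folklore] -/
theorem sum_amgm_shape {κ : Type*} (F : Finset κ) (a b : κ → ℝ) (k lam : ℝ) :
    ∑ f ∈ F, k * ((lam * a f + lam⁻¹ * b f) / 2) = k * (lam * ∑ f ∈ F, a f + lam⁻¹ * ∑ f ∈ F, b f) / 2 := by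
  classical
  induction F using Finset.induction_on with
  | empty => simp
  | insert x F hx ih => rw [Finset.sum_insert hx, Finset.sum_insert hx, Finset.sum_insert hx, ih]; ring

/-- **A discrete spectral family, two weight systems.**  If `‖w_f‖ ≤ c₁ ω_f + c₂ ωa_f ωb_f` and the
one-sided weighted quadratic sums are bounded (`∑ om|A|² ≤ U_A`, `∑ om|B|² ≤ U_B`, `∑ ωa²|A|² ≤ U'_A`,
`∑ ωb²|B|² ≤ U'_B` over all finite subfamilies), then the `HasSum` value `V` of `w_f A_f B_f` obeys
`|V| ≤ c₁(λU_A + λ⁻¹U_B)/2 + c₂(λ'U'_A + λ'⁻¹U'_B)/2` for all `λ, λ' > 0`.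
[cite: DeshouillersIwaniec1982, §9.1 (9.3)–(9.5) p. 279] -/
theorem disc_family_bound {κ : Type*} (w A B : κ → ℂ) {V : ℂ} (hV : HasSum (fun f => w f * A f * B f) V)
    (om oma omb : κ → ℝ) (hω : ∀ f, 0 ≤ om f)
    {c₁ c₂ : ℝ} (hc₁ : 0 ≤ c₁) (hc₂ : 0 ≤ c₂) (hw : ∀ f, ‖w f‖ ≤ c₁ * om f + c₂ * (oma f * omb f))
    {UA UB UA' UB' : ℝ}
    (hA : ∀ F : Finset κ, ∑ f ∈ F, om f * ‖A f‖ ^ 2 ≤ UA) (hB : ∀ F : Finset κ, ∑ f ∈ F, om f * ‖B f‖ ^ 2 ≤ UB)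
    (hA' : ∀ F : Finset κ, ∑ f ∈ F, oma f ^ 2 * ‖A f‖ ^ 2 ≤ UA')
    (hB' : ∀ F : Finset κ, ∑ f ∈ F, omb f ^ 2 * ‖B f‖ ^ 2 ≤ UB')
    {lam lam' : ℝ} (hl : 0 < lam) (hl' : 0 < lam') :
    ‖V‖ ≤ c₁ * (lam * UA + lam⁻¹ * UB) / 2 + c₂ * (lam' * UA' + lam'⁻¹ * UB') / 2 := by
  refine norm_le_of_hasSum_of_forall_sum_norm hV fun F => ?_
  have hterm : ∀ f ∈ F, ‖w f * A f * B f‖ ≤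
      c₁ * ((lam * (om f * ‖A f‖ ^ 2) + lam⁻¹ * (om f * ‖B f‖ ^ 2)) / 2) +
      c₂ * ((lam' * (oma f ^ 2 * ‖A f‖ ^ 2) + lam'⁻¹ * (omb f ^ 2 * ‖B f‖ ^ 2)) / 2) := by
    intro f _
    rw [norm_mul, norm_mul]
    have h1 : ‖A f‖ * ‖B f‖ ≤ (lam * ‖A f‖ ^ 2 + lam⁻¹ * ‖B f‖ ^ 2) / 2 := mul_le_amgm_param hl
    have h2 : (oma f * ‖A f‖) * (omb f * ‖B f‖) ≤
        (lam' * (oma f * ‖A f‖) ^ 2 + lam'⁻¹ * (omb f * ‖B f‖) ^ 2) / 2 := mul_le_amgm_param hl'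
    have hAB : 0 ≤ ‖A f‖ * ‖B f‖ := by positivity
    calc ‖w f‖ * ‖A f‖ * ‖B f‖ = ‖w f‖ * (‖A f‖ * ‖B f‖) := by ring
      _ ≤ (c₁ * om f + c₂ * (oma f * omb f)) * (‖A f‖ * ‖B f‖) :=
          mul_le_mul_of_nonneg_right (hw f) hAB
      _ = c₁ * (om f * (‖A f‖ * ‖B f‖)) + c₂ * ((oma f * ‖A f‖) * (omb f * ‖B f‖)) := by ring
      _ ≤ c₁ * (om f * ((lam * ‖A f‖ ^ 2 + lam⁻¹ * ‖B f‖ ^ 2) / 2)) +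
          c₂ * ((lam' * (oma f * ‖A f‖) ^ 2 + lam'⁻¹ * (omb f * ‖B f‖) ^ 2) / 2) := by
          gcongr
          · exact hω f
      _ = _ := by ring
  refine (Finset.sum_le_sum hterm).trans ?_
  rw [Finset.sum_add_distrib, sum_amgm_shape, sum_amgm_shape]
  have hli : 0 ≤ lam⁻¹ := inv_nonneg.2 hl.le
  have hli' : 0 ≤ lam'⁻¹ := inv_nonneg.2 hl'.le
  have h1 : lam * ∑ f ∈ F, om f * ‖A f‖ ^ 2 + lam⁻¹ * ∑ f ∈ F, om f * ‖B f‖ ^ 2 ≤ lam * UA + lam⁻¹ * UB :=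
    add_le_add (mul_le_mul_of_nonneg_left (hA F) hl.le) (mul_le_mul_of_nonneg_left (hB F) hli)
  have h2 : lam' * ∑ f ∈ F, oma f ^ 2 * ‖A f‖ ^ 2 + lam'⁻¹ * ∑ f ∈ F, omb f ^ 2 * ‖B f‖ ^ 2 ≤
      lam' * UA' + lam'⁻¹ * UB' :=
    add_le_add (mul_le_mul_of_nonneg_left (hA' F) hl'.le) (mul_le_mul_of_nonneg_left (hB' F) hli')
  have := mul_le_mul_of_nonneg_left h1 hc₁
  have := mul_le_mul_of_nonneg_left h2 hc₂
  linarith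

/-- From a `lintegral` bound to integrability and an `integral` bound, for a non-negative measurable
function. [folklore] -/
theorem integrable_and_integral_le_of_lintegral_le {g : ℝ → ℝ} (hgm : Measurable g) (hg0 : ∀ t, 0 ≤ g t)
    {U : ℝ} (hU : 0 ≤ U) (h : ∫⁻ t, ENNReal.ofReal (g t) ≤ ENNReal.ofReal U) :
    Integrable g ∧ ∫ t, g t ≤ U := by
  have hfin : ∫⁻ t, ENNReal.ofReal (g t) < ⊤ := h.trans_lt ENNReal.ofReal_lt_top
  have hint : Integrable g := by
    refine ⟨hgm.aestronglyMeasurable, ?_⟩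
    rw [hasFiniteIntegral_iff_norm]
    simpa [Real.norm_eq_abs, abs_of_nonneg (hg0 _)] using hfin
  refine ⟨hint, ?_⟩
  rw [integral_eq_lintegral_of_nonneg_ae (Filter.Eventually.of_forall hg0) hgm.aestronglyMeasurable]
  exact ENNReal.toReal_le_of_le_ofReal hU h

/-- **The continuous-spectrum family.**  For `V = ∑_𝔠 (1/4π) ∫ w(t) A_𝔠(t) B_𝔠(t) dt` with
`‖w(t)‖ ≤ c om(t)`, `∑_𝔠 ∫ om|A_𝔠|² ≤ U_A`, `∑_𝔠 ∫ om|B_𝔠|² ≤ U_B` (as `lintegral` bounds):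
`|V| ≤ (1/4π) c (λU_A + λ⁻¹U_B)/2`. [cite: DeshouillersIwaniec1982, §9.1 (9.3)–(9.4) p. 279] -/
theorem eis_family_bound {nc : ℕ} (w : ℝ → ℂ) (A B : Fin nc → ℝ → ℂ)
    (om : ℝ → ℝ) (hω : ∀ t, 0 ≤ om t) (hωm : Measurable om) {c : ℝ} (hc : 0 ≤ c) (hw : ∀ t, ‖w t‖ ≤ c * om t)
    (hAm : ∀ 𝔠, Measurable (A 𝔠)) (hBm : ∀ 𝔠, Measurable (B 𝔠)) {UA UB : ℝ} (hUA : 0 ≤ UA) (hUB : 0 ≤ UB)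
    (hA : ∑ 𝔠, ∫⁻ t, ENNReal.ofReal (om t * ‖A 𝔠 t‖ ^ 2) ≤ ENNReal.ofReal UA)
    (hB : ∑ 𝔠, ∫⁻ t, ENNReal.ofReal (om t * ‖B 𝔠 t‖ ^ 2) ≤ ENNReal.ofReal UB)
    {lam : ℝ} (hl : 0 < lam) :
    ‖∑ 𝔠, (1 / (4 * π) : ℂ) * ∫ t, w t * A 𝔠 t * B 𝔠 t‖ ≤ 1 / (4 * π) * c * (lam * UA + lam⁻¹ * UB) / 2 := by
  have hli : 0 ≤ lam⁻¹ := inv_nonneg.2 hl.le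
  -- the one-sided integrals, per cusp
  have hAi : ∀ 𝔠, Integrable (fun t => om t * ‖A 𝔠 t‖ ^ 2) ∧
      ∫ t, om t * ‖A 𝔠 t‖ ^ 2 ≤ (∫⁻ t, ENNReal.ofReal (om t * ‖A 𝔠 t‖ ^ 2)).toReal := by
    intro 𝔠
    have hm : Measurable fun t => om t * ‖A 𝔠 t‖ ^ 2 := hωm.mul ((hAm 𝔠).norm.pow_const 2)
    have h0 : ∀ t, 0 ≤ om t * ‖A 𝔠 t‖ ^ 2 := fun t => mul_nonneg (hω t) (by positivity)
    have hfin : ∫⁻ t, ENNReal.ofReal (om t * ‖A 𝔠 t‖ ^ 2) < ⊤ := by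
      refine lt_of_le_of_lt ?_ (hA.trans_lt ENNReal.ofReal_lt_top)
      exact Finset.single_le_sum (f := fun 𝔠 => ∫⁻ t, ENNReal.ofReal (om t * ‖A 𝔠 t‖ ^ 2))
        (fun _ _ => bot_le) (Finset.mem_univ 𝔠)
    have := integrable_and_integral_le_of_lintegral_le hm h0 ENNReal.toReal_nonneg
      (by rw [ENNReal.ofReal_toReal hfin.ne])
    exact this
  have hBi : ∀ 𝔠, Integrable (fun t => om t * ‖B 𝔠 t‖ ^ 2) ∧
      ∫ t, om t * ‖B 𝔠 t‖ ^ 2 ≤ (∫⁻ t, ENNReal.ofReal (om t * ‖B 𝔠 t‖ ^ 2)).toReal := by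
    intro 𝔠
    have hm : Measurable fun t => om t * ‖B 𝔠 t‖ ^ 2 := hωm.mul ((hBm 𝔠).norm.pow_const 2)
    have h0 : ∀ t, 0 ≤ om t * ‖B 𝔠 t‖ ^ 2 := fun t => mul_nonneg (hω t) (by positivity)
    have hfin : ∫⁻ t, ENNReal.ofReal (om t * ‖B 𝔠 t‖ ^ 2) < ⊤ := by
      refine lt_of_le_of_lt ?_ (hB.trans_lt ENNReal.ofReal_lt_top)
      exact Finset.single_le_sum (f := fun 𝔠 => ∫⁻ t, ENNReal.ofReal (om t * ‖B 𝔠 t‖ ^ 2))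
        (fun _ _ => bot_le) (Finset.mem_univ 𝔠)
    exact integrable_and_integral_le_of_lintegral_le hm h0 ENNReal.toReal_nonneg
      (by rw [ENNReal.ofReal_toReal hfin.ne])
  -- sums of the one-sided integrals
  have hAsum : ∑ 𝔠, ∫ t, om t * ‖A 𝔠 t‖ ^ 2 ≤ UA := by
    have hfin : ∀ 𝔠, ∫⁻ t, ENNReal.ofReal (om t * ‖A 𝔠 t‖ ^ 2) ≠ ⊤ := fun 𝔠 =>
      (lt_of_le_of_lt (Finset.single_le_sum (f := fun 𝔠 => ∫⁻ t, ENNReal.ofReal (om t * ‖A 𝔠 t‖ ^ 2))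
        (fun _ _ => bot_le) (Finset.mem_univ 𝔠)) (hA.trans_lt ENNReal.ofReal_lt_top)).ne
    calc ∑ 𝔠, ∫ t, om t * ‖A 𝔠 t‖ ^ 2 ≤ ∑ 𝔠, (∫⁻ t, ENNReal.ofReal (om t * ‖A 𝔠 t‖ ^ 2)).toReal :=
          Finset.sum_le_sum fun 𝔠 _ => (hAi 𝔠).2
      _ = (∑ 𝔠, ∫⁻ t, ENNReal.ofReal (om t * ‖A 𝔠 t‖ ^ 2)).toReal :=
          (ENNReal.toReal_sum fun 𝔠 _ => hfin 𝔠).symm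
      _ ≤ UA := ENNReal.toReal_le_of_le_ofReal hUA hA
  have hBsum : ∑ 𝔠, ∫ t, om t * ‖B 𝔠 t‖ ^ 2 ≤ UB := by
    have hfin : ∀ 𝔠, ∫⁻ t, ENNReal.ofReal (om t * ‖B 𝔠 t‖ ^ 2) ≠ ⊤ := fun 𝔠 =>
      (lt_of_le_of_lt (Finset.single_le_sum (f := fun 𝔠 => ∫⁻ t, ENNReal.ofReal (om t * ‖B 𝔠 t‖ ^ 2))
        (fun _ _ => bot_le) (Finset.mem_univ 𝔠)) (hB.trans_lt ENNReal.ofReal_lt_top)).ne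
    calc ∑ 𝔠, ∫ t, om t * ‖B 𝔠 t‖ ^ 2 ≤ ∑ 𝔠, (∫⁻ t, ENNReal.ofReal (om t * ‖B 𝔠 t‖ ^ 2)).toReal :=
          Finset.sum_le_sum fun 𝔠 _ => (hBi 𝔠).2
      _ = (∑ 𝔠, ∫⁻ t, ENNReal.ofReal (om t * ‖B 𝔠 t‖ ^ 2)).toReal :=
          (ENNReal.toReal_sum fun 𝔠 _ => hfin 𝔠).symm
      _ ≤ UB := ENNReal.toReal_le_of_le_ofReal hUB hB
  -- per cusp: `‖∫ w A B‖ ≤ c (λ ∫om|A|² + λ⁻¹ ∫om|B|²)/2`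
  have hcusp : ∀ 𝔠, ‖∫ t, w t * A 𝔠 t * B 𝔠 t‖ ≤
      c * (lam * (∫ t, om t * ‖A 𝔠 t‖ ^ 2) + lam⁻¹ * (∫ t, om t * ‖B 𝔠 t‖ ^ 2)) / 2 := by
    intro 𝔠
    have hg : Integrable (fun t => c * ((lam * (om t * ‖A 𝔠 t‖ ^ 2) + lam⁻¹ * (om t * ‖B 𝔠 t‖ ^ 2)) / 2)) :=
      ((((hAi 𝔠).1.const_mul lam).add ((hBi 𝔠).1.const_mul lam⁻¹)).div_const 2).const_mul c
    have hle : ∀ᵐ t, ‖w t * A 𝔠 t * B 𝔠 t‖ ≤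
        c * ((lam * (om t * ‖A 𝔠 t‖ ^ 2) + lam⁻¹ * (om t * ‖B 𝔠 t‖ ^ 2)) / 2) := by
      refine Filter.Eventually.of_forall fun t => ?_
      rw [norm_mul, norm_mul]
      have h1 : ‖A 𝔠 t‖ * ‖B 𝔠 t‖ ≤ (lam * ‖A 𝔠 t‖ ^ 2 + lam⁻¹ * ‖B 𝔠 t‖ ^ 2) / 2 := mul_le_amgm_param hl
      have hAB : 0 ≤ ‖A 𝔠 t‖ * ‖B 𝔠 t‖ := by positivity
      calc ‖w t‖ * ‖A 𝔠 t‖ * ‖B 𝔠 t‖ = ‖w t‖ * (‖A 𝔠 t‖ * ‖B 𝔠 t‖) := by ring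
        _ ≤ (c * om t) * (‖A 𝔠 t‖ * ‖B 𝔠 t‖) := mul_le_mul_of_nonneg_right (hw t) hAB
        _ ≤ (c * om t) * ((lam * ‖A 𝔠 t‖ ^ 2 + lam⁻¹ * ‖B 𝔠 t‖ ^ 2) / 2) :=
            mul_le_mul_of_nonneg_left h1 (mul_nonneg hc (hω t))
        _ = _ := by ring
    refine (norm_integral_le_of_norm_le hg hle).trans_eq ?_
    rw [integral_const_mul, integral_div, integral_add ((hAi 𝔠).1.const_mul lam) ((hBi 𝔠).1.const_mul lam⁻¹),
      integral_const_mul, integral_const_mul]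
    ring
  -- sum over the cusps
  calc ‖∑ 𝔠, (1 / (4 * π) : ℂ) * ∫ t, w t * A 𝔠 t * B 𝔠 t‖
      ≤ ∑ 𝔠, ‖(1 / (4 * π) : ℂ) * ∫ t, w t * A 𝔠 t * B 𝔠 t‖ := norm_sum_le _ _
    _ = ∑ 𝔠, 1 / (4 * π) * ‖∫ t, w t * A 𝔠 t * B 𝔠 t‖ := by
        refine Finset.sum_congr rfl fun 𝔠 _ => ?_
        rw [norm_mul]
        congr 1
        rw [show (1 / (4 * π) : ℂ) = ((1 / (4 * π) : ℝ) : ℂ) by push_cast; ring, Complex.norm_real,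
          Real.norm_eq_abs, abs_of_pos (by positivity)]
    _ ≤ ∑ 𝔠, 1 / (4 * π) * (c * (lam * (∫ t, om t * ‖A 𝔠 t‖ ^ 2) + lam⁻¹ * (∫ t, om t * ‖B 𝔠 t‖ ^ 2)) / 2) := by
        gcongr with 𝔠
        exact hcusp 𝔠
    _ = ∑ 𝔠, (1 / (4 * π) * c) * ((lam * (∫ t, om t * ‖A 𝔠 t‖ ^ 2) + lam⁻¹ * (∫ t, om t * ‖B 𝔠 t‖ ^ 2)) / 2) := by
        refine Finset.sum_congr rfl fun 𝔠 _ => by ring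
    _ = 1 / (4 * π) * c * (lam * (∑ 𝔠, ∫ t, om t * ‖A 𝔠 t‖ ^ 2) + lam⁻¹ * (∑ 𝔠, ∫ t, om t * ‖B 𝔠 t‖ ^ 2)) / 2 :=
        sum_amgm_shape (Finset.univ) (fun 𝔠 => ∫ t, om t * ‖A 𝔠 t‖ ^ 2) (fun 𝔠 => ∫ t, om t * ‖B 𝔠 t‖ ^ 2) _ _
    _ ≤ 1 / (4 * π) * c * (lam * UA + lam⁻¹ * UB) / 2 := by
        have h0 : 0 ≤ 1 / (4 * π) * c := by positivity
        have h1 : lam * (∑ 𝔠, ∫ t, om t * ‖A 𝔠 t‖ ^ 2) + lam⁻¹ * (∑ 𝔠, ∫ t, om t * ‖B 𝔠 t‖ ^ 2) ≤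
            lam * UA + lam⁻¹ * UB :=
          add_le_add (mul_le_mul_of_nonneg_left hAsum hl.le) (mul_le_mul_of_nonneg_left hBsum hli)
        have := mul_le_mul_of_nonneg_left h1 h0
        linarith

/-- **Sums of suprema of non-negative partial sums.**  If every simultaneous choice of finite
subfamilies has `∑_{r ∈ S} s_r(F_r) ≤ B`, then `∑_{r ∈ S} sup_F s_r(F) ≤ B`. [folklore] -/
theorem sum_ciSup_le_of_forall {κ : ℕ → Type*} (s : (r : ℕ) → Finset (κ r) → ℝ) (S : Finset ℕ) {Bd : ℝ}
    (h : ∀ Fsel : (r : ℕ) → Finset (κ r), ∑ r ∈ S, s r (Fsel r) ≤ Bd) :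
    ∑ r ∈ S, (⨆ F : Finset (κ r), s r F) ≤ Bd := by
  classical
  induction S using Finset.induction_on generalizing Bd with
  | empty => simpa using h fun r => ∅
  | insert r₀ S hr₀ ih =>
    rw [Finset.sum_insert hr₀]
    -- for each fixed `F₀`, the induction hypothesis bounds the rest
    have key : ∀ F₀ : Finset (κ r₀), s r₀ F₀ + ∑ r ∈ S, (⨆ F : Finset (κ r), s r F) ≤ Bd := by
      intro F₀
      have hS : ∑ r ∈ S, (⨆ F : Finset (κ r), s r F) ≤ Bd - s r₀ F₀ := by
        apply ih
        intro Fsel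
        have := h (Function.update Fsel r₀ F₀)
        rw [Finset.sum_insert hr₀, Function.update_self] at this
        have e : ∑ r ∈ S, s r (Function.update Fsel r₀ F₀ r) = ∑ r ∈ S, s r (Fsel r) := by
          refine Finset.sum_congr rfl fun r hr => ?_
          have hne : r ≠ r₀ := fun h => hr₀ (h ▸ hr)
          rw [Function.update_of_ne hne]
        linarith [e ▸ this]
      linarith
    have : (⨆ F : Finset (κ r₀), s r₀ F) ≤ Bd - ∑ r ∈ S, (⨆ F : Finset (κ r), s r F) :=
      ciSup_le fun F₀ => by linarith [key F₀]
    linarith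

/-- A partial sum is at most the supremum of the partial sums (bounded case). [folklore] -/
theorem le_ciSup_finset {κ : Type*} (s : Finset κ → ℝ) {Bd : ℝ} (h : ∀ F, s F ≤ Bd) (F : Finset κ) :
    s F ≤ ⨆ F : Finset κ, s F :=
  le_ciSup ⟨Bd, by rintro _ ⟨F, rfl⟩; exact h F⟩ F

/-- The supremum of bounded partial sums is at most the bound. [folklore] -/
theorem ciSup_finset_le {κ : Type*} (s : Finset κ → ℝ) {Bd : ℝ} (h : ∀ F, s F ≤ Bd) :
    (⨆ F : Finset κ, s F) ≤ Bd :=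
  ciSup_le h

/-- The supremum of non-negative-at-`∅` partial sums is non-negative (bounded case). [folklore] -/
theorem ciSup_finset_nonneg {κ : Type*} (s : Finset κ → ℝ) {Bd : ℝ} (h : ∀ F, s F ≤ Bd) (h0 : s ∅ = 0) :
    0 ≤ ⨆ F : Finset κ, s F :=
  h0 ▸ le_ciSup_finset s h ∅




/-! ### One level: the four spectral pieces together -/

/-- **One level, abstract form.**  The Kloosterman-side quantity `LHS = V_M + V_exc + 𝓔 + V_H`
(values of the bilinear spectral series) is bounded through the termwise weight bounds and the
one-sided weighted quadratic bounds, for all `λ, λ' > 0`. [cite: DeshouillersIwaniec1982, §9.1 (9.3)–(9.8) pp. 279–280] -/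
theorem level_core {ι ιe ιh : Type*} {nc : ℕ}
    (wM AM BM : ι → ℂ) (wX AX BX : ιe → ℂ) (wE : ℝ → ℂ) (AE BE : Fin nc → ℝ → ℂ) (wH AH BH : ιh → ℂ)
    {VM VX VH LHS : ℂ} (hVM : HasSum (fun f => wM f * AM f * BM f) VM)
    (hVX : HasSum (fun f => wX f * AX f * BX f) VX) (hVH : HasSum (fun f => wH f * AH f * BH f) VH)
    (hLHS : LHS = VM + VX + (∑ 𝔠, (1 / (4 * π) : ℂ) * ∫ t, wE t * AE 𝔠 t * BE 𝔠 t) + VH)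
    (omM : ι → ℝ) (homM : ∀ f, 0 ≤ omM f) (omX oma omb : ιe → ℝ) (homX : ∀ f, 0 ≤ omX f)
    (omE : ℝ → ℝ) (homE : ∀ t, 0 ≤ omE t) (homEm : Measurable omE) (omH : ιh → ℝ) (homH : ∀ f, 0 ≤ omH f)
    {c cX cX' : ℝ} (hc : 0 ≤ c) (hcX : 0 ≤ cX) (hcX' : 0 ≤ cX')
    (hwM : ∀ f, ‖wM f‖ ≤ c * omM f) (hwX : ∀ f, ‖wX f‖ ≤ cX * omX f + cX' * (oma f * omb f))
    (hwE : ∀ t, ‖wE t‖ ≤ c * omE t) (hwH : ∀ f, ‖wH f‖ ≤ c * omH f)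
    (hAEm : ∀ 𝔠, Measurable (AE 𝔠)) (hBEm : ∀ 𝔠, Measurable (BE 𝔠))
    {UAM UBM UAX UBX UA' UB' UAE UBE UAH UBH : ℝ} (hUAE : 0 ≤ UAE) (hUBE : 0 ≤ UBE)
    (hAM : ∀ F : Finset ι, ∑ f ∈ F, omM f * ‖AM f‖ ^ 2 ≤ UAM)
    (hBM : ∀ F : Finset ι, ∑ f ∈ F, omM f * ‖BM f‖ ^ 2 ≤ UBM)
    (hAX : ∀ F : Finset ιe, ∑ f ∈ F, omX f * ‖AX f‖ ^ 2 ≤ UAX)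
    (hBX : ∀ F : Finset ιe, ∑ f ∈ F, omX f * ‖BX f‖ ^ 2 ≤ UBX)
    (hA' : ∀ F : Finset ιe, ∑ f ∈ F, oma f ^ 2 * ‖AX f‖ ^ 2 ≤ UA')
    (hB' : ∀ F : Finset ιe, ∑ f ∈ F, omb f ^ 2 * ‖BX f‖ ^ 2 ≤ UB')
    (hAE : ∑ 𝔠, ∫⁻ t, ENNReal.ofReal (omE t * ‖AE 𝔠 t‖ ^ 2) ≤ ENNReal.ofReal UAE)
    (hBE : ∑ 𝔠, ∫⁻ t, ENNReal.ofReal (omE t * ‖BE 𝔠 t‖ ^ 2) ≤ ENNReal.ofReal UBE)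
    (hAH : ∀ F : Finset ιh, ∑ f ∈ F, omH f * ‖AH f‖ ^ 2 ≤ UAH)
    (hBH : ∀ F : Finset ιh, ∑ f ∈ F, omH f * ‖BH f‖ ^ 2 ≤ UBH)
    {lam lam' : ℝ} (hl : 0 < lam) (hl' : 0 < lam') :
    ‖LHS‖ ≤ c * (lam * UAM + lam⁻¹ * UBM) / 2 +
      (cX * (lam * UAX + lam⁻¹ * UBX) / 2 + cX' * (lam' * UA' + lam'⁻¹ * UB') / 2) +
      1 / (4 * π) * c * (lam * UAE + lam⁻¹ * UBE) / 2 + c * (lam * UAH + lam⁻¹ * UBH) / 2 := by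
  rw [hLHS]
  have h1 : ‖VM‖ ≤ c * (lam * UAM + lam⁻¹ * UBM) / 2 := by
    have := disc_family_bound wM AM BM hVM omM (fun _ => 0) (fun _ => 0) homM hc le_rfl
      (fun f => by simpa using hwM f) hAM hBM (UA' := 0) (UB' := 0)
      (fun F => by simp) (fun F => by simp) hl hl'
    simpa using this
  have h2 : ‖VX‖ ≤ cX * (lam * UAX + lam⁻¹ * UBX) / 2 + cX' * (lam' * UA' + lam'⁻¹ * UB') / 2 :=
    disc_family_bound wX AX BX hVX omX oma omb homX hcX hcX' hwX hAX hBX hA' hB' hl hl'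
  have h3 : ‖∑ 𝔠, (1 / (4 * π) : ℂ) * ∫ t, wE t * AE 𝔠 t * BE 𝔠 t‖ ≤
      1 / (4 * π) * c * (lam * UAE + lam⁻¹ * UBE) / 2 :=
    eis_family_bound wE AE BE omE homE homEm hc hwE hAEm hBEm hUAE hUBE hAE hBE hl
  have h4 : ‖VH‖ ≤ c * (lam * UAH + lam⁻¹ * UBH) / 2 := by
    have := disc_family_bound wH AH BH hVH omH (fun _ => 0) (fun _ => 0) homH hc le_rfl
      (fun f => by simpa using hwH f) hAH hBH (UA' := 0) (UB' := 0)
      (fun F => by simp) (fun F => by simp) hl hl'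
    simpa using this
  calc ‖VM + VX + (∑ 𝔠, (1 / (4 * π) : ℂ) * ∫ t, wE t * AE 𝔠 t * BE 𝔠 t) + VH‖
      ≤ ‖VM‖ + ‖VX‖ + ‖∑ 𝔠, (1 / (4 * π) : ℂ) * ∫ t, wE t * AE 𝔠 t * BE 𝔠 t‖ + ‖VH‖ := by
        refine (norm_add_le _ _).trans ?_
        refine add_le_add ((norm_add_le _ _).trans (add_le_add (norm_add_le _ _) le_rfl)) le_rfl
    _ ≤ _ := by linarith

/-! ### Small facts used at each level -/

/-- The finite `c`-sum of `kuzSum` at level `r` equals the value of Kuznetsov's Kloosterman side when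
`φ(x_c) = 0` beyond the cutoff. [folklore] -/
theorem kloos_finsum_eq {r : ℕ} {φ : ℝ → ℂ} {m n : ℕ} {h : ℤ} {v : ℂ}
    (hv : HasSum (kloosSide r φ m n h) v) {cM : ℕ} (hzero : ∀ c : ℕ, cM < c → φ (xK m n r c) = 0) :
    ∑ c ∈ (Finset.Icc 1 cM).filter (fun c => r.Coprime c),
        ((((c : ℝ) * Real.sqrt r)⁻¹ : ℝ) : ℂ) * φ (xK m n r c) * kl c r n h = v := by
  classical
  set S := (Finset.Icc 1 cM).filter (fun c => r.Coprime c) with hS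
  have hout : ∀ c ∉ S, kloosSide r φ m n h c = 0 := by
    intro c hc
    unfold kloosSide
    by_cases h1 : 1 ≤ c ∧ r.Coprime c
    · have hcM : cM < c := by
        by_contra hle
        exact hc (by rw [hS, Finset.mem_filter, Finset.mem_Icc]; exact ⟨⟨h1.1, not_lt.1 hle⟩, h1.2⟩)
      rw [if_pos h1, hzero c hcM, mul_zero, zero_mul]
    · rw [if_neg h1]
  have hfin : HasSum (kloosSide r φ m n h) (∑ c ∈ S, kloosSide r φ m n h c) :=
    hasSum_sum_of_ne_finset_zero hout
  rw [hv.unique hfin]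
  refine Finset.sum_congr rfl fun c hc => ?_
  rw [hS, Finset.mem_filter, Finset.mem_Icc] at hc
  unfold kloosSide
  rw [if_pos ⟨hc.1.1, hc.2⟩]

/-- The extension by zero of `conj α` from `S_m` to a dyadic range. [folklore] -/
def extConj (Sm : Finset ℕ) (α : ℕ → ℂ) (m : ℕ) : ℂ := if m ∈ Sm then conj (α m) else 0

/-- `‖∑_{m ∈ S_m} α_m conj(p_m)‖ = ‖∑_{m ∈ T} (extConj α)_m p_m‖` for `S_m ⊆ T`. [folklore] -/
theorem norm_sum_mul_conj_eq {Sm T : Finset ℕ} (hsub : Sm ⊆ T) (α p : ℕ → ℂ) :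
    ‖∑ m ∈ Sm, α m * conj (p m)‖ = ‖∑ m ∈ T, extConj Sm α m * p m‖ := by
  have h1 : ∑ m ∈ T, extConj Sm α m * p m = ∑ m ∈ Sm, conj (α m) * p m := by
    rw [← Finset.sum_subset hsub (f := fun m => extConj Sm α m * p m)]
    · refine Finset.sum_congr rfl fun m hm => by rw [extConj, if_pos hm]
    · intro m _ hm; rw [extConj, if_neg hm, zero_mul]
  have h2 : ∑ m ∈ Sm, conj (α m) * p m = conj (∑ m ∈ Sm, α m * conj (p m)) := by
    rw [map_sum]; refine Finset.sum_congr rfl fun m _ => by rw [map_mul, Complex.conj_conj]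
  rw [h1, h2, Complex.norm_conj]

/-- `‖extConj α‖² = ∑_{S_m} |α_m|²`. [folklore] -/
theorem l2sq_extConj {Sm : Finset ℕ} {M : ℝ} (hsub : Sm ⊆ dyadic M) (α : ℕ → ℂ) :
    l2sq M (extConj Sm α) = ∑ m ∈ Sm, ‖α m‖ ^ 2 := by
  unfold l2sq
  rw [← Finset.sum_subset hsub (f := fun m => ‖extConj Sm α m‖ ^ 2)]
  · refine Finset.sum_congr rfl fun m hm => by rw [extConj, if_pos hm, Complex.norm_conj]
  · intro m _ hm; rw [extConj, if_neg hm]; simp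

/-- `cos(πy) ≥ √2/2 > 0` for `0 < y ≤ 1/4`. [folklore] -/
theorem cos_pi_mul_ge {y : ℝ} (hy0 : 0 < y) (hy : y ≤ 1 / 4) :
    Real.sqrt 2 / 2 ≤ Real.cos (π * y) ∧ 0 < Real.cos (π * y) := by
  have h1 : Real.cos (π / 4) ≤ Real.cos (π * y) := by
    apply Real.cos_le_cos_of_nonneg_of_le_pi (by positivity)
    · linarith [Real.pi_pos]
    · nlinarith [Real.pi_pos]
  rw [Real.cos_pi_div_four] at h1
  exact ⟨h1, lt_of_lt_of_le (by positivity) h1⟩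

/-- `1/cos(πy) ≤ √2` for `0 < y ≤ 1/4`. [folklore] -/
theorem inv_cos_pi_mul_le {y : ℝ} (hy0 : 0 < y) (hy : y ≤ 1 / 4) : (Real.cos (π * y))⁻¹ ≤ Real.sqrt 2 := by
  obtain ⟨h1, h2⟩ := cos_pi_mul_ge hy0 hy
  rw [inv_le_comm₀ h2 (by positivity)]
  have : (Real.sqrt 2)⁻¹ = Real.sqrt 2 / 2 := by
    rw [eq_div_iff two_ne_zero, inv_mul_eq_div, eq_comm]
    have h := Real.mul_self_sqrt (show (0:ℝ) ≤ 2 by norm_num)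
    field_simp
    linarith [h]
  rw [this]; exact h1

/-- `X^{−2y} ≤ Y₁^y Y₂^y` when `X⁻² ≤ Y₁Y₂` (`X, y > 0`, `Y_i ≥ 0`). [folklore] -/
theorem rpow_neg_two_mul_le {X y Y₁ Y₂ : ℝ} (hX : 0 < X) (hy : 0 ≤ y) (hY₁ : 0 ≤ Y₁) (hY₂ : 0 ≤ Y₂)
    (hXY : X⁻¹ ^ 2 ≤ Y₁ * Y₂) : X ^ (-2 * y) ≤ Y₁ ^ y * Y₂ ^ y := by
  have e : X ^ (-2 * y) = (X⁻¹ ^ 2) ^ y := by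
    rw [Real.rpow_mul hX.le, show (-2 : ℝ) = ((2 : ℕ) : ℝ) * (-1) by norm_num, Real.rpow_mul hX.le,
      Real.rpow_neg_one, Real.rpow_natCast]
    ring_nf
  rw [e, ← Real.mul_rpow hY₁ hY₂]
  exact Real.rpow_le_rpow (by positivity) hXY hy

/-- `(Y^y)² = Y^{2y}` for `Y ≥ 0`. [folklore] -/
theorem rpow_sq_eq {Y y : ℝ} (hY : 0 ≤ Y) : (Y ^ y) ^ 2 = Y ^ (2 * y) := by
  rw [mul_comm, Real.rpow_mul hY, Real.rpow_two]

/-- `Γ(k) ≥ 0` for natural `k`. [folklore] -/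
theorem Gamma_nat_nonneg (k : ℕ) : 0 ≤ Real.Gamma (k : ℕ) := by
  rcases Nat.eq_zero_or_pos k with rfl | hk
  · simp [Real.Gamma_zero]
  · exact (Real.Gamma_pos_of_pos (by exact_mod_cast hk)).le

/-- `0 ≤ ω_X(t) ≤ 1`. [folklore] -/
theorem omegaT_nonneg {X : ℝ} (hX : 0 ≤ X) (t : ℝ) : 0 ≤ omegaT X t := by
  unfold omegaT; exact le_min zero_le_one (by positivity)

/-- `ω_X` is continuous in `t`. [folklore] -/
theorem continuous_omegaT (X : ℝ) : Continuous (omegaT X) := by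
  unfold omegaT
  refine continuous_const.min (continuous_const.div (by fun_prop) fun t => ?_)
  positivity

/-- `Λ(X) ≥ 0`. [folklore] -/
theorem LamT_nonneg {X : ℝ} (hX : 0 ≤ X) : 0 ≤ LamT X := by unfold LamT; positivity

/-- `1/(1+X) ≤ Λ(X)`. [folklore] -/
theorem inv_one_add_le_LamT {X : ℝ} (hX : 0 ≤ X) : 1 / (1 + X) ≤ LamT X := by
  unfold LamT
  apply div_le_div_of_nonneg_right _ (by positivity)
  linarith [abs_nonneg (Real.log X)]

/-- The shell factor `14 ((1+X)³)^{2/3} + (3 + log((1+X)³)) D` (`= 14 (1+X)² + (3 + 3 log(1+X)) D`). [folklore] -/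
def regFac (X D : ℝ) : ℝ :=
  14 * ((1 + X) ^ 3) ^ ((2 : ℝ) / 3) + (3 + Real.log ((1 + X) ^ 3)) * D

/-- `1 ≤ (1 + X)³` for `X ≥ 0`. [folklore] -/
theorem one_le_one_add_pow_three {X : ℝ} (hX : 0 ≤ X) : 1 ≤ (1 + X) ^ 3 :=
  one_le_pow₀ (by linarith)

/-- `0 ≤ log((1 + X)³)` for `X ≥ 0`. [folklore] -/
theorem log_one_add_pow_three_nonneg {X : ℝ} (hX : 0 ≤ X) : 0 ≤ Real.log ((1 + X) ^ 3) :=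
  Real.log_nonneg (one_le_one_add_pow_three hX)

/-- `((1 + X)³)^{2/3} = (1 + X)²` for `X ≥ 0`. [folklore] -/
theorem one_add_pow_three_rpow {X : ℝ} (hX : 0 ≤ X) : ((1 + X) ^ 3) ^ ((2 : ℝ) / 3) = (1 + X) ^ 2 := by
  rw [show ((1 + X) ^ 3 : ℝ) = (1 + X) ^ ((3 : ℕ) : ℝ) by rw [Real.rpow_natCast], ← Real.rpow_mul (by linarith)]
  norm_num

/-- `regFac ≥ 0` for `X, D ≥ 0`. [folklore] -/
theorem regFac_nonneg {X D : ℝ} (hX : 0 ≤ X) (hD : 0 ≤ D) : 0 ≤ regFac X D := by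
  unfold regFac
  have := log_one_add_pow_three_nonneg hX
  positivity

/-- **Shells, discrete form used at each level.** [cite: DeshouillersIwaniec1982, §9.1 p. 279] -/
theorem shell_disc {κ : Type*} (tv g : κ → ℝ) (hg : ∀ f, 0 ≤ g f) {KK D X : ℝ} (hKK : 0 ≤ KK)
    (hD : 0 ≤ D) (hX : 0 ≤ X)
    (hLS : ∀ T : ℝ, 1 ≤ T → ∀ F : Finset κ, (∀ f ∈ F, |tv f| ≤ T) → ∑ f ∈ F, g f ≤ KK * (T ^ 2 + D))
    (F : Finset κ) : ∑ f ∈ F, omegaT X (tv f) * g f ≤ KK * regFac X D := by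
  have hB : 1 ≤ (1 + X) ^ 3 := one_le_one_add_pow_three hX
  have := weighted_sum_le_of_largeSieve F tv g (fun f _ => hg f) hKK hD hB
    (fun T hT => hLS T hT _ fun f hf => (Finset.mem_filter.1 hf).2)
  exact this

/-- **Shells, continuous form used at each level.** [cite: DeshouillersIwaniec1982, §9.1 p. 279] -/
theorem shell_eis {nc : ℕ} (G : Fin nc → ℝ → ℂ) (hGm : ∀ 𝔠, Measurable (G 𝔠)) {KK D X : ℝ} (hKK : 0 ≤ KK)
    (hD : 0 ≤ D) (hX : 0 ≤ X)
    (hLS : ∀ T : ℝ, 1 ≤ T →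
      IntegrableOn (fun t : ℝ => ∑ 𝔠, ‖G 𝔠 t‖ ^ 2 / Real.cosh (π * t)) (Set.Icc (-T) T) ∧
      ∫ t in Set.Icc (-T) T, ∑ 𝔠, ‖G 𝔠 t‖ ^ 2 / Real.cosh (π * t) ≤ KK * (T ^ 2 + D)) :
    ∑ 𝔠, ∫⁻ t, ENNReal.ofReal (omegaT X t / Real.cosh (π * t) * ‖G 𝔠 t‖ ^ 2) ≤
      ENNReal.ofReal (KK * regFac X D) := by
  have hB : 1 ≤ (1 + X) ^ 3 := one_le_one_add_pow_three hX
  set Gt : ℝ → ℝ≥0∞ := fun t => ENNReal.ofReal (∑ 𝔠, ‖G 𝔠 t‖ ^ 2 / Real.cosh (π * t)) with hGt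
  have hcosh : ∀ t : ℝ, 0 < Real.cosh (π * t) := fun t => Real.cosh_pos _
  -- rewrite the left side as `∫⁻ ofReal(ω) * Gt`
  have hmeas : ∀ 𝔠, Measurable fun t => ENNReal.ofReal (omegaT X t / Real.cosh (π * t) * ‖G 𝔠 t‖ ^ 2) := by
    intro 𝔠
    refine ENNReal.measurable_ofReal.comp ?_
    exact (((continuous_omegaT X).div (Real.continuous_cosh.comp (continuous_const.mul continuous_id))
      fun t => (hcosh t).ne').measurable.mul ((hGm 𝔠).norm.pow_const 2))
  have hlhs : ∑ 𝔠, ∫⁻ t, ENNReal.ofReal (omegaT X t / Real.cosh (π * t) * ‖G 𝔠 t‖ ^ 2) =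
      ∫⁻ t, ENNReal.ofReal (omegaT X t) * Gt t := by
    rw [← lintegral_finsetSum _ fun 𝔠 _ => hmeas 𝔠]
    refine lintegral_congr fun t => ?_
    rw [hGt]
    simp only
    rw [← ENNReal.ofReal_sum_of_nonneg (fun 𝔠 _ => by
      exact mul_nonneg (div_nonneg (omegaT_nonneg hX t) (hcosh t).le) (by positivity))]
    rw [← ENNReal.ofReal_mul (omegaT_nonneg hX t)]
    congr 1
    rw [Finset.mul_sum]
    refine Finset.sum_congr rfl fun 𝔠 _ => by rw [div_mul_eq_mul_div, mul_div_assoc]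
  rw [hlhs]
  refine weighted_lintegral_le_of_largeSieve Gt hKK hD hB fun T hT => ?_
  obtain ⟨hint, hle⟩ := hLS T hT
  rw [hGt]
  rw [← ofReal_integral_eq_lintegral_ofReal hint (Filter.Eventually.of_forall fun t => by
    exact Finset.sum_nonneg fun 𝔠 _ => div_nonneg (by positivity) (hcosh t).le)]
  exact ENNReal.ofReal_le_ofReal hle

/-! ### The sign-dependent spectral data at one level -/

/-- `‖z / r‖ = ‖z‖ / r` for real `r > 0`. [folklore] -/
theorem norm_div_ofReal_pos (z : ℂ) {x : ℝ} (hx : 0 < x) : ‖z / (x : ℂ)‖ = ‖z‖ / x := by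
  rw [norm_div, Complex.norm_real, Real.norm_eq_abs, abs_of_pos hx]

/-- **The spectral data at level `r` for the sign `s = ±1`**, extracted from `KuzPlus`/`KuzMinus` and
the cusp-`0` hypotheses: weights `w` (with their bounds), the sign-adjusted `n`-side arrays, the values
of the spectral series, the `n`-side large-sieve and exceptional bounds for the given coefficients
`β`, and the identity "finite Kloosterman side = spectral side". [cite: DeshouillersIwaniec1982, §9.1 (9.2) p. 279] -/
theorem sign_data (D : ℕ → SpecData) (W : KuzTransforms) {ε A K₂ K₄ K₆ K₇ : ℝ}
    (hA0 : 0 ≤ A) (hK₆ : 0 ≤ K₆)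
    (hKp : KuzPlus D W) (hKm : KuzMinus D W)
    (hL2 : LSMaassZeroAt D ε K₂) (hL4 : LSEisZeroAt D ε K₄) (hL6 : LSHolZeroAt D ε K₆) (hE5 : ExcFiveAt D ε K₇)
    {X : ℝ} (hX : 0 < X) {φ : ℝ → ℂ} (hadm : KuzAdmissible φ)
    (htpl : ∀ t, ‖W.Tpl φ t‖ ≤ A * LamT X * omegaT X t) (htmi : ∀ t, ‖W.Tmi φ t‖ ≤ A * LamT X * omegaT X t)
    (hthol : ∀ k : ℕ, ‖W.Thol φ k‖ ≤ A * LamT X * omegaT X k)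
    (htx : ∀ y, 0 < y → y ≤ 1 / 4 →
      ‖W.TplX φ y‖ ≤ A * LamT X * (1 + X ^ (-2 * y)) ∧ ‖W.TmiX φ y‖ ≤ A * LamT X * (1 + X ^ (-2 * y)))
    {N : ℝ} (hN : 1 / 2 ≤ N) {r : ℕ} (hr : 1 ≤ r) {s : ℤ} (hs : s = 1 ∨ s = -1)
    (Sm : Finset ℕ) (hSm1 : ∀ m ∈ Sm, 1 ≤ m) (βv : ℕ → ℂ) (cM : ℕ)
    (hcM : ∀ m ∈ Sm, ∀ n ∈ dyadic N, ∀ c : ℕ, cM < c → φ (xK m n r c) = 0)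
    {Y₂ : ℝ} (hY₂ : 1 ≤ Y₂) :
    ∃ (wM : (D r).ι → ℂ) (wX : (D r).ιe → ℂ) (wE : ℝ → ℂ) (wH : (D r).ιh → ℂ)
      (Qn : (D r).ι → ℕ → ℂ) (Qen : (D r).ιe → ℕ → ℂ) (QEn : Fin (D r).nc → ℝ → ℕ → ℂ)
      (QHn : (D r).ιh → ℕ → ℂ) (vM vX vH : ℕ → ℕ → ℂ),
      (∀ f, ‖wM f‖ ≤ A * LamT X * (omegaT X ((D r).t f) / Real.cosh (π * (D r).t f))) ∧
      (∀ f, ‖wX f‖ ≤ A * LamT X * (1 + X ^ (-2 * (D r).y f)) * (Real.cos (π * (D r).y f))⁻¹) ∧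
      (∀ t, ‖wE t‖ ≤ A * LamT X * (omegaT X t / Real.cosh (π * t))) ∧
      (∀ f, ‖wH f‖ ≤ A * LamT X * (omegaT X ((D r).wt f) * Real.Gamma ((D r).wt f))) ∧
      (∀ T : ℝ, 1 ≤ T → ∀ F : Finset (D r).ι, (∀ f ∈ F, |(D r).t f| ≤ T) → ∀ Fe : Finset (D r).ιe,
        ∑ f ∈ F, ‖∑ n ∈ dyadic N, βv n * Qn f n‖ ^ 2 / Real.cosh (π * (D r).t f) +
          ∑ f ∈ Fe, ‖∑ n ∈ dyadic N, βv n * Qen f n‖ ^ 2 / Real.cos (π * (D r).y f) ≤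
          K₂ * (T ^ 2 + N ^ (1 + ε) / r) * l2sq N βv) ∧
      (∀ T : ℝ, 1 ≤ T →
        IntegrableOn (fun t : ℝ => ∑ 𝔠, ‖∑ n ∈ dyadic N, βv n * QEn 𝔠 t n‖ ^ 2 / Real.cosh (π * t))
            (Set.Icc (-T) T) ∧
          ∫ t in Set.Icc (-T) T, ∑ 𝔠, ‖∑ n ∈ dyadic N, βv n * QEn 𝔠 t n‖ ^ 2 / Real.cosh (π * t) ≤
            K₄ * (T ^ 2 + N ^ (1 + ε) / r) * l2sq N βv) ∧
      (∀ T : ℝ, 1 ≤ T → ∀ F : Finset (D r).ιh, (∀ f ∈ F, ((D r).wt f : ℝ) ≤ T) →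
        ∑ f ∈ F, Real.Gamma ((D r).wt f) * ‖∑ n ∈ dyadic N, βv n * QHn f n‖ ^ 2 ≤
          K₆ * (T ^ 2 + N ^ (1 + ε) / r) * l2sq N βv) ∧
      (∀ Fe : Finset (D r).ιe, ∑ f ∈ Fe, Y₂ ^ (2 * (D r).y f) * ‖∑ n ∈ dyadic N, βv n * Qen f n‖ ^ 2 ≤
          K₇ * (1 + Real.sqrt (N * Y₂ / r)) * (1 + Real.sqrt (N / r) * N ^ ε) * l2sq N βv) ∧
      (∀ 𝔠 n, Measurable fun t => QEn 𝔠 t n) ∧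
      (∀ m ∈ Sm, ∀ n ∈ dyadic N, HasSum (fun f => wM f * conj ((D r).P f m) * Qn f n) (vM m n)) ∧
      (∀ m ∈ Sm, ∀ n ∈ dyadic N, HasSum (fun f => wX f * conj ((D r).Pe f m) * Qen f n) (vX m n)) ∧
      (∀ m ∈ Sm, ∀ n ∈ dyadic N, HasSum (fun f => wH f * conj ((D r).PH f m) * QHn f n) (vH m n)) ∧
      (∀ m ∈ Sm, ∀ n ∈ dyadic N, ∀ 𝔠, Integrable (fun t => wE t * conj ((D r).PE 𝔠 t m) * QEn 𝔠 t n)) ∧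
      (∀ m ∈ Sm, ∀ n ∈ dyadic N,
        ∑ c ∈ (Finset.Icc 1 cM).filter (fun c => r.Coprime c),
            ((((c : ℝ) * Real.sqrt r)⁻¹ : ℝ) : ℂ) * φ (xK m n r c) * kl c r n (s * m) =
          vM m n + vX m n + (∑ 𝔠, (1 / (4 * π) : ℂ) * ∫ t, wE t * conj ((D r).PE 𝔠 t m) * QEn 𝔠 t n) +
            vH m n) := by
  have hN0 : 0 < N := by linarith
  have hn1 : ∀ n ∈ dyadic N, 1 ≤ n := fun n hn =>
    Nat.one_le_iff_ne_zero.2 (pos_of_mem_dyadic hN0.le hn).ne'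
  have hcosh : ∀ x : ℝ, 0 < Real.cosh (π * x) := fun x => Real.cosh_pos _
  have hcos : ∀ f : (D r).ιe, 0 < Real.cos (π * (D r).y f) := fun f =>
    (cos_pi_mul_ge ((D r).hy f).1 ((D r).hy f).2).2
  -- weight bounds, both signs
  have hwbd : ∀ (T : ℝ → ℂ), (∀ t, ‖T t‖ ≤ A * LamT X * omegaT X t) →
      ∀ x : ℝ, ‖T x / (Real.cosh (π * x) : ℂ)‖ ≤ A * LamT X * (omegaT X x / Real.cosh (π * x)) := by
    intro T hT x
    rw [norm_div_ofReal_pos _ (hcosh x), ← mul_div_assoc]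
    exact div_le_div_of_nonneg_right (hT x) (hcosh x).le
  have hwxbd : ∀ (T : ℝ → ℂ), (∀ y, 0 < y → y ≤ 1 / 4 → ‖T y‖ ≤ A * LamT X * (1 + X ^ (-2 * y))) →
      ∀ f : (D r).ιe, ‖T ((D r).y f) / (Real.cos (π * (D r).y f) : ℂ)‖ ≤
        A * LamT X * (1 + X ^ (-2 * (D r).y f)) * (Real.cos (π * (D r).y f))⁻¹ := by
    intro T hT f
    rw [norm_div_ofReal_pos _ (hcos f), div_eq_mul_inv]
    exact mul_le_mul_of_nonneg_right (hT _ ((D r).hy f).1 ((D r).hy f).2) (inv_nonneg.2 (hcos f).le)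
  rcases hs with rfl | rfl
  · -- the sign `+`
    choose! vM vX vH hMs hXs hEs hHs htot using hKp r hr φ hadm
    refine ⟨fun f => W.Tpl φ ((D r).t f) / (Real.cosh (π * (D r).t f) : ℂ),
      fun f => W.TplX φ ((D r).y f) / (Real.cos (π * (D r).y f) : ℂ),
      fun t => W.Tpl φ t / (Real.cosh (π * t) : ℂ),
      fun f => W.Thol φ ((D r).wt f) * (Real.Gamma ((D r).wt f) : ℂ),
      fun f n => (D r).Q f n, fun f n => (D r).Qe f n, fun 𝔠 t n => (D r).QE 𝔠 t n, fun f n => (D r).QH f n,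
      vM, vX, vH, fun f => hwbd _ htpl _, fun f => hwxbd _ (fun y hy hy' => (htx y hy hy').1) f,
      fun t => hwbd _ htpl t, ?_, ?_, ?_, ?_, ?_, ?_, ?_, ?_, ?_, ?_, ?_⟩
    · intro f
      rw [norm_mul, Complex.norm_real, Real.norm_eq_abs, abs_of_nonneg (Gamma_nat_nonneg _), ← mul_assoc]
      exact mul_le_mul_of_nonneg_right (hthol _) (Gamma_nat_nonneg _)
    · intro T hT F hF Fe
      have := hL2 r hr T N hT hN βv 1 (Or.inl rfl) F hF Fe
      simpa only [one_mul] using this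
    · intro T hT
      have := hL4 r hr T N hT hN βv 1 (Or.inl rfl)
      simpa only [one_mul] using this
    · intro T hT F hF
      exact hL6 r hr T N hT hN βv F hF
    · intro Fe
      have := hE5 r hr Y₂ N hY₂ hN βv 1 (Or.inl rfl) Fe
      simpa only [one_mul] using this
    · intro 𝔠 n; exact (D r).mQE 𝔠 n
    · intro m hm n hn; exact hMs m n (hSm1 m hm) (hn1 n hn)
    · intro m hm n hn; exact hXs m n (hSm1 m hm) (hn1 n hn)
    · intro m hm n hn; exact hHs m n (hSm1 m hm) (hn1 n hn)
    · intro m hm n hn 𝔠; exact hEs m n (hSm1 m hm) (hn1 n hn) 𝔠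
    · intro m hm n hn
      have h := htot m n (hSm1 m hm) (hn1 n hn)
      have := kloos_finsum_eq h (fun c hc => hcM m hm n hn c hc)
      simpa only [one_mul] using this
  · -- the sign `−`
    choose! vM vX hMs hXs hEs htot using hKm r hr φ hadm
    refine ⟨fun f => W.Tmi φ ((D r).t f) / (Real.cosh (π * (D r).t f) : ℂ),
      fun f => W.TmiX φ ((D r).y f) / (Real.cos (π * (D r).y f) : ℂ),
      fun t => W.Tmi φ t / (Real.cosh (π * t) : ℂ),
      fun _ => 0,
      fun f n => (D r).Q f (-(n : ℤ)), fun f n => (D r).Qe f (-(n : ℤ)), fun 𝔠 t n => (D r).QE 𝔠 t (-(n : ℤ)),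
      fun _ _ => 0,
      vM, vX, fun _ _ => 0, fun f => hwbd _ htmi _, fun f => hwxbd _ (fun y hy hy' => (htx y hy hy').2) f,
      fun t => hwbd _ htmi t, ?_, ?_, ?_, ?_, ?_, ?_, ?_, ?_, ?_, ?_, ?_⟩
    · intro f
      rw [norm_zero]
      exact mul_nonneg (mul_nonneg hA0 (LamT_nonneg hX.le))
        (mul_nonneg (omegaT_nonneg hX.le _) (Gamma_nat_nonneg _))
    · intro T hT F hF Fe
      have := hL2 r hr T N hT hN βv (-1) (Or.inr rfl) F hF Fe
      simpa only [neg_one_mul] using this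
    · intro T hT
      have := hL4 r hr T N hT hN βv (-1) (Or.inr rfl)
      simpa only [neg_one_mul] using this
    · intro T hT F hF
      have h0 : ∑ f ∈ F, Real.Gamma ((D r).wt f) * ‖∑ n ∈ dyadic N, βv n * (0 : ℂ)‖ ^ 2 = 0 := by simp
      rw [h0]
      have : 0 ≤ N ^ (1 + ε) / r := by positivity
      have : 0 ≤ l2sq N βv := Finset.sum_nonneg fun n _ => by positivity
      positivity
    · intro Fe
      have := hE5 r hr Y₂ N hY₂ hN βv (-1) (Or.inr rfl) Fe
      simpa only [neg_one_mul] using this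
    · intro 𝔠 n; exact (D r).mQE 𝔠 (-(n : ℤ))
    · intro m hm n hn; exact hMs m n (hSm1 m hm) (hn1 n hn)
    · intro m hm n hn; exact hXs m n (hSm1 m hm) (hn1 n hn)
    · intro m hm n hn
      have : (fun f : (D r).ιh => (0 : ℂ) * conj ((D r).PH f m) * 0) = fun _ => 0 := by funext f; simp
      rw [this]; exact hasSum_zero
    · intro m hm n hn 𝔠; exact hEs m n (hSm1 m hm) (hn1 n hn) 𝔠
    · intro m hm n hn
      have h := htot m n (hSm1 m hm) (hn1 n hn)
      have := kloos_finsum_eq h (fun c hc => hcM m hm n hn c hc)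
      rw [add_zero]
      simpa only [neg_one_mul] using this

/-! ### One level: assembling the bound -/

/-- **The bound at one level `r` (both signs).** [cite: DeshouillersIwaniec1982, §9.1 (9.3)–(9.8) pp. 279–280] -/
theorem level_mid (D : ℕ → SpecData) (W : KuzTransforms) {ε A K₁ K₂ K₃ K₄ K₅ K₆ K₇ : ℝ}
    (hA0 : 0 ≤ A) (hK₁ : 0 ≤ K₁) (hK₂ : 0 ≤ K₂) (hK₃ : 0 ≤ K₃) (hK₄ : 0 ≤ K₄)
    (hK₅ : 0 ≤ K₅) (hK₆ : 0 ≤ K₆)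
    (hKp : KuzPlus D W) (hKm : KuzMinus D W)
    (hL1 : LSMaassInfAt D ε K₁) (hL2 : LSMaassZeroAt D ε K₂) (hL3 : LSEisInfAt D ε K₃)
    (hL4 : LSEisZeroAt D ε K₄) (hL5 : LSHolInfAt D ε K₅) (hL6 : LSHolZeroAt D ε K₆) (hE5 : ExcFiveAt D ε K₇)
    {X : ℝ} (hX : 0 < X) {φ : ℝ → ℂ} (hadm : KuzAdmissible φ)
    (htpl : ∀ t, ‖W.Tpl φ t‖ ≤ A * LamT X * omegaT X t) (htmi : ∀ t, ‖W.Tmi φ t‖ ≤ A * LamT X * omegaT X t)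
    (hthol : ∀ k : ℕ, ‖W.Thol φ k‖ ≤ A * LamT X * omegaT X k)
    (htx : ∀ y, 0 < y → y ≤ 1 / 4 →
      ‖W.TplX φ y‖ ≤ A * LamT X * (1 + X ^ (-2 * y)) ∧ ‖W.TmiX φ y‖ ≤ A * LamT X * (1 + X ^ (-2 * y)))
    {M N : ℝ} (hM : 1 / 2 ≤ M) (hN : 1 / 2 ≤ N) {r : ℕ} (hr : 1 ≤ r) {s : ℤ} (hs : s = 1 ∨ s = -1)
    (Sm : Finset ℕ) (hSm : Sm ⊆ dyadic M) (α βv : ℕ → ℂ) (cM : ℕ)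
    (hcM : ∀ m ∈ Sm, ∀ n ∈ dyadic N, ∀ c : ℕ, cM < c → φ (xK m n r c) = 0)
    {Y₁ Y₂ : ℝ} (hY₁ : 1 ≤ Y₁) (hY₂ : 1 ≤ Y₂) (hXY : X⁻¹ ^ 2 ≤ Y₁ * Y₂)
    {UA'v : ℝ} (hUA' : ∀ F : Finset (D r).ιe,
      ∑ f ∈ F, Y₁ ^ (2 * (D r).y f) * ‖∑ m ∈ Sm, α m * conj ((D r).Pe f m)‖ ^ 2 ≤ UA'v)
    {lam lam' : ℝ} (hl : 0 < lam) (hl' : 0 < lam') :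
    ‖∑ n ∈ dyadic N, ∑ m ∈ Sm, βv n * α m *
        ∑ c ∈ (Finset.Icc 1 cM).filter (fun c => r.Coprime c),
          ((((c : ℝ) * Real.sqrt r)⁻¹ : ℝ) : ℂ) * φ (xK m n r c) * kl c r n (s * m)‖ ≤
      A * LamT X * (lam * (K₁ * (∑ m ∈ Sm, ‖α m‖ ^ 2) * regFac X (M ^ (1 + ε) / r)) +
          lam⁻¹ * (K₂ * l2sq N βv * regFac X (N ^ (1 + ε) / r))) / 2 +
      (A * LamT X * (lam * (K₁ * (∑ m ∈ Sm, ‖α m‖ ^ 2) * (1 + M ^ (1 + ε) / r)) +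
          lam⁻¹ * (K₂ * l2sq N βv * (1 + N ^ (1 + ε) / r))) / 2 +
        A * Real.sqrt 2 * LamT X * (lam' * UA'v +
          lam'⁻¹ * (K₇ * (1 + Real.sqrt (N * Y₂ / r)) * (1 + Real.sqrt (N / r) * N ^ ε) * l2sq N βv)) / 2) +
      1 / (4 * π) * (A * LamT X) * (lam * (K₃ * (∑ m ∈ Sm, ‖α m‖ ^ 2) * regFac X (M ^ (1 + ε) / r)) +
          lam⁻¹ * (K₄ * l2sq N βv * regFac X (N ^ (1 + ε) / r))) / 2 +
      A * LamT X * (lam * (K₅ * (∑ m ∈ Sm, ‖α m‖ ^ 2) * regFac X (M ^ (1 + ε) / r)) +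
          lam⁻¹ * (K₆ * l2sq N βv * regFac X (N ^ (1 + ε) / r))) / 2 := by
  -- basic facts
  have hM0 : 0 < M := by linarith
  have hN0 : 0 < N := by linarith
  have hSm1 : ∀ m ∈ Sm, 1 ≤ m := fun m hm =>
    Nat.one_le_iff_ne_zero.2 (pos_of_mem_dyadic hM0.le (hSm hm)).ne'
  have hcosh : ∀ x : ℝ, 0 < Real.cosh (π * x) := fun x => Real.cosh_pos _
  set S := D r with hSdef
  have hcos : ∀ f : S.ιe, 0 < Real.cos (π * S.y f) := fun f => (cos_pi_mul_ge (S.hy f).1 (S.hy f).2).2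
  have hnA : 0 ≤ ∑ m ∈ Sm, ‖α m‖ ^ 2 := Finset.sum_nonneg fun m _ => by positivity
  have hnB : 0 ≤ l2sq N βv := Finset.sum_nonneg fun n _ => by positivity
  have hDM : 0 ≤ M ^ (1 + ε) / r := by positivity
  have hDN : 0 ≤ N ^ (1 + ε) / r := by positivity
  have hΛ : 0 ≤ LamT X := LamT_nonneg hX.le
  -- the sign-dependent data
  obtain ⟨wM, wX, wE, wH, Qn, Qen, QEn, QHn, vM, vX, vH, hwM, hwX, hwE, hwH, hLB, hLBE, hLBH, hE5B,
    hQEm, hMs, hXs, hHs, hEs, htot⟩ :=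
    sign_data D W hA0 hK₆ hKp hKm hL2 hL4 hL6 hE5 hX hadm htpl htmi hthol htx hN hr hs Sm hSm1 βv cM hcM hY₂
  -- the bilinear rearrangement
  obtain ⟨hVM, hVX, hVH, hint, hId⟩ := bilinear_core Sm (dyadic N) α βv wM (fun f m => S.P f m) Qn
    wX (fun f m => S.Pe f m) Qen wE (fun 𝔠 t m => S.PE 𝔠 t m) QEn wH (fun f m => S.PH f m) QHn vM vX vH
    (fun m n => ∑ c ∈ (Finset.Icc 1 cM).filter (fun c => r.Coprime c),
          ((((c : ℝ) * Real.sqrt r)⁻¹ : ℝ) : ℂ) * φ (xK m n r c) * kl c r n (s * m))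
    hMs hXs hHs hEs htot
  -- `A`-side large-sieve consequences
  have hLA : ∀ T : ℝ, 1 ≤ T → ∀ F : Finset S.ι, (∀ f ∈ F, |S.t f| ≤ T) →
      ∑ f ∈ F, ‖∑ m ∈ Sm, α m * conj (S.P f m)‖ ^ 2 / Real.cosh (π * S.t f) ≤
        K₁ * (∑ m ∈ Sm, ‖α m‖ ^ 2) * (T ^ 2 + M ^ (1 + ε) / r) := by
    intro T hT F hF
    have h := hL1 r hr T M hT hM (extConj Sm α) F hF ∅
    rw [Finset.sum_empty, add_zero, l2sq_extConj hSm] at h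
    calc ∑ f ∈ F, ‖∑ m ∈ Sm, α m * conj (S.P f m)‖ ^ 2 / Real.cosh (π * S.t f)
        = ∑ f ∈ F, ‖∑ m ∈ dyadic M, extConj Sm α m * S.P f m‖ ^ 2 / Real.cosh (π * S.t f) := by
          refine Finset.sum_congr rfl fun f _ => by rw [norm_sum_mul_conj_eq hSm]
      _ ≤ _ := by rw [mul_right_comm]; exact h
  have hLAX : ∀ Fe : Finset S.ιe,
      ∑ f ∈ Fe, ‖∑ m ∈ Sm, α m * conj (S.Pe f m)‖ ^ 2 / Real.cos (π * S.y f) ≤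
        K₁ * (∑ m ∈ Sm, ‖α m‖ ^ 2) * (1 + M ^ (1 + ε) / r) := by
    intro Fe
    have h := hL1 r hr 1 M le_rfl hM (extConj Sm α) ∅ (by simp) Fe
    rw [Finset.sum_empty, zero_add, l2sq_extConj hSm, one_pow] at h
    calc ∑ f ∈ Fe, ‖∑ m ∈ Sm, α m * conj (S.Pe f m)‖ ^ 2 / Real.cos (π * S.y f)
        = ∑ f ∈ Fe, ‖∑ m ∈ dyadic M, extConj Sm α m * S.Pe f m‖ ^ 2 / Real.cos (π * S.y f) := by
          refine Finset.sum_congr rfl fun f _ => by rw [norm_sum_mul_conj_eq hSm]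
      _ ≤ _ := by rw [mul_right_comm]; exact h
  have hLAE : ∀ T : ℝ, 1 ≤ T →
      IntegrableOn (fun t : ℝ => ∑ 𝔠, ‖∑ m ∈ Sm, α m * conj (S.PE 𝔠 t m)‖ ^ 2 / Real.cosh (π * t))
          (Set.Icc (-T) T) ∧
        ∫ t in Set.Icc (-T) T, ∑ 𝔠, ‖∑ m ∈ Sm, α m * conj (S.PE 𝔠 t m)‖ ^ 2 / Real.cosh (π * t) ≤
          K₃ * (∑ m ∈ Sm, ‖α m‖ ^ 2) * (T ^ 2 + M ^ (1 + ε) / r) := by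
    intro T hT
    have h := hL3 r hr T M hT hM (extConj Sm α)
    have e : (fun t : ℝ => ∑ 𝔠, ‖∑ m ∈ Sm, α m * conj (S.PE 𝔠 t m)‖ ^ 2 / Real.cosh (π * t)) =
        fun t : ℝ => ∑ 𝔠, ‖∑ m ∈ dyadic M, extConj Sm α m * S.PE 𝔠 t m‖ ^ 2 / Real.cosh (π * t) := by
      funext t
      refine Finset.sum_congr rfl fun 𝔠 _ => by rw [norm_sum_mul_conj_eq hSm]
    rw [e, mul_right_comm, ← l2sq_extConj hSm α]
    exact h
  have hLAH : ∀ T : ℝ, 1 ≤ T → ∀ F : Finset S.ιh, (∀ f ∈ F, (S.wt f : ℝ) ≤ T) →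
      ∑ f ∈ F, Real.Gamma (S.wt f) * ‖∑ m ∈ Sm, α m * conj (S.PH f m)‖ ^ 2 ≤
        K₅ * (∑ m ∈ Sm, ‖α m‖ ^ 2) * (T ^ 2 + M ^ (1 + ε) / r) := by
    intro T hT F hF
    have h := hL5 r hr T M hT hM (extConj Sm α) F hF
    rw [l2sq_extConj hSm] at h
    calc ∑ f ∈ F, Real.Gamma (S.wt f) * ‖∑ m ∈ Sm, α m * conj (S.PH f m)‖ ^ 2
        = ∑ f ∈ F, Real.Gamma (S.wt f) * ‖∑ m ∈ dyadic M, extConj Sm α m * S.PH f m‖ ^ 2 := by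
          refine Finset.sum_congr rfl fun f _ => by rw [norm_sum_mul_conj_eq hSm]
      _ ≤ _ := by rw [mul_right_comm]; exact h
  -- measurability of the Eisenstein bilinear factors
  have hAEm : ∀ 𝔠, Measurable fun t => ∑ m ∈ Sm, α m * conj (S.PE 𝔠 t m) := fun 𝔠 =>
    Finset.measurable_sum _ fun m _ => (Complex.continuous_conj.measurable.comp (S.mPE 𝔠 m)).const_mul _
  have hBEm : ∀ 𝔠, Measurable fun t => ∑ n ∈ dyadic N, βv n * QEn 𝔠 t n := fun 𝔠 =>
    Finset.measurable_sum _ fun n _ => (hQEm 𝔠 n).const_mul _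
  -- the exceptional weight bound in the two-weight form
  have hwX' : ∀ f : S.ιe, ‖wX f‖ ≤ A * LamT X * (Real.cos (π * S.y f))⁻¹ +
      A * Real.sqrt 2 * LamT X * (Y₁ ^ S.y f * Y₂ ^ S.y f) := by
    intro f
    have hyf := S.hy f
    refine (hwX f).trans ?_
    have h1 : X ^ (-2 * S.y f) ≤ Y₁ ^ S.y f * Y₂ ^ S.y f :=
      rpow_neg_two_mul_le hX hyf.1.le (by linarith) (by linarith) hXY
    have h2 : (Real.cos (π * S.y f))⁻¹ ≤ Real.sqrt 2 := inv_cos_pi_mul_le hyf.1 hyf.2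
    have h3 : 0 ≤ (Real.cos (π * S.y f))⁻¹ := inv_nonneg.2 (hcos f).le
    have h4 : 0 ≤ X ^ (-2 * S.y f) := by positivity
    have hA1 : 0 ≤ A * LamT X := by positivity
    calc A * LamT X * (1 + X ^ (-2 * S.y f)) * (Real.cos (π * S.y f))⁻¹
        = A * LamT X * (Real.cos (π * S.y f))⁻¹ +
            A * LamT X * (X ^ (-2 * S.y f) * (Real.cos (π * S.y f))⁻¹) := by ring
      _ ≤ A * LamT X * (Real.cos (π * S.y f))⁻¹ +
            A * LamT X * ((Y₁ ^ S.y f * Y₂ ^ S.y f) * Real.sqrt 2) := by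
          gcongr
      _ = _ := by ring
  -- apply the abstract one-level bound
  have key := level_core wM (fun f => ∑ m ∈ Sm, α m * conj (S.P f m)) (fun f => ∑ n ∈ dyadic N, βv n * Qn f n)
    wX (fun f => ∑ m ∈ Sm, α m * conj (S.Pe f m)) (fun f => ∑ n ∈ dyadic N, βv n * Qen f n)
    wE (fun 𝔠 t => ∑ m ∈ Sm, α m * conj (S.PE 𝔠 t m)) (fun 𝔠 t => ∑ n ∈ dyadic N, βv n * QEn 𝔠 t n)
    wH (fun f => ∑ m ∈ Sm, α m * conj (S.PH f m)) (fun f => ∑ n ∈ dyadic N, βv n * QHn f n)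
    hVM hVX hVH hId
    (fun f => omegaT X (S.t f) / Real.cosh (π * S.t f)) (fun f => div_nonneg (omegaT_nonneg hX.le _) (hcosh _).le)
    (fun f => (Real.cos (π * S.y f))⁻¹) (fun f => Y₁ ^ S.y f) (fun f => Y₂ ^ S.y f)
    (fun f => inv_nonneg.2 (hcos f).le)
    (fun t => omegaT X t / Real.cosh (π * t)) (fun t => div_nonneg (omegaT_nonneg hX.le _) (hcosh _).le)
    (((continuous_omegaT X).div (Real.continuous_cosh.comp (continuous_const.mul continuous_id))
      fun t => (hcosh t).ne').measurable)
    (fun f => omegaT X (S.wt f) * Real.Gamma (S.wt f))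
    (fun f => mul_nonneg (omegaT_nonneg hX.le _) (Gamma_nat_nonneg _))
    (c := A * LamT X) (cX := A * LamT X) (cX' := A * Real.sqrt 2 * LamT X)
    (by positivity) (by positivity) (by positivity) hwM hwX' hwE hwH hAEm hBEm
    (UAM := K₁ * (∑ m ∈ Sm, ‖α m‖ ^ 2) * regFac X (M ^ (1 + ε) / r))
    (UBM := K₂ * l2sq N βv * regFac X (N ^ (1 + ε) / r))
    (UAX := K₁ * (∑ m ∈ Sm, ‖α m‖ ^ 2) * (1 + M ^ (1 + ε) / r))
    (UBX := K₂ * l2sq N βv * (1 + N ^ (1 + ε) / r))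
    (UA' := UA'v)
    (UB' := K₇ * (1 + Real.sqrt (N * Y₂ / r)) * (1 + Real.sqrt (N / r) * N ^ ε) * l2sq N βv)
    (UAE := K₃ * (∑ m ∈ Sm, ‖α m‖ ^ 2) * regFac X (M ^ (1 + ε) / r))
    (UBE := K₄ * l2sq N βv * regFac X (N ^ (1 + ε) / r))
    (UAH := K₅ * (∑ m ∈ Sm, ‖α m‖ ^ 2) * regFac X (M ^ (1 + ε) / r))
    (UBH := K₆ * l2sq N βv * regFac X (N ^ (1 + ε) / r))
    (by have := regFac_nonneg hX.le hDM; positivity) (by have := regFac_nonneg hX.le hDN; positivity)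
    ?_ ?_ ?_ ?_ ?_ ?_ ?_ ?_ ?_ ?_ hl hl'
  · exact key
  · -- hAM
    intro F
    have := shell_disc (fun f : S.ι => S.t f)
      (fun f => ‖∑ m ∈ Sm, α m * conj (S.P f m)‖ ^ 2 / Real.cosh (π * S.t f))
      (fun f => div_nonneg (by positivity) (hcosh _).le) (mul_nonneg hK₁ hnA) hDM hX.le
      (fun T hT F hF => hLA T hT F hF) F
    refine le_of_eq_of_le ?_ this
    refine Finset.sum_congr rfl fun f _ => by ring
  · -- hBM
    intro F
    have := shell_disc (fun f : S.ι => S.t f)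
      (fun f => ‖∑ n ∈ dyadic N, βv n * Qn f n‖ ^ 2 / Real.cosh (π * S.t f))
      (fun f => div_nonneg (by positivity) (hcosh _).le) (mul_nonneg hK₂ hnB) hDN hX.le
      (fun T hT F hF => by
        have h := hLB T hT F hF ∅
        rw [Finset.sum_empty, add_zero] at h
        rw [mul_right_comm]; exact h) F
    refine le_of_eq_of_le ?_ this
    refine Finset.sum_congr rfl fun f _ => by ring
  · -- hAX
    intro F
    refine le_of_eq_of_le ?_ (hLAX F)
    refine Finset.sum_congr rfl fun f _ => by rw [div_eq_inv_mul]
  · -- hBX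
    intro F
    have h := hLB 1 le_rfl ∅ (by simp) F
    rw [Finset.sum_empty, zero_add, one_pow] at h
    have h' : ∑ f ∈ F, ‖∑ n ∈ dyadic N, βv n * Qen f n‖ ^ 2 / Real.cos (π * S.y f) ≤
        K₂ * l2sq N βv * (1 + N ^ (1 + ε) / r) := by rw [mul_right_comm]; exact h
    refine le_of_eq_of_le ?_ h'
    refine Finset.sum_congr rfl fun f _ => by rw [div_eq_inv_mul]
  · -- hA'
    intro F
    refine le_of_eq_of_le ?_ (hUA' F)
    refine Finset.sum_congr rfl fun f _ => by rw [rpow_sq_eq (by linarith)]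
  · -- hB'
    intro F
    refine le_of_eq_of_le ?_ (hE5B F)
    refine Finset.sum_congr rfl fun f _ => by rw [rpow_sq_eq (by linarith)]
  · -- hAE
    have := shell_eis (fun 𝔠 t => ∑ m ∈ Sm, α m * conj (S.PE 𝔠 t m)) hAEm (mul_nonneg hK₃ hnA) hDM hX.le
      (fun T hT => hLAE T hT)
    refine le_of_eq_of_le ?_ this
    refine Finset.sum_congr rfl fun 𝔠 _ => lintegral_congr fun t => by ring_nf
  · -- hBE
    have := shell_eis (fun 𝔠 t => ∑ n ∈ dyadic N, βv n * QEn 𝔠 t n) hBEm (mul_nonneg hK₄ hnB) hDN hX.le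
      (fun T hT => by
        obtain ⟨h1, h2⟩ := hLBE T hT
        exact ⟨h1, by rw [mul_right_comm]; exact h2⟩)
    refine le_of_eq_of_le ?_ this
    refine Finset.sum_congr rfl fun 𝔠 _ => lintegral_congr fun t => by ring_nf
  · -- hAH
    intro F
    have := shell_disc (fun f : S.ιh => (S.wt f : ℝ))
      (fun f => Real.Gamma (S.wt f) * ‖∑ m ∈ Sm, α m * conj (S.PH f m)‖ ^ 2)
      (fun f => mul_nonneg (Gamma_nat_nonneg _) (by positivity)) (mul_nonneg hK₅ hnA) hDM hX.le
      (fun T hT F hF => hLAH T hT F fun f hf => (abs_le.1 (hF f hf)).2) F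
    refine le_of_eq_of_le ?_ this
    refine Finset.sum_congr rfl fun f _ => by ring
  · -- hBH
    intro F
    have := shell_disc (fun f : S.ιh => (S.wt f : ℝ))
      (fun f => Real.Gamma (S.wt f) * ‖∑ n ∈ dyadic N, βv n * QHn f n‖ ^ 2)
      (fun f => mul_nonneg (Gamma_nat_nonneg _) (by positivity)) (mul_nonneg hK₆ hnB) hDN hX.le
      (fun T hT F hF => by
        have h := hLBH T hT F fun f hf => (abs_le.1 (hF f hf)).2
        rw [mul_right_comm]; exact h) F
    refine le_of_eq_of_le ?_ this
    refine Finset.sum_congr rfl fun f _ => by ring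




/-! ### Real inequalities for the final conversion -/

/-- `√(a + b) ≤ √a + √b`. [folklore] -/
private theorem sqrt_add_le_sqrt_add_sqrt {a b : ℝ} (ha : 0 ≤ a) (hb : 0 ≤ b) :
    Real.sqrt (a + b) ≤ Real.sqrt a + Real.sqrt b := by
  rw [Real.sqrt_le_left (by positivity)]
  nlinarith [Real.sq_sqrt ha, Real.sq_sqrt hb, Real.sqrt_nonneg a, Real.sqrt_nonneg b]

/-- `R + M + √M ≤ 2 (√(R/2) + √M)²` for `R ≥ 1/2`, `M ≥ 0`. [folklore] -/
theorem R_add_M_add_sqrt_le {R M : ℝ} (hR : 1 / 2 ≤ R) (hM : 0 ≤ M) :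
    R + M + Real.sqrt M ≤ 2 * (Real.sqrt (R / 2) + Real.sqrt M) ^ 2 := by
  have h1 : (Real.sqrt (R / 2) + Real.sqrt M) ^ 2 = R / 2 + M + 2 * (Real.sqrt (R / 2) * Real.sqrt M) := by
    nlinarith [Real.sq_sqrt (show 0 ≤ R / 2 by linarith), Real.sq_sqrt hM]
  rw [h1]
  -- `√M ≤ 2 √(R/2) √M · 2 /… `: since `√(R/2) ≥ 1/2`
  have h2 : 1 / 2 ≤ Real.sqrt (R / 2) := by
    rw [show (1 / 2 : ℝ) = Real.sqrt (1 / 4) by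
      rw [show (1 / 4 : ℝ) = (1 / 2) ^ 2 by norm_num, Real.sqrt_sq (by norm_num)]]
    exact Real.sqrt_le_sqrt (by linarith)
  have h3 : Real.sqrt M ≤ 4 * (Real.sqrt (R / 2) * Real.sqrt M) := by
    nlinarith [Real.sqrt_nonneg M]
  nlinarith [Real.sqrt_nonneg M, Real.sqrt_nonneg (R / 2)]

/-- `√((R + M + √M) M) ≤ √2 √(R/2) (1 + X + √(M/(R/2))) √M`. [folklore] -/
theorem sqrt_core_le {X R M : ℝ} (hX : 0 ≤ X) (hR : 1 / 2 ≤ R) (hM : 0 ≤ M) :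
    Real.sqrt ((R + M + Real.sqrt M) * M) ≤
      Real.sqrt 2 * (Real.sqrt (R / 2) * (1 + X + Real.sqrt (M / (R / 2))) * Real.sqrt M) := by
  have hR2 : 0 < R / 2 := by linarith
  have h1 := R_add_M_add_sqrt_le hR hM
  have hsum : 0 ≤ Real.sqrt (R / 2) + Real.sqrt M := by positivity
  calc Real.sqrt ((R + M + Real.sqrt M) * M)
      ≤ Real.sqrt (2 * (Real.sqrt (R / 2) + Real.sqrt M) ^ 2 * M) := by
        apply Real.sqrt_le_sqrt; exact mul_le_mul_of_nonneg_right h1 hM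
    _ = Real.sqrt 2 * (Real.sqrt (R / 2) + Real.sqrt M) * Real.sqrt M := by
        rw [Real.sqrt_mul (by positivity), Real.sqrt_mul (by positivity), Real.sqrt_sq hsum]
    _ = Real.sqrt 2 * (Real.sqrt (R / 2) * (1 + Real.sqrt (M / (R / 2))) * Real.sqrt M) := by
        have h : Real.sqrt (R / 2) * Real.sqrt (M / (R / 2)) = Real.sqrt M := by
          rw [← Real.sqrt_mul hR2.le, mul_div_cancel₀ _ hR2.ne']
        have e : Real.sqrt (R / 2) + Real.sqrt M = Real.sqrt (R / 2) * (1 + Real.sqrt (M / (R / 2))) := by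
          rw [mul_add, mul_one, h]
        rw [e]; ring
    _ ≤ Real.sqrt 2 * (Real.sqrt (R / 2) * (1 + X + Real.sqrt (M / (R / 2))) * Real.sqrt M) := by
        gcongr
        linarith

/-- `(1+X) L_reg` written out. [folklore] -/
theorem one_add_mul_Lreg {X M N R : ℝ} (hX : 0 < X) :
    (1 + X) * Lreg X M N R =
      (1 + X + Real.sqrt (N / (R / 2))) * (1 + X + Real.sqrt (M / (R / 2))) * Real.sqrt (R / 2) * Real.sqrt M := by
  unfold Lreg
  field_simp

/-- `(1+X) L_exc` written out. [folklore] -/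
theorem one_add_mul_Lexc {X M N R : ℝ} (hX : 0 < X) (hR : 0 < R) :
    (1 + X) * Lexc X M N R =
      (1 + Real.sqrt (N / (R / 2))) * Real.sqrt (1 + X⁻¹) * Real.sqrt (Real.sqrt (M * N / (R / 2 + N))) *
        Real.sqrt M := by
  unfold Lexc
  have hR2 : 0 < R / 2 := by linarith
  have e : Real.sqrt ((1 + X⁻¹) / (R / 2)) * Real.sqrt (R / 2) = Real.sqrt (1 + X⁻¹) := by
    rw [Real.sqrt_div' _ hR2.le, div_mul_cancel₀ _ (Real.sqrt_pos.2 hR2).ne']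
  have hX1 : (1 + X) ≠ 0 := by positivity
  calc (1 + X) * ((1 + Real.sqrt (N / (R / 2))) * Real.sqrt ((1 + X⁻¹) / (R / 2)) *
        Real.sqrt (Real.sqrt (M * N / (R / 2 + N))) * (Real.sqrt (R / 2) / (1 + X)) * Real.sqrt M)
      = (1 + Real.sqrt (N / (R / 2))) * (Real.sqrt ((1 + X⁻¹) / (R / 2)) * Real.sqrt (R / 2)) *
          Real.sqrt (Real.sqrt (M * N / (R / 2 + N))) * Real.sqrt M * ((1 + X) / (1 + X)) := by ring
    _ = _ := by rw [e, div_self hX1, mul_one]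

/-- The second-term comparison of the exceptional conversion: if `U ≤ (9/4) V` (`U, V ≥ 0`) then
`√(U X⁻¹) ≤ (3/2) √(1 + X⁻¹) √V`. [folklore] -/
theorem sqrt_second_le {U V X : ℝ} (hX : 0 < X) (hV : 0 ≤ V) (h : U ≤ 9 / 4 * V) :
    Real.sqrt (U * X⁻¹) ≤ 3 / 2 * (Real.sqrt (1 + X⁻¹) * Real.sqrt V) := by
  have hXi : 0 < X⁻¹ := inv_pos.2 hX
  have h1 : U * X⁻¹ ≤ (9 / 4) * ((1 + X⁻¹) * V) := by nlinarith
  calc Real.sqrt (U * X⁻¹) ≤ Real.sqrt ((9 / 4) * ((1 + X⁻¹) * V)) := Real.sqrt_le_sqrt h1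
    _ = 3 / 2 * (Real.sqrt (1 + X⁻¹) * Real.sqrt V) := by
        rw [Real.sqrt_mul (by norm_num), Real.sqrt_mul (by positivity),
          show Real.sqrt (9 / 4 : ℝ) = 3 / 2 by
            rw [show (9 / 4 : ℝ) = (3 / 2) ^ 2 by norm_num, Real.sqrt_sq (by norm_num)]]

/-- **The exceptional conversion** (both cases `N ≥ R`, `N < R`): with `Y₂ = max(1, R/N)`,
`Y₁ = max(1, X⁻²/Y₂)`,
`√((R + M + √(M Y₁)) M) · √((1 + √(N Y₂/R))(1 + √(N/R))) ≤ 3 (1 + X)(L_reg + L_exc)`.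
[cite: DeshouillersIwaniec1982, §9.1 (9.5)–(9.8) p. 280; Drappeau2017, Prop. 4.12] -/
theorem exc_algebra {X M N R Y₁ Y₂ : ℝ} (hX : 0 < X) (hM : 1 / 2 ≤ M) (hN : 1 / 2 ≤ N) (hR : 1 / 2 ≤ R)
    (hY₂ : Y₂ = max 1 (R / N)) (hY₁ : Y₁ = max 1 (X⁻¹ ^ 2 / Y₂)) :
    Real.sqrt ((R + M + Real.sqrt (M * Y₁)) * M) *
        Real.sqrt ((1 + Real.sqrt (N * Y₂ / R)) * (1 + Real.sqrt (N / R))) ≤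
      3 * (1 + X) * (Lreg X M N R + Lexc X M N R) := by
  have hM0 : 0 < M := by linarith
  have hN0 : 0 < N := by linarith
  have hR0 : 0 < R := by linarith
  have hXi : 0 < X⁻¹ := inv_pos.2 hX
  have hY₂1 : 1 ≤ Y₂ := by rw [hY₂]; exact le_max_left _ _
  have hY₂0 : 0 < Y₂ := by linarith
  have hY₁1 : 1 ≤ Y₁ := by rw [hY₁]; exact le_max_left _ _
  have hY₁0 : 0 < Y₁ := by linarith
  -- names for `(1+X) L_reg`, `(1+X) L_exc`
  set P' := (1 + X) * Lreg X M N R with hP'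
  set Q' := (1 + X) * Lexc X M N R with hQ'
  have eP := one_add_mul_Lreg (M := M) (N := N) (R := R) hX
  have eQ := one_add_mul_Lexc (M := M) (N := N) hX hR0
  have hP0 : 0 ≤ P' := by rw [hP', eP]; positivity
  have hQ0 : 0 ≤ Q' := by rw [hQ', eQ]; positivity
  -- `√Y₁ ≤ 1 + X⁻¹/√Y₂`
  have hsY₁ : Real.sqrt Y₁ ≤ 1 + X⁻¹ / Real.sqrt Y₂ := by
    have h1 : Y₁ ≤ 1 + X⁻¹ ^ 2 / Y₂ := by
      rw [hY₁]
      have h0 : 0 ≤ X⁻¹ ^ 2 / Y₂ := by positivity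
      exact max_le (by linarith) (by linarith)
    calc Real.sqrt Y₁ ≤ Real.sqrt (1 + X⁻¹ ^ 2 / Y₂) := Real.sqrt_le_sqrt h1
      _ ≤ Real.sqrt 1 + Real.sqrt (X⁻¹ ^ 2 / Y₂) := sqrt_add_le_sqrt_add_sqrt zero_le_one (by positivity)
      _ = 1 + X⁻¹ / Real.sqrt Y₂ := by rw [Real.sqrt_one, Real.sqrt_div' _ hY₂0.le, Real.sqrt_sq hXi.le]
  -- the first factor
  have hF1 : Real.sqrt ((R + M + Real.sqrt (M * Y₁)) * M) ≤
      Real.sqrt 2 * (Real.sqrt (R / 2) * (1 + X + Real.sqrt (M / (R / 2))) * Real.sqrt M) +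
        Real.sqrt M * Real.sqrt (Real.sqrt M * (X⁻¹ / Real.sqrt Y₂)) := by
    have h1 : Real.sqrt (M * Y₁) ≤ Real.sqrt M + Real.sqrt M * (X⁻¹ / Real.sqrt Y₂) := by
      rw [Real.sqrt_mul hM0.le]
      have := mul_le_mul_of_nonneg_left hsY₁ (Real.sqrt_nonneg M)
      linarith
    have h2 : (R + M + Real.sqrt (M * Y₁)) * M ≤
        (R + M + Real.sqrt M) * M + M * (Real.sqrt M * (X⁻¹ / Real.sqrt Y₂)) := by nlinarith
    calc Real.sqrt ((R + M + Real.sqrt (M * Y₁)) * M)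
        ≤ Real.sqrt ((R + M + Real.sqrt M) * M + M * (Real.sqrt M * (X⁻¹ / Real.sqrt Y₂))) := Real.sqrt_le_sqrt h2
      _ ≤ Real.sqrt ((R + M + Real.sqrt M) * M) + Real.sqrt (M * (Real.sqrt M * (X⁻¹ / Real.sqrt Y₂))) :=
          sqrt_add_le_sqrt_add_sqrt (by positivity) (by positivity)
      _ ≤ _ := by
          rw [Real.sqrt_mul hM0.le]
          exact add_le_add (sqrt_core_le hX.le hR hM0.le) le_rfl
  have hF1nonneg : 0 ≤ Real.sqrt 2 * (Real.sqrt (R / 2) * (1 + X + Real.sqrt (M / (R / 2))) * Real.sqrt M) := by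
    positivity
  -- `T1 ≤ √2 P'` pieces
  have hT1 : Real.sqrt 2 * (Real.sqrt (R / 2) * (1 + X + Real.sqrt (M / (R / 2))) * Real.sqrt M) *
      (1 + X + Real.sqrt (N / (R / 2))) = Real.sqrt 2 * P' := by rw [hP', eP]; ring
  have hNfac1 : 1 ≤ 1 + X + Real.sqrt (N / (R / 2)) := by
    have : 0 ≤ Real.sqrt (N / (R / 2)) := Real.sqrt_nonneg _; linarith
  have hs2 : Real.sqrt 2 ≤ 3 / 2 := by
    rw [Real.sqrt_le_left (by norm_num)]; norm_num
  rcases le_or_gt R N with hRN | hNR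
  · -- Case `R ≤ N`: `Y₂ = 1`
    have hY₂e : Y₂ = 1 := by rw [hY₂]; exact max_eq_left ((div_le_one hN0).2 hRN)
    have hF2 : Real.sqrt ((1 + Real.sqrt (N * Y₂ / R)) * (1 + Real.sqrt (N / R))) = 1 + Real.sqrt (N / R) := by
      rw [hY₂e, mul_one, ← pow_two, Real.sqrt_sq (by positivity)]
    have hNR' : Real.sqrt (N / R) ≤ Real.sqrt (N / (R / 2)) :=
      Real.sqrt_le_sqrt (div_le_div_of_nonneg_left hN0.le (by linarith) (by linarith))
    -- second term
    have hsec : Real.sqrt (Real.sqrt M * (X⁻¹ / Real.sqrt Y₂)) ≤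
        3 / 2 * (Real.sqrt (1 + X⁻¹) * Real.sqrt (Real.sqrt (M * N / (R / 2 + N)))) := by
      rw [hY₂e, Real.sqrt_one, div_one]
      apply sqrt_second_le hX (Real.sqrt_nonneg _)
      -- `√M ≤ 9/4 √(MN/(R/2+N))`
      have h1 : M ≤ (9 / 4) ^ 2 * (M * N / (R / 2 + N)) := by
        have hden : 0 < R / 2 + N := by positivity
        rw [← mul_div_assoc, le_div_iff₀ hden]; nlinarith
      calc Real.sqrt M ≤ Real.sqrt ((9 / 4) ^ 2 * (M * N / (R / 2 + N))) := Real.sqrt_le_sqrt h1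
        _ = 9 / 4 * Real.sqrt (M * N / (R / 2 + N)) := by
            rw [Real.sqrt_mul (by positivity), Real.sqrt_sq (by norm_num)]
    have hT2 : Real.sqrt M * (3 / 2 * (Real.sqrt (1 + X⁻¹) * Real.sqrt (Real.sqrt (M * N / (R / 2 + N))))) *
        (1 + Real.sqrt (N / R)) ≤ 3 / 2 * Q' := by
      rw [hQ', eQ]
      have h0 : 0 ≤ Real.sqrt M * (3 / 2 * (Real.sqrt (1 + X⁻¹) * Real.sqrt (Real.sqrt (M * N / (R / 2 + N))))) := by
        positivity
      calc Real.sqrt M * (3 / 2 * (Real.sqrt (1 + X⁻¹) * Real.sqrt (Real.sqrt (M * N / (R / 2 + N))))) *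
            (1 + Real.sqrt (N / R))
          ≤ Real.sqrt M * (3 / 2 * (Real.sqrt (1 + X⁻¹) * Real.sqrt (Real.sqrt (M * N / (R / 2 + N))))) *
            (1 + Real.sqrt (N / (R / 2))) := mul_le_mul_of_nonneg_left (by linarith) h0
        _ = _ := by ring
    calc Real.sqrt ((R + M + Real.sqrt (M * Y₁)) * M) *
          Real.sqrt ((1 + Real.sqrt (N * Y₂ / R)) * (1 + Real.sqrt (N / R)))
        ≤ (Real.sqrt 2 * (Real.sqrt (R / 2) * (1 + X + Real.sqrt (M / (R / 2))) * Real.sqrt M) +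
            Real.sqrt M * (3 / 2 * (Real.sqrt (1 + X⁻¹) * Real.sqrt (Real.sqrt (M * N / (R / 2 + N)))))) *
            (1 + Real.sqrt (N / R)) := by
          rw [hF2]
          apply mul_le_mul_of_nonneg_right _ (by positivity)
          exact hF1.trans (add_le_add le_rfl (mul_le_mul_of_nonneg_left hsec (Real.sqrt_nonneg _)))
      _ ≤ Real.sqrt 2 * P' + 3 / 2 * Q' := by
          rw [add_mul]
          refine add_le_add ?_ hT2
          rw [← hT1]
          exact mul_le_mul_of_nonneg_left (by linarith) hF1nonneg
      _ ≤ 3 * (1 + X) * (Lreg X M N R + Lexc X M N R) := by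
          have : 3 * (1 + X) * (Lreg X M N R + Lexc X M N R) = 3 * P' + 3 * Q' := by rw [hP', hQ']; ring
          rw [this]
          linarith [mul_le_mul_of_nonneg_right hs2 hP0]
  · -- Case `N < R`: `Y₂ = R/N`
    have hY₂e : Y₂ = R / N := by rw [hY₂]; exact max_eq_right ((one_le_div hN0).2 hNR.le)
    have hsNR : Real.sqrt (N / R) ≤ 1 := by
      rw [Real.sqrt_le_one]; exact (div_le_one hR0).2 hNR.le
    have hF2 : Real.sqrt ((1 + Real.sqrt (N * Y₂ / R)) * (1 + Real.sqrt (N / R))) ≤ 2 := by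
      have e : N * Y₂ / R = 1 := by rw [hY₂e]; field_simp
      rw [e, Real.sqrt_one, Real.sqrt_le_left (by norm_num)]
      linarith [hsNR]
    have hrec : X⁻¹ / Real.sqrt Y₂ = X⁻¹ * Real.sqrt (N / R) := by
      rw [hY₂e, div_eq_mul_inv, ← Real.sqrt_inv, inv_div]
    have hsec : Real.sqrt (Real.sqrt M * (X⁻¹ / Real.sqrt Y₂)) ≤
        3 / 2 * (Real.sqrt (1 + X⁻¹) * Real.sqrt (Real.sqrt (M * N / (R / 2 + N)))) := by
      rw [hrec, show Real.sqrt M * (X⁻¹ * Real.sqrt (N / R)) = (Real.sqrt M * Real.sqrt (N / R)) * X⁻¹ by ring]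
      apply sqrt_second_le hX (Real.sqrt_nonneg _)
      rw [← Real.sqrt_mul hM0.le]
      have h1 : M * (N / R) ≤ (9 / 4) ^ 2 * (M * N / (R / 2 + N)) := by
        have hden : 0 < R / 2 + N := by positivity
        have hp : 0 < M * N := mul_pos hM0 hN0
        have hp1 : M * N * N < M * N * R := mul_lt_mul_of_pos_left hNR hp
        have hp2 : 0 ≤ M * N * R := by positivity
        calc M * (N / R) = (M * N) / R := by ring
          _ ≤ ((9 / 4) ^ 2 * (M * N)) / (R / 2 + N) := by
              rw [div_le_div_iff₀ hR0 hden]; linarith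
          _ = (9 / 4) ^ 2 * (M * N / (R / 2 + N)) := by ring
      calc Real.sqrt (M * (N / R)) ≤ Real.sqrt ((9 / 4) ^ 2 * (M * N / (R / 2 + N))) := Real.sqrt_le_sqrt h1
        _ = 9 / 4 * Real.sqrt (M * N / (R / 2 + N)) := by
            rw [Real.sqrt_mul (by positivity), Real.sqrt_sq (by norm_num)]
    have hT2 : Real.sqrt M * (3 / 2 * (Real.sqrt (1 + X⁻¹) * Real.sqrt (Real.sqrt (M * N / (R / 2 + N))))) * 2 ≤
        3 * Q' := by
      rw [hQ', eQ]
      have h0 : 0 ≤ Real.sqrt M * (Real.sqrt (1 + X⁻¹) * Real.sqrt (Real.sqrt (M * N / (R / 2 + N)))) := by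
        positivity
      have h1 : (1 : ℝ) ≤ 1 + Real.sqrt (N / (R / 2)) := by
        have := Real.sqrt_nonneg (N / (R / 2)); linarith
      have e1 : Real.sqrt M * (3 / 2 * (Real.sqrt (1 + X⁻¹) * Real.sqrt (Real.sqrt (M * N / (R / 2 + N))))) * 2 =
          3 * (Real.sqrt M * (Real.sqrt (1 + X⁻¹) * Real.sqrt (Real.sqrt (M * N / (R / 2 + N))))) := by ring
      have e2 : 3 * ((1 + Real.sqrt (N / (R / 2))) * Real.sqrt (1 + X⁻¹) *
          Real.sqrt (Real.sqrt (M * N / (R / 2 + N))) * Real.sqrt M) =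
          3 * ((1 + Real.sqrt (N / (R / 2))) *
            (Real.sqrt M * (Real.sqrt (1 + X⁻¹) * Real.sqrt (Real.sqrt (M * N / (R / 2 + N)))))) := by ring
      rw [e1, e2]
      exact mul_le_mul_of_nonneg_left (le_mul_of_one_le_left h0 h1) (by norm_num)
    have hT1' : Real.sqrt 2 * (Real.sqrt (R / 2) * (1 + X + Real.sqrt (M / (R / 2))) * Real.sqrt M) * 2 ≤
        2 * (Real.sqrt 2 * P') := by
      rw [← hT1]
      linarith [mul_le_mul_of_nonneg_left hNfac1 hF1nonneg]
    calc Real.sqrt ((R + M + Real.sqrt (M * Y₁)) * M) *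
          Real.sqrt ((1 + Real.sqrt (N * Y₂ / R)) * (1 + Real.sqrt (N / R)))
        ≤ (Real.sqrt 2 * (Real.sqrt (R / 2) * (1 + X + Real.sqrt (M / (R / 2))) * Real.sqrt M) +
            Real.sqrt M * (3 / 2 * (Real.sqrt (1 + X⁻¹) * Real.sqrt (Real.sqrt (M * N / (R / 2 + N)))))) * 2 := by
          refine mul_le_mul ?_ hF2 (Real.sqrt_nonneg _) ?_
          · exact hF1.trans (add_le_add le_rfl (mul_le_mul_of_nonneg_left hsec (Real.sqrt_nonneg _)))
          · positivity
      _ ≤ 2 * (Real.sqrt 2 * P') + 3 * Q' := by rw [add_mul]; exact add_le_add hT1' hT2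
      _ ≤ 3 * (1 + X) * (Lreg X M N R + Lexc X M N R) := by
          have : 3 * (1 + X) * (Lreg X M N R + Lexc X M N R) = 3 * P' + 3 * Q' := by rw [hP', hQ']; ring
          rw [this]
          linarith [mul_le_mul_of_nonneg_right hs2 hP0]

/-! ### Preparations for the main theorem -/

/-- `kuzSum` level by level, with the coefficient `β_{n,r} e(θm)` pulled in front of the `c`-sum. [folklore] -/
theorem kuzSum_eq_sum_inner (φ : ℝ → ℂ) (θ R N : ℝ) (a u : ℕ) (sgn : ℤ) (cM : ℕ) (β : ℕ → ℕ → ℂ) :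
    kuzSum φ θ R N a u sgn cM β = ∑ r ∈ dyadic R, ∑ n ∈ dyadic N, ∑ m ∈ Finset.Ioc a u,
      β n r * ((𝐞 (θ * m) : Circle) : ℂ) *
        ∑ c ∈ (Finset.Icc 1 cM).filter (fun c => r.Coprime c),
          ((((c : ℝ) * Real.sqrt r)⁻¹ : ℝ) : ℂ) * φ (xK m n r c) * kl c r n (sgn * m) := by
  unfold kuzSum
  refine Finset.sum_congr rfl fun r _ => Finset.sum_congr rfl fun n _ => ?_
  rw [Finset.mul_sum]
  refine Finset.sum_congr rfl fun m _ => by ring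

/-- A smooth `φ` supported in `[X, 2X]`, `X > 0`, is admissible. [folklore] -/
theorem kuzAdmissible_of_support {X : ℝ} (hX : 0 < X) {φ : ℝ → ℂ} (hφ1 : ContDiff ℝ ∞ φ)
    (hφ2 : ∀ x, φ x ≠ 0 → x ∈ Set.Icc X (2 * X)) : KuzAdmissible φ := by
  have hsupp : Function.support φ ⊆ Set.Icc X (2 * X) := fun x hx => hφ2 x hx
  have hts : tsupport φ ⊆ Set.Icc X (2 * X) := closure_minimal hsupp isClosed_Icc
  refine ⟨hφ1, ?_, hts.trans fun x hx => ?_⟩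
  · exact IsCompact.of_isClosed_subset isCompact_Icc (isClosed_tsupport φ) hts
  · exact lt_of_lt_of_le hX hx.1

/-- Beyond the cutoff `c > c_M ≥ 8π√(MN)/(X√R)` the test function vanishes at `x = 4π√(mn)/(c√r)`
(`m ≤ 2M`, `n ∼ N`, `r ∼ R`). [folklore] -/
theorem phi_xK_eq_zero {X M N R : ℝ} (hX : 0 < X) (hM0 : 0 < M) (hN0 : 0 < N) (hR0 : 0 < R) {φ : ℝ → ℂ}
    (hφ2 : ∀ x, φ x ≠ 0 → x ∈ Set.Icc X (2 * X)) {m n r c cM : ℕ} (hm0 : 0 < m) (hm : (m : ℝ) ≤ 2 * M)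
    (hn : n ∈ dyadic N) (hr : r ∈ dyadic R) (hcM : 8 * π * Real.sqrt (M * N) / (X * Real.sqrt R) ≤ cM)
    (hc : cM < c) : φ (xK m n r c) = 0 := by
  by_contra h
  have hx := (hφ2 _ h).1
  obtain ⟨hnN, hn2⟩ := (mem_dyadic hN0.le).1 hn
  obtain ⟨hrR, hr2⟩ := (mem_dyadic hR0.le).1 hr
  have hm' : (0 : ℝ) < m := by exact_mod_cast hm0
  have hn' : (0 : ℝ) < n := lt_trans hN0 hnN
  have hr' : (0 : ℝ) < r := lt_trans hR0 hrR
  have hc' : (cM : ℝ) < c := by exact_mod_cast hc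
  have hc0 : (0 : ℝ) < c := lt_of_le_of_lt (Nat.cast_nonneg _) hc'
  have hsR : Real.sqrt R ≤ Real.sqrt r := Real.sqrt_le_sqrt hrR.le
  have hsRpos : 0 < Real.sqrt R := Real.sqrt_pos.2 hR0
  have hmn : Real.sqrt ((m : ℝ) * n) ≤ 2 * Real.sqrt (M * N) := by
    have e : (2 : ℝ) * Real.sqrt (M * N) = Real.sqrt (2 ^ 2 * (M * N)) := by
      rw [Real.sqrt_mul (by norm_num) (M * N), Real.sqrt_sq (by norm_num)]
    rw [e]
    exact Real.sqrt_le_sqrt (by nlinarith)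
  -- `x ≤ 8π√(MN)/(c√R) < X`
  have h1 : xK m n r c ≤ 8 * π * Real.sqrt (M * N) / ((c : ℝ) * Real.sqrt R) := by
    unfold xK
    rw [div_le_div_iff₀ (by positivity) (by positivity)]
    have : 4 * π * Real.sqrt ((m : ℝ) * n) * ((c : ℝ) * Real.sqrt R) ≤
        4 * π * (2 * Real.sqrt (M * N)) * ((c : ℝ) * Real.sqrt r) := by
      apply mul_le_mul (by nlinarith [Real.pi_pos]) (by nlinarith) (by positivity) (by positivity)
    linarith
  have h2 : 8 * π * Real.sqrt (M * N) / ((c : ℝ) * Real.sqrt R) < X := by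
    rw [div_lt_iff₀ (by positivity)]
    have h3 : 8 * π * Real.sqrt (M * N) ≤ cM * (X * Real.sqrt R) := by
      rwa [div_le_iff₀ (by positivity)] at hcM
    nlinarith [mul_pos hX hsRpos]
  linarith

/-- `conj e(x) = e(−x)` in `ℂ`. [folklore] -/
private theorem conj_e_eq (x : ℝ) : conj ((𝐞 x : Circle) : ℂ) = ((𝐞 (-x) : Circle) : ℂ) := by
  rw [AddChar.map_neg_eq_inv, Circle.coe_inv_eq_conj]

/-- `‖∑_{m ∈ S} e(θm) conj(p_m)‖ = ‖∑_{m ∈ S} e(−θm) p_m‖`. [folklore] -/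
theorem norm_sum_e_mul_conj (S : Finset ℕ) (θ : ℝ) (p : ℕ → ℂ) :
    ‖∑ m ∈ S, ((𝐞 (θ * m) : Circle) : ℂ) * conj (p m)‖ = ‖∑ m ∈ S, ((𝐞 (-θ * m) : Circle) : ℂ) * p m‖ := by
  have : ∑ m ∈ S, ((𝐞 (θ * m) : Circle) : ℂ) * conj (p m) = conj (∑ m ∈ S, ((𝐞 (-θ * m) : Circle) : ℂ) * p m) := by
    rw [map_sum]
    refine Finset.sum_congr rfl fun m _ => ?_
    rw [map_mul (starRingEnd ℂ), conj_e_eq, neg_mul, neg_neg]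
  rw [this, Complex.norm_conj]

/-- `‖x − y‖² ≤ 2‖x‖² + 2‖y‖²`. [folklore] -/
private theorem norm_sub_sq_le (x y : ℂ) : ‖x - y‖ ^ 2 ≤ 2 * ‖x‖ ^ 2 + 2 * ‖y‖ ^ 2 := by
  have h := norm_sub_le x y
  have h2 : ‖x - y‖ ^ 2 ≤ (‖x‖ + ‖y‖) ^ 2 := pow_le_pow_left₀ (norm_nonneg _) h 2
  nlinarith [sq_nonneg (‖x‖ - ‖y‖)]

/-- `(a, u] = [1, u] ∖ [1, a]` as a difference of sums. [folklore] -/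
theorem sum_Ioc_eq_sub (a u : ℕ) (hau : a ≤ u) (g : ℕ → ℂ) :
    ∑ m ∈ Finset.Ioc a u, g m = ∑ m ∈ Finset.Icc 1 u, g m - ∑ m ∈ Finset.Icc 1 a, g m := by
  have hsub : Finset.Icc 1 a ⊆ Finset.Icc 1 u := Finset.Icc_subset_Icc le_rfl hau
  rw [← Finset.sum_sdiff hsub, add_sub_cancel_right]
  congr 1
  ext m
  simp only [Finset.mem_sdiff, Finset.mem_Icc, Finset.mem_Ioc]
  omega

/-- **The `A`-side exceptional bound from (E7)**: summed over the levels `r ∼ R`, for the twisted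
interval `(a, u] ⊆ (M, 2M]`, `∑_r ∑_f Y₁^{2y_f} |∑_{a<m≤u} e(θm) conj(√m ρ_{f∞}(m))|² ≤
16 K (4RM)^ε (R + M + √(M Y₁)) M`. [cite: DeshouillersIwaniec1982, §9.1 (9.7) p. 280, Theorem 7 (1.41)] -/
theorem exc_A_bound (D : ℕ → SpecData) {ε K : ℝ} (hε : 0 ≤ ε) (hK : 0 ≤ K) (hE7 : ExcSevenAt D ε K)
    {R M : ℝ} (hR : 1 / 2 ≤ R) (hM : 1 / 2 ≤ M) (θ : ℝ) {a u : ℕ} (hau : a < u) (huM : (u : ℝ) ≤ 2 * M)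
    {Y₁ : ℝ} (hY₁ : 1 ≤ Y₁) (Fsel : (r : ℕ) → Finset (D r).ιe) :
    ∑ r ∈ dyadic R, ∑ f ∈ Fsel r, Y₁ ^ (2 * (D r).y f) *
        ‖∑ m ∈ Finset.Ioc a u, ((𝐞 (θ * m) : Circle) : ℂ) * conj ((D r).Pe f m)‖ ^ 2 ≤
      16 * K * (4 * R * M) ^ ε * (R + M + Real.sqrt (M * Y₁)) * M := by
  classical
  have hR0 : 0 < R := by linarith
  have hM0 : 0 < M := by linarith
  have hu1 : (1 : ℝ) ≤ u := by exact_mod_cast Nat.lt_of_le_of_lt (Nat.zero_le a) hau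
  have h2R : (1 : ℝ) ≤ 2 * R := by linarith
  -- extend the selection by `∅` outside `r ∼ R`
  set Fsel' : (q : ℕ) → Finset (D q).ιe := fun q => if q ∈ dyadic R then Fsel q else ∅ with hFsel'
  have hsubq : dyadic R ⊆ Finset.Icc 1 ⌊2 * R⌋₊ := by
    intro r hr
    obtain ⟨h1, h2⟩ := (mem_dyadic hR0.le).1 hr
    rw [Finset.mem_Icc]
    refine ⟨Nat.one_le_iff_ne_zero.2 (pos_of_mem_dyadic hR0.le hr).ne', Nat.le_floor h2⟩
  -- the quantity `S(N')` and its bound by (E7)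
  have hS : ∀ N' : ℕ, (N' : ℝ) ≤ 2 * M →
      ∑ r ∈ dyadic R, ∑ f ∈ Fsel r, Y₁ ^ (2 * (D r).y f) *
          ‖∑ m ∈ Finset.Icc 1 N', ((𝐞 (-θ * m) : Circle) : ℂ) * (D r).Pe f m‖ ^ 2 ≤
        K * (4 * R * M) ^ ε * (2 * R + 2 * M + Real.sqrt (2 * M * Y₁)) * (2 * M) := by
    intro N' hN'
    rcases Nat.eq_zero_or_pos N' with h0 | hpos
    · subst h0
      simp only [show Finset.Icc 1 0 = ∅ by rfl, Finset.sum_empty, norm_zero, ne_eq, OfNat.ofNat_ne_zero,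
        not_false_eq_true, zero_pow, mul_zero, Finset.sum_const_zero]
      positivity
    · have hN'1 : (1 : ℝ) ≤ N' := by exact_mod_cast hpos
      have h := hE7 (-θ) (2 * R) N' Y₁ h2R hN'1 hY₁ Fsel'
      rw [Nat.floor_natCast] at h
      -- restrict the level sum to `r ∼ R`
      have hrestr : ∑ r ∈ dyadic R, ∑ f ∈ Fsel r, Y₁ ^ (2 * (D r).y f) *
            ‖∑ m ∈ Finset.Icc 1 N', ((𝐞 (-θ * m) : Circle) : ℂ) * (D r).Pe f m‖ ^ 2 =
          ∑ q ∈ Finset.Icc 1 ⌊2 * R⌋₊, ∑ f ∈ Fsel' q, Y₁ ^ (2 * (D q).y f) *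
            ‖∑ m ∈ Finset.Icc 1 N', ((𝐞 (-θ * m) : Circle) : ℂ) * (D q).Pe f m‖ ^ 2 := by
        rw [← Finset.sum_subset hsubq]
        · refine Finset.sum_congr rfl fun r hr => by rw [hFsel']; simp only [if_pos hr]
        · intro q _ hq; rw [hFsel']; simp only [if_neg hq, Finset.sum_empty]
      rw [hrestr]
      refine h.trans ?_
      -- monotonicity in `N' ≤ 2M`
      have hN'0 : (0 : ℝ) ≤ N' := Nat.cast_nonneg _
      have e1 : (2 * R * N') ^ ε ≤ (4 * R * M) ^ ε :=
        Real.rpow_le_rpow (by positivity) (by nlinarith) hε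
      have e2 : Real.sqrt (N' * Y₁) ≤ Real.sqrt (2 * M * Y₁) :=
        Real.sqrt_le_sqrt (by nlinarith)
      have e3 : 2 * R + N' + Real.sqrt (N' * Y₁) ≤ 2 * R + 2 * M + Real.sqrt (2 * M * Y₁) := by linarith
      have : 0 ≤ K * (2 * R * N') ^ ε := by positivity
      have hfin : K * (2 * R * N') ^ ε * (2 * R + N' + Real.sqrt (N' * Y₁)) * N' ≤
          K * (4 * R * M) ^ ε * (2 * R + 2 * M + Real.sqrt (2 * M * Y₁)) * (2 * M) := by
        gcongr
      exact hfin
  -- split `(a,u] = [1,u] ∖ [1,a]`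
  have hterm : ∀ r : ℕ, ∀ f : (D r).ιe,
      Y₁ ^ (2 * (D r).y f) * ‖∑ m ∈ Finset.Ioc a u, ((𝐞 (θ * m) : Circle) : ℂ) * conj ((D r).Pe f m)‖ ^ 2 ≤
        2 * (Y₁ ^ (2 * (D r).y f) * ‖∑ m ∈ Finset.Icc 1 u, ((𝐞 (-θ * m) : Circle) : ℂ) * (D r).Pe f m‖ ^ 2) +
        2 * (Y₁ ^ (2 * (D r).y f) * ‖∑ m ∈ Finset.Icc 1 a, ((𝐞 (-θ * m) : Circle) : ℂ) * (D r).Pe f m‖ ^ 2) := by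
    intro r f
    rw [norm_sum_e_mul_conj, sum_Ioc_eq_sub a u hau.le]
    have hY : 0 ≤ Y₁ ^ (2 * (D r).y f) := by positivity
    nlinarith [norm_sub_sq_le (∑ m ∈ Finset.Icc 1 u, ((𝐞 (-θ * m) : Circle) : ℂ) * (D r).Pe f m)
      (∑ m ∈ Finset.Icc 1 a, ((𝐞 (-θ * m) : Circle) : ℂ) * (D r).Pe f m)]
  have haM : (a : ℝ) ≤ 2 * M := le_trans (by exact_mod_cast hau.le) huM
  calc ∑ r ∈ dyadic R, ∑ f ∈ Fsel r, Y₁ ^ (2 * (D r).y f) *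
          ‖∑ m ∈ Finset.Ioc a u, ((𝐞 (θ * m) : Circle) : ℂ) * conj ((D r).Pe f m)‖ ^ 2
      ≤ ∑ r ∈ dyadic R, ∑ f ∈ Fsel r,
          (2 * (Y₁ ^ (2 * (D r).y f) * ‖∑ m ∈ Finset.Icc 1 u, ((𝐞 (-θ * m) : Circle) : ℂ) * (D r).Pe f m‖ ^ 2) +
          2 * (Y₁ ^ (2 * (D r).y f) * ‖∑ m ∈ Finset.Icc 1 a, ((𝐞 (-θ * m) : Circle) : ℂ) * (D r).Pe f m‖ ^ 2)) :=
        Finset.sum_le_sum fun r _ => Finset.sum_le_sum fun f _ => hterm r f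
    _ = 2 * (∑ r ∈ dyadic R, ∑ f ∈ Fsel r, Y₁ ^ (2 * (D r).y f) *
            ‖∑ m ∈ Finset.Icc 1 u, ((𝐞 (-θ * m) : Circle) : ℂ) * (D r).Pe f m‖ ^ 2) +
        2 * (∑ r ∈ dyadic R, ∑ f ∈ Fsel r, Y₁ ^ (2 * (D r).y f) *
            ‖∑ m ∈ Finset.Icc 1 a, ((𝐞 (-θ * m) : Circle) : ℂ) * (D r).Pe f m‖ ^ 2) := by
        rw [Finset.mul_sum, Finset.mul_sum, ← Finset.sum_add_distrib]
        refine Finset.sum_congr rfl fun r _ => ?_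
        rw [Finset.mul_sum, Finset.mul_sum, ← Finset.sum_add_distrib]
    _ ≤ 2 * (K * (4 * R * M) ^ ε * (2 * R + 2 * M + Real.sqrt (2 * M * Y₁)) * (2 * M)) +
        2 * (K * (4 * R * M) ^ ε * (2 * R + 2 * M + Real.sqrt (2 * M * Y₁)) * (2 * M)) := by
        gcongr
        · exact hS u huM
        · exact hS a haM
    _ ≤ 16 * K * (4 * R * M) ^ ε * (R + M + Real.sqrt (M * Y₁)) * M := by
        have h1 : Real.sqrt (2 * M * Y₁) ≤ 2 * Real.sqrt (M * Y₁) := by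
          have e : (2 : ℝ) * Real.sqrt (M * Y₁) = Real.sqrt (2 ^ 2 * (M * Y₁)) := by
            rw [Real.sqrt_mul (by norm_num) (M * Y₁), Real.sqrt_sq (by norm_num)]
          rw [e]
          exact Real.sqrt_le_sqrt (by nlinarith)
        have h0 : 0 ≤ K * (4 * R * M) ^ ε := by positivity
        have h2 : 2 * R + 2 * M + Real.sqrt (2 * M * Y₁) ≤ 2 * (R + M + Real.sqrt (M * Y₁)) := by linarith
        have h3 := mul_le_mul_of_nonneg_left h2 h0
        have h4 := mul_le_mul_of_nonneg_right h3 hM0.le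
        nlinarith [h4]

/-! ### The final clean-up inequalities -/

/-- `regFac X D + 1 + D ≤ 5 (3 + log((1+X)³)) ((1+X)² + D)`. [folklore] -/
theorem regFac_add_le {X D : ℝ} (hX : 0 ≤ X) (hD : 0 ≤ D) :
    regFac X D + 1 + D ≤ 5 * (3 + Real.log ((1 + X) ^ 3)) * ((1 + X) ^ 2 + D) := by
  unfold regFac
  rw [one_add_pow_three_rpow hX]
  set ℓ := 3 + Real.log ((1 + X) ^ 3) with hl
  have hℓ : 3 ≤ ℓ := by have := log_one_add_pow_three_nonneg hX; rw [hl]; linarith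
  have hX2 : 1 ≤ (1 + X) ^ 2 := one_le_pow₀ (by linarith)
  have h1 : 14 * (1 + X) ^ 2 + 1 ≤ 5 * ℓ * (1 + X) ^ 2 := by nlinarith
  have h2 : ℓ * D + D ≤ 5 * ℓ * D := by nlinarith
  nlinarith

/-- `√((1+X)² + M^{1+ε}/R) ≤ (2M)^{ε/2} (1 + X + √(M/(R/2)))`. [folklore] -/
theorem sqrt_bracket_le {X M R ε : ℝ} (hX : 0 ≤ X) (hM : 1 / 2 ≤ M) (hR : 1 / 2 ≤ R) (hε : 0 ≤ ε) :
    Real.sqrt ((1 + X) ^ 2 + M ^ (1 + ε) / R) ≤ (2 * M) ^ (ε / 2) * (1 + X + Real.sqrt (M / (R / 2))) := by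
  have hM0 : 0 < M := by linarith
  have hR0 : 0 < R := by linarith
  have h2M : 1 ≤ 2 * M := by linarith
  have hpow1 : 1 ≤ (2 * M) ^ ε := Real.one_le_rpow h2M hε
  have hMe : M ^ (1 + ε) ≤ M * (2 * M) ^ ε := by
    rw [Real.rpow_add hM0, Real.rpow_one]
    exact mul_le_mul_of_nonneg_left (Real.rpow_le_rpow hM0.le (by linarith) hε) hM0.le
  have hX2 : 0 ≤ (1 + X) ^ 2 := by positivity
  have h1 : (1 + X) ^ 2 + M ^ (1 + ε) / R ≤ (2 * M) ^ ε * ((1 + X) ^ 2 + M / R) := by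
    have : M ^ (1 + ε) / R ≤ (2 * M) ^ ε * (M / R) := by
      rw [div_le_iff₀ hR0]; calc M ^ (1 + ε) ≤ M * (2 * M) ^ ε := hMe
        _ = (2 * M) ^ ε * (M / R) * R := by field_simp
    nlinarith
  have hsq : Real.sqrt ((2 * M) ^ ε) = (2 * M) ^ (ε / 2) := by
    rw [Real.sqrt_eq_rpow, ← Real.rpow_mul (by linarith)]; ring_nf
  calc Real.sqrt ((1 + X) ^ 2 + M ^ (1 + ε) / R) ≤ Real.sqrt ((2 * M) ^ ε * ((1 + X) ^ 2 + M / R)) :=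
        Real.sqrt_le_sqrt h1
    _ = (2 * M) ^ (ε / 2) * Real.sqrt ((1 + X) ^ 2 + M / R) := by rw [Real.sqrt_mul (by positivity), hsq]
    _ ≤ (2 * M) ^ (ε / 2) * (Real.sqrt ((1 + X) ^ 2) + Real.sqrt (M / R)) := by
        gcongr; exact sqrt_add_le_sqrt_add_sqrt (by positivity) (by positivity)
    _ ≤ (2 * M) ^ (ε / 2) * (1 + X + Real.sqrt (M / (R / 2))) := by
        gcongr ?_ * ?_
        · have h3 : Real.sqrt ((1 + X) ^ 2) = 1 + X := Real.sqrt_sq (by linarith)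
          have h4 : Real.sqrt (M / R) ≤ Real.sqrt (M / (R / 2)) :=
            Real.sqrt_le_sqrt (div_le_div_of_nonneg_left hM0.le (by positivity) (by linarith))
          linarith

/-- `1 + √(N/R) N^ε ≤ (2N)^ε (1 + √(N/R))`. [folklore] -/
theorem one_add_sqrt_mul_rpow_le {N R ε : ℝ} (hN : 1 / 2 ≤ N) (hε : 0 ≤ ε) :
    1 + Real.sqrt (N / R) * N ^ ε ≤ (2 * N) ^ ε * (1 + Real.sqrt (N / R)) := by
  have hN0 : 0 < N := by linarith
  have h2 : N ^ ε ≤ (2 * N) ^ ε := Real.rpow_le_rpow hN0.le (by linarith) hε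
  have h3 : 1 ≤ (2 * N) ^ ε := Real.one_le_rpow (by linarith) hε
  have h4 : 0 ≤ Real.sqrt (N / R) := Real.sqrt_nonneg _
  nlinarith [mul_le_mul_of_nonneg_left h2 h4]

/-- `X + X⁻¹ ≥ 2`. [folklore] -/
private theorem two_le_add_inv {X : ℝ} (hX : 0 < X) : 2 ≤ X + X⁻¹ := by
  have hXi : X⁻¹ = 1 / X := inv_eq_one_div X
  rw [hXi, ← sub_nonneg]
  have : X + 1 / X - 2 = (X - 1) ^ 2 / X := by field_simp; ring
  rw [this]; positivity

/-- **Logarithmic clean-up**: `(1 + |log X|)(3 + log((1 + X)³)) ≤ 6 (1 + 2/ε)² (X + X⁻¹)^ε`. [folklore] -/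
theorem log_cleanup {X ε : ℝ} (hX : 0 < X) (hε : 0 < ε) :
    (1 + |Real.log X|) * (3 + Real.log ((1 + X) ^ 3)) ≤ 6 * (1 + 2 / ε) ^ 2 * (X + X⁻¹) ^ ε := by
  set y := X + X⁻¹ with hy
  have hy2 : 2 ≤ y := two_le_add_inv hX
  have hy0 : 0 < y := by linarith
  have hy1 : 1 ≤ y := by linarith
  set u := Real.log y with hu
  have hu0 : 0 ≤ u := Real.log_nonneg hy1
  -- `|log X| ≤ u`
  have hlogX : |Real.log X| ≤ u := by
    rw [abs_le]
    constructor
    · have : Real.log X⁻¹ ≤ u := Real.log_le_log (inv_pos.2 hX) (by rw [hy]; linarith)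
      rw [Real.log_inv] at this; linarith
    · exact Real.log_le_log hX (by rw [hy]; linarith [inv_pos.2 hX])
  -- `log((1 + X)³) ≤ 3 + 3u`
  have hlogB : Real.log ((1 + X) ^ 3) ≤ 3 + 3 * u := by
    have hX1 : 0 < 1 + X := by linarith
    have h1 : 1 + X ≤ 2 * y := by rw [hy]; linarith [inv_pos.2 hX]
    calc Real.log ((1 + X) ^ 3) = 3 * Real.log (1 + X) := by rw [Real.log_pow]; norm_num
      _ ≤ 3 * Real.log (2 * y) := by gcongr
      _ = 3 * (Real.log 2 + u) := by rw [Real.log_mul (by norm_num) hy0.ne']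
      _ ≤ 3 + 3 * u := by linarith [Real.log_two_lt_d9]
  -- `1 + u ≤ (1 + 2/ε) y^{ε/2}`
  have hup : u ≤ 2 / ε * y ^ (ε / 2) := by
    have := Real.log_le_rpow_div hy0.le (half_pos hε)
    rw [← hu] at this
    calc u ≤ y ^ (ε / 2) / (ε / 2) := this
      _ = 2 / ε * y ^ (ε / 2) := by field_simp
  have hyp1 : 1 ≤ y ^ (ε / 2) := Real.one_le_rpow hy1 (half_pos hε).le
  have h1u : 1 + u ≤ (1 + 2 / ε) * y ^ (ε / 2) := by nlinarith [div_pos two_pos hε]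
  have hsq : (y ^ (ε / 2)) ^ 2 = y ^ ε := by rw [← Real.rpow_natCast, ← Real.rpow_mul hy0.le]; norm_num
  have h3 : (1 + |Real.log X|) * (3 + Real.log ((1 + X) ^ 3)) ≤ 6 * (1 + u) ^ 2 := by
    have ha : 1 + |Real.log X| ≤ 1 + u := by linarith
    have hb : 3 + Real.log ((1 + X) ^ 3) ≤ 6 * (1 + u) := by linarith
    have hb0 : 0 ≤ 3 + Real.log ((1 + X) ^ 3) := by
      have := log_one_add_pow_three_nonneg hX.le
      linarith
    calc (1 + |Real.log X|) * (3 + Real.log ((1 + X) ^ 3))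
        ≤ (1 + u) * (6 * (1 + u)) := mul_le_mul ha hb hb0 (by linarith)
      _ = 6 * (1 + u) ^ 2 := by ring
  calc (1 + |Real.log X|) * (3 + Real.log ((1 + X) ^ 3)) ≤ 6 * (1 + u) ^ 2 := h3
    _ ≤ 6 * ((1 + 2 / ε) * y ^ (ε / 2)) ^ 2 := by gcongr
    _ = 6 * (1 + 2 / ε) ^ 2 * (X + X⁻¹) ^ ε := by rw [mul_pow, hsq]; ring

/-- **Power clean-up**: `(4RM)^{ε/2}(2N)^{ε/2} ≤ 8^ε (RMN)^ε` and `(4MN)^{ε/2} ≤ 8^ε (RMN)^ε` for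
`R, M, N ≥ 1/2`. [folklore] -/
theorem pow_cleanup {R M N ε : ℝ} (hR : 1 / 2 ≤ R) (hM : 1 / 2 ≤ M) (hN : 1 / 2 ≤ N) (hε : 0 < ε) :
    (4 * R * M) ^ (ε / 2) * (2 * N) ^ (ε / 2) ≤ 8 ^ ε * (R * M * N) ^ ε ∧
      (4 * M * N) ^ (ε / 2) ≤ 8 ^ ε * (R * M * N) ^ ε := by
  have hR0 : 0 < R := by linarith
  have hM0 : 0 < M := by linarith
  have hN0 : 0 < N := by linarith
  have h8 : 1 ≤ 8 * (R * M * N) := by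
    have h1 : 1 / 4 ≤ R * M := by nlinarith
    nlinarith
  have key : (8 * (R * M * N)) ^ (ε / 2) ≤ 8 ^ ε * (R * M * N) ^ ε := by
    calc (8 * (R * M * N)) ^ (ε / 2) ≤ (8 * (R * M * N)) ^ ε :=
          Real.rpow_le_rpow_of_exponent_le h8 (by linarith)
      _ = 8 ^ ε * (R * M * N) ^ ε := Real.mul_rpow (by norm_num) (by positivity)
  constructor
  · rw [← Real.mul_rpow (by positivity) (by positivity)]
    have : 4 * R * M * (2 * N) = 8 * (R * M * N) := by ring
    rw [this]; exact key
  · calc (4 * M * N) ^ (ε / 2) ≤ (8 * (R * M * N)) ^ (ε / 2) := by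
          apply Real.rpow_le_rpow (by positivity) _ (by linarith)
          nlinarith [mul_pos hM0 hN0]
      _ ≤ _ := key

/-! ### One level, simplified and uniform in `r ∼ R` -/

/-- `regFac` is monotone in `D`. [folklore] -/
theorem regFac_mono {X D₁ D₂ : ℝ} (hX : 0 ≤ X) (h : D₁ ≤ D₂) : regFac X D₁ ≤ regFac X D₂ := by
  unfold regFac
  have : 0 ≤ 3 + Real.log ((1 + X) ^ 3) := by
    have h0 := log_one_add_pow_three_nonneg hX
    linarith
  nlinarith

set_option maxHeartbeats 400000 in
/-- **The bound at one level `r ∼ R`, uniform in `r`.** [cite: DeshouillersIwaniec1982, §9.1 (9.3)–(9.8) pp. 279–280] -/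
theorem level_final (D : ℕ → SpecData) (W : KuzTransforms) {ε A K₁ K₂ K₃ K₄ K₅ K₆ K₇ : ℝ}
    (hA0 : 0 ≤ A) (hK₁ : 0 ≤ K₁) (hK₂ : 0 ≤ K₂) (hK₃ : 0 ≤ K₃) (hK₄ : 0 ≤ K₄)
    (hK₅ : 0 ≤ K₅) (hK₆ : 0 ≤ K₆) (hK₇ : 0 ≤ K₇)
    (hKp : KuzPlus D W) (hKm : KuzMinus D W)
    (hL1 : LSMaassInfAt D ε K₁) (hL2 : LSMaassZeroAt D ε K₂) (hL3 : LSEisInfAt D ε K₃)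
    (hL4 : LSEisZeroAt D ε K₄) (hL5 : LSHolInfAt D ε K₅) (hL6 : LSHolZeroAt D ε K₆) (hE5 : ExcFiveAt D ε K₇)
    {X : ℝ} (hX : 0 < X) {φ : ℝ → ℂ} (hadm : KuzAdmissible φ)
    (htpl : ∀ t, ‖W.Tpl φ t‖ ≤ A * LamT X * omegaT X t) (htmi : ∀ t, ‖W.Tmi φ t‖ ≤ A * LamT X * omegaT X t)
    (hthol : ∀ k : ℕ, ‖W.Thol φ k‖ ≤ A * LamT X * omegaT X k)
    (htx : ∀ y, 0 < y → y ≤ 1 / 4 →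
      ‖W.TplX φ y‖ ≤ A * LamT X * (1 + X ^ (-2 * y)) ∧ ‖W.TmiX φ y‖ ≤ A * LamT X * (1 + X ^ (-2 * y)))
    {M N R : ℝ} (hM : 1 / 2 ≤ M) (hN : 1 / 2 ≤ N) (hR : 1 / 2 ≤ R) {r : ℕ} (hr : r ∈ dyadic R)
    {s : ℤ} (hs : s = 1 ∨ s = -1)
    (Sm : Finset ℕ) (hSm : Sm ⊆ dyadic M) (α βv : ℕ → ℂ) (cM : ℕ)
    (hcM : ∀ m ∈ Sm, ∀ n ∈ dyadic N, ∀ c : ℕ, cM < c → φ (xK m n r c) = 0)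
    {Y₁ Y₂ : ℝ} (hY₁ : 1 ≤ Y₁) (hY₂ : 1 ≤ Y₂) (hXY : X⁻¹ ^ 2 ≤ Y₁ * Y₂)
    {UA'v : ℝ} (hUA' : ∀ F : Finset (D r).ιe,
      ∑ f ∈ F, Y₁ ^ (2 * (D r).y f) * ‖∑ m ∈ Sm, α m * conj ((D r).Pe f m)‖ ^ 2 ≤ UA'v)
    {lam lam' : ℝ} (hl : 0 < lam) (hl' : 0 < lam') :
    ‖∑ n ∈ dyadic N, ∑ m ∈ Sm, βv n * α m *
        ∑ c ∈ (Finset.Icc 1 cM).filter (fun c => r.Coprime c),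
          ((((c : ℝ) * Real.sqrt r)⁻¹ : ℝ) : ℂ) * φ (xK m n r c) * kl c r n (s * m)‖ ≤
      lam * (A * LamT X * (∑ m ∈ Sm, ‖α m‖ ^ 2) *
          ((K₁ + K₃ / (4 * π) + K₅) * regFac X (M ^ (1 + ε) / R) + K₁ * (1 + M ^ (1 + ε) / R))) / 2 +
      lam⁻¹ * (A * LamT X * l2sq N βv *
          ((K₂ + K₄ / (4 * π) + K₆) * regFac X (N ^ (1 + ε) / R) + K₂ * (1 + N ^ (1 + ε) / R))) / 2 +
      A * Real.sqrt 2 * LamT X * (lam' * UA'v +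
          lam'⁻¹ * (K₇ * (1 + Real.sqrt (N * Y₂ / R)) * (1 + Real.sqrt (N / R) * N ^ ε) * l2sq N βv)) / 2 := by
  have hR0 : 0 < R := by linarith
  have hM0 : 0 < M := by linarith
  have hN0 : 0 < N := by linarith
  obtain ⟨hrR, hr2⟩ := (mem_dyadic hR0.le).1 hr
  have hr1 : 1 ≤ r := Nat.one_le_iff_ne_zero.2 (pos_of_mem_dyadic hR0.le hr).ne'
  have hr0 : (0 : ℝ) < r := by exact_mod_cast hr1
  have h := level_mid D W hA0 hK₁ hK₂ hK₃ hK₄ hK₅ hK₆ hKp hKm hL1 hL2 hL3 hL4 hL5 hL6 hE5 hX hadm htpl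
    htmi hthol htx hM hN hr1 hs Sm hSm α βv cM hcM hY₁ hY₂ hXY hUA' hl hl'
  refine h.trans ?_
  -- the atoms and their monotone replacements
  have hΛ : 0 ≤ LamT X := LamT_nonneg hX.le
  have ha3 : M ^ (1 + ε) / r ≤ M ^ (1 + ε) / R := div_le_div_of_nonneg_left (by positivity) hR0 hrR.le
  have ha4 : N ^ (1 + ε) / r ≤ N ^ (1 + ε) / R := div_le_div_of_nonneg_left (by positivity) hR0 hrR.le
  have ha3' : 0 ≤ M ^ (1 + ε) / r := by positivity
  have ha4' : 0 ≤ N ^ (1 + ε) / r := by positivity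
  have ha1 : regFac X (M ^ (1 + ε) / r) ≤ regFac X (M ^ (1 + ε) / R) := regFac_mono hX.le ha3
  have ha2 : regFac X (N ^ (1 + ε) / r) ≤ regFac X (N ^ (1 + ε) / R) := regFac_mono hX.le ha4
  have ha1' : 0 ≤ regFac X (M ^ (1 + ε) / r) := regFac_nonneg hX.le ha3'
  have ha2' : 0 ≤ regFac X (N ^ (1 + ε) / r) := regFac_nonneg hX.le ha4'
  have ha5 : (1 + Real.sqrt (N * Y₂ / r)) * (1 + Real.sqrt (N / r) * N ^ ε) ≤
      (1 + Real.sqrt (N * Y₂ / R)) * (1 + Real.sqrt (N / R) * N ^ ε) := by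
    have h1 : Real.sqrt (N * Y₂ / r) ≤ Real.sqrt (N * Y₂ / R) :=
      Real.sqrt_le_sqrt (div_le_div_of_nonneg_left (by positivity) hR0 hrR.le)
    have h2 : Real.sqrt (N / r) * N ^ ε ≤ Real.sqrt (N / R) * N ^ ε :=
      mul_le_mul_of_nonneg_right (Real.sqrt_le_sqrt (div_le_div_of_nonneg_left hN0.le hR0 hrR.le))
        (by positivity)
    have h3 : 0 ≤ Real.sqrt (N / r) * N ^ ε := by positivity
    have h4 : 0 ≤ Real.sqrt (N * Y₂ / r) := Real.sqrt_nonneg _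
    exact mul_le_mul (by linarith) (by linarith) (by positivity) (by positivity)
  have ha5' : 0 ≤ (1 + Real.sqrt (N * Y₂ / r)) * (1 + Real.sqrt (N / r) * N ^ ε) := by positivity
  have hnA : 0 ≤ ∑ m ∈ Sm, ‖α m‖ ^ 2 := Finset.sum_nonneg fun m _ => by positivity
  have hnB : 0 ≤ l2sq N βv := Finset.sum_nonneg fun n _ => by positivity
  have hli : 0 ≤ lam⁻¹ := inv_nonneg.2 hl.le
  have hli' : 0 ≤ lam'⁻¹ := inv_nonneg.2 hl'.le
  set q := A * LamT X with hq
  set nA := ∑ m ∈ Sm, ‖α m‖ ^ 2 with hnAdef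
  set nB := l2sq N βv with hnBdef
  set a1 := regFac X (M ^ (1 + ε) / r)
  set b1 := regFac X (M ^ (1 + ε) / R)
  set a2 := regFac X (N ^ (1 + ε) / r)
  set b2 := regFac X (N ^ (1 + ε) / R)
  set a3 := M ^ (1 + ε) / r
  set b3 := M ^ (1 + ε) / R
  set a4 := N ^ (1 + ε) / r
  set b4 := N ^ (1 + ε) / R
  have hq0 : 0 ≤ q := by positivity
  have hb3 : 0 ≤ b3 := by positivity
  have hb4 : 0 ≤ b4 := by positivity
  have t0 : 0 ≤ (q * lam * K₁ * nA / 2) * (b1 - a1) := mul_nonneg (by positivity) (sub_nonneg.2 ha1)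
  have t1 : 0 ≤ (q * lam⁻¹ * K₂ * nB / 2) * (b2 - a2) := mul_nonneg (by positivity) (sub_nonneg.2 ha2)
  have t2 : 0 ≤ (1 / (4 * π) * q * lam * K₃ * nA / 2) * (b1 - a1) := mul_nonneg (by positivity) (sub_nonneg.2 ha1)
  have t3 : 0 ≤ (1 / (4 * π) * q * lam⁻¹ * K₄ * nB / 2) * (b2 - a2) := mul_nonneg (by positivity) (sub_nonneg.2 ha2)
  have t4 : 0 ≤ (q * lam * K₅ * nA / 2) * (b1 - a1) := mul_nonneg (by positivity) (sub_nonneg.2 ha1)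
  have t5 : 0 ≤ (q * lam⁻¹ * K₆ * nB / 2) * (b2 - a2) := mul_nonneg (by positivity) (sub_nonneg.2 ha2)
  have t6 : 0 ≤ (q * lam * K₁ * nA / 2) * (b3 - a3) := mul_nonneg (by positivity) (sub_nonneg.2 ha3)
  have t7 : 0 ≤ (q * lam⁻¹ * K₂ * nB / 2) * (b4 - a4) := mul_nonneg (by positivity) (sub_nonneg.2 ha4)
  have t10 : 0 ≤ (A * Real.sqrt 2 * LamT X * lam'⁻¹ * K₇ * nB / 2) * ((1 + Real.sqrt (N * Y₂ / R)) * (1 + Real.sqrt (N / R) * N ^ ε) - (1 + Real.sqrt (N * Y₂ / r)) * (1 + Real.sqrt (N / r) * N ^ ε)) := mul_nonneg (by positivity) (sub_nonneg.2 ha5)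
  have key : (lam * (q * nA * ((K₁ + K₃ / (4 * π) + K₅) * b1 + K₁ * (1 + b3))) / 2 +
      lam⁻¹ * (q * nB * ((K₂ + K₄ / (4 * π) + K₆) * b2 + K₂ * (1 + b4))) / 2 +
      A * Real.sqrt 2 * LamT X * (lam' * UA'v + lam'⁻¹ * (K₇ * (1 + Real.sqrt (N * Y₂ / R)) * (1 + Real.sqrt (N / R) * N ^ ε) * nB)) / 2) - (q * (lam * (K₁ * nA * a1) + lam⁻¹ * (K₂ * nB * a2)) / 2 +
      (q * (lam * (K₁ * nA * (1 + a3)) + lam⁻¹ * (K₂ * nB * (1 + a4))) / 2 +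
        A * Real.sqrt 2 * LamT X * (lam' * UA'v + lam'⁻¹ * (K₇ * (1 + Real.sqrt (N * Y₂ / r)) * (1 + Real.sqrt (N / r) * N ^ ε) * nB)) / 2) +
      1 / (4 * π) * q * (lam * (K₃ * nA * a1) + lam⁻¹ * (K₄ * nB * a2)) / 2 +
      q * (lam * (K₅ * nA * a1) + lam⁻¹ * (K₆ * nB * a2)) / 2) =
        (q * lam * K₁ * nA / 2) * (b1 - a1) +
        (q * lam⁻¹ * K₂ * nB / 2) * (b2 - a2) +
        (1 / (4 * π) * q * lam * K₃ * nA / 2) * (b1 - a1) +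
        (1 / (4 * π) * q * lam⁻¹ * K₄ * nB / 2) * (b2 - a2) +
        (q * lam * K₅ * nA / 2) * (b1 - a1) +
        (q * lam⁻¹ * K₆ * nB / 2) * (b2 - a2) +
        (q * lam * K₁ * nA / 2) * (b3 - a3) +
        (q * lam⁻¹ * K₂ * nB / 2) * (b4 - a4) +
        (A * Real.sqrt 2 * LamT X * lam'⁻¹ * K₇ * nB / 2) * ((1 + Real.sqrt (N * Y₂ / R)) * (1 + Real.sqrt (N / R) * N ^ ε) - (1 + Real.sqrt (N * Y₂ / r)) * (1 + Real.sqrt (N / r) * N ^ ε)) := by ring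
  rw [← sub_nonneg, key]
  positivity

/-! ### The two final conversions -/

/-- **Final conversion, regular part**: `√(c_R q n_A W_M) √(q W_N n_β) ≤ C₁ (X+X⁻¹)^ε (RMN)^ε L_reg √n_β`
with `q = A Λ(X)`, `c_R ≤ 4R`, `n_A ≤ 2M`, `W_M ≤ K_A (regFac + 1 + D_M)`, `W_N ≤ K_B (…)`.
[cite: DeshouillersIwaniec1982, §9.1 (9.4) p. 279] -/
theorem final_reg {X M N R ε A KA KB cR nA WM WN nβ : ℝ} (hX : 0 < X) (hM : 1 / 2 ≤ M) (hN : 1 / 2 ≤ N)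
    (hR : 1 / 2 ≤ R) (hε : 0 < ε) (hA0 : 0 ≤ A) (hKA : 0 ≤ KA) (hKB : 0 ≤ KB)
    (hcR0 : 0 ≤ cR) (hcR : cR ≤ 4 * R) (hnA0 : 0 ≤ nA) (hnA : nA ≤ 2 * M) (hWM0 : 0 ≤ WM) (hWN0 : 0 ≤ WN)
    (hWM : WM ≤ KA * (regFac X (M ^ (1 + ε) / R) + 1 + M ^ (1 + ε) / R))
    (hWN : WN ≤ KB * (regFac X (N ^ (1 + ε) / R) + 1 + N ^ (1 + ε) / R)) :
    Real.sqrt (cR * (A * LamT X) * nA * WM) * Real.sqrt ((A * LamT X) * WN * nβ) ≤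
      120 * A * Real.sqrt (KA * KB) * (1 + 2 / ε) ^ 2 * 8 ^ ε * ((X + X⁻¹) ^ ε * (R * M * N) ^ ε) *
        Lreg X M N R * Real.sqrt nβ := by
  have hM0 : 0 < M := by linarith
  have hN0 : 0 < N := by linarith
  have hR0 : 0 < R := by linarith
  have hΛ : 0 ≤ LamT X := LamT_nonneg hX.le
  set q := A * LamT X with hq
  have hq0 : 0 ≤ q := by positivity
  set ℓ := 3 + Real.log ((1 + X) ^ 3) with hl
  have hℓ0 : 0 ≤ ℓ := by
    have := log_one_add_pow_three_nonneg hX.le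
    rw [hl]; linarith
  -- `W_M ≤ 5 K_A ℓ ((1+X)² + D_M)` and the square roots
  have hDM : 0 ≤ M ^ (1 + ε) / R := by positivity
  have hDN : 0 ≤ N ^ (1 + ε) / R := by positivity
  have hWM' : WM ≤ 5 * KA * ℓ * ((1 + X) ^ 2 + M ^ (1 + ε) / R) := by
    have := mul_le_mul_of_nonneg_left (regFac_add_le hX.le hDM) hKA
    rw [hl]; linarith
  have hWN' : WN ≤ 5 * KB * ℓ * ((1 + X) ^ 2 + N ^ (1 + ε) / R) := by
    have := mul_le_mul_of_nonneg_left (regFac_add_le hX.le hDN) hKB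
    rw [hl]; linarith
  have hsM : Real.sqrt WM ≤ Real.sqrt (5 * KA * ℓ) * ((2 * M) ^ (ε / 2) * (1 + X + Real.sqrt (M / (R / 2)))) := by
    calc Real.sqrt WM ≤ Real.sqrt (5 * KA * ℓ * ((1 + X) ^ 2 + M ^ (1 + ε) / R)) := Real.sqrt_le_sqrt hWM'
      _ = Real.sqrt (5 * KA * ℓ) * Real.sqrt ((1 + X) ^ 2 + M ^ (1 + ε) / R) := Real.sqrt_mul (by positivity) _
      _ ≤ _ := mul_le_mul_of_nonneg_left (sqrt_bracket_le hX.le hM hR hε.le) (Real.sqrt_nonneg _)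
  have hsN : Real.sqrt WN ≤ Real.sqrt (5 * KB * ℓ) * ((2 * N) ^ (ε / 2) * (1 + X + Real.sqrt (N / (R / 2)))) := by
    calc Real.sqrt WN ≤ Real.sqrt (5 * KB * ℓ * ((1 + X) ^ 2 + N ^ (1 + ε) / R)) := Real.sqrt_le_sqrt hWN'
      _ = Real.sqrt (5 * KB * ℓ) * Real.sqrt ((1 + X) ^ 2 + N ^ (1 + ε) / R) := Real.sqrt_mul (by positivity) _
      _ ≤ _ := mul_le_mul_of_nonneg_left (sqrt_bracket_le hX.le hN hR hε.le) (Real.sqrt_nonneg _)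
  have hsRA : Real.sqrt (cR * nA) ≤ Real.sqrt 8 * Real.sqrt (R * M) := by
    rw [← Real.sqrt_mul (by norm_num)]
    exact Real.sqrt_le_sqrt (by nlinarith [mul_nonneg hcR0 hnA0])
  -- rewrite the left side as `q √(c_R n_A) √W_M √W_N √n_β`
  have hlhs : Real.sqrt (cR * q * nA * WM) * Real.sqrt (q * WN * nβ) =
      q * (Real.sqrt (cR * nA) * Real.sqrt WM * Real.sqrt WN * Real.sqrt nβ) := by
    have e : cR * q * nA * WM * (q * WN * nβ) = q ^ 2 * ((cR * nA) * (WM * (WN * nβ))) := by ring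
    have h1 : 0 ≤ cR * q * nA * WM := by positivity
    calc Real.sqrt (cR * q * nA * WM) * Real.sqrt (q * WN * nβ)
        = Real.sqrt (cR * q * nA * WM * (q * WN * nβ)) := (Real.sqrt_mul h1 _).symm
      _ = Real.sqrt (q ^ 2 * ((cR * nA) * (WM * (WN * nβ)))) := by rw [e]
      _ = Real.sqrt (q ^ 2) * Real.sqrt ((cR * nA) * (WM * (WN * nβ))) := Real.sqrt_mul (by positivity) _
      _ = q * (Real.sqrt (cR * nA) * (Real.sqrt WM * (Real.sqrt WN * Real.sqrt nβ))) := by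
          rw [Real.sqrt_sq hq0, Real.sqrt_mul (mul_nonneg hcR0 hnA0), Real.sqrt_mul hWM0, Real.sqrt_mul hWN0]
      _ = _ := by ring
  rw [hlhs]
  -- the product of the three square-root bounds
  have hprod : Real.sqrt (cR * nA) * Real.sqrt WM * Real.sqrt WN ≤
      (Real.sqrt 8 * Real.sqrt (R * M)) * (Real.sqrt (5 * KA * ℓ) * ((2 * M) ^ (ε / 2) * (1 + X + Real.sqrt (M / (R / 2))))) *
        (Real.sqrt (5 * KB * ℓ) * ((2 * N) ^ (ε / 2) * (1 + X + Real.sqrt (N / (R / 2))))) := by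
    apply mul_le_mul (mul_le_mul hsRA hsM (Real.sqrt_nonneg _) (by positivity)) hsN (Real.sqrt_nonneg _)
      (by positivity)
  -- collect: `√8 √(RM) √(5KAℓ) √(5KBℓ) = 5 ℓ √(8 KA KB) · √2 √(R/2) √M …`
  have hLreg : Real.sqrt (R * M) * (1 + X + Real.sqrt (M / (R / 2))) * (1 + X + Real.sqrt (N / (R / 2))) =
      Real.sqrt 2 * (1 + X) * Lreg X M N R := by
    unfold Lreg
    have e : Real.sqrt (R * M) = Real.sqrt 2 * Real.sqrt (R / 2) * Real.sqrt M := by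
      rw [← Real.sqrt_mul (by norm_num), ← Real.sqrt_mul (by positivity)]
      congr 1; ring
    rw [e]; field_simp
  have hKK : Real.sqrt (5 * KA * ℓ) * Real.sqrt (5 * KB * ℓ) = 5 * ℓ * Real.sqrt (KA * KB) := by
    rw [← Real.sqrt_mul (by positivity)]
    have : 5 * KA * ℓ * (5 * KB * ℓ) = (5 * ℓ) ^ 2 * (KA * KB) := by ring
    rw [this, Real.sqrt_mul (by positivity), Real.sqrt_sq (by positivity)]
  have hMN : (2 * M) ^ (ε / 2) * (2 * N) ^ (ε / 2) = (4 * M * N) ^ (ε / 2) := by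
    rw [← Real.mul_rpow (by positivity) (by positivity)]; congr 1; ring
  have h8 : Real.sqrt 8 * Real.sqrt 2 = 4 := by
    rw [← Real.sqrt_mul (by norm_num), show (8 : ℝ) * 2 = 4 ^ 2 by norm_num, Real.sqrt_sq (by norm_num)]
  -- the clean-ups
  obtain ⟨_, hpow⟩ := pow_cleanup hR hM hN hε
  have hlog := log_cleanup hX hε
  have hLr : 0 ≤ Lreg X M N R := Lreg_nonneg hX.le
  -- assemble
  have hq' : q = A * ((1 + |Real.log X|) / (1 + X)) := by rw [hq]; rfl
  have hX1 : 0 < 1 + X := by linarith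
  calc q * (Real.sqrt (cR * nA) * Real.sqrt WM * Real.sqrt WN * Real.sqrt nβ)
      ≤ q * ((Real.sqrt 8 * Real.sqrt (R * M)) * (Real.sqrt (5 * KA * ℓ) * ((2 * M) ^ (ε / 2) * (1 + X + Real.sqrt (M / (R / 2))))) *
        (Real.sqrt (5 * KB * ℓ) * ((2 * N) ^ (ε / 2) * (1 + X + Real.sqrt (N / (R / 2))))) * Real.sqrt nβ) := by
        apply mul_le_mul_of_nonneg_left _ hq0
        exact mul_le_mul_of_nonneg_right hprod (Real.sqrt_nonneg _)
    _ = A * ((1 + |Real.log X|) * ℓ) * (4 * M * N) ^ (ε / 2) * (5 * Real.sqrt (KA * KB)) * (Real.sqrt 8 * Real.sqrt 2) *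
          Lreg X M N R * Real.sqrt nβ := by
        rw [hq']
        have e1 : (Real.sqrt 8 * Real.sqrt (R * M)) * (Real.sqrt (5 * KA * ℓ) * ((2 * M) ^ (ε / 2) * (1 + X + Real.sqrt (M / (R / 2))))) *
            (Real.sqrt (5 * KB * ℓ) * ((2 * N) ^ (ε / 2) * (1 + X + Real.sqrt (N / (R / 2))))) =
            Real.sqrt 8 * (Real.sqrt (5 * KA * ℓ) * Real.sqrt (5 * KB * ℓ)) * ((2 * M) ^ (ε / 2) * (2 * N) ^ (ε / 2)) *
              (Real.sqrt (R * M) * (1 + X + Real.sqrt (M / (R / 2))) * (1 + X + Real.sqrt (N / (R / 2)))) := by ring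
        rw [e1, hKK, hMN, hLreg]
        field_simp
        try ring
    _ ≤ A * (6 * (1 + 2 / ε) ^ 2 * (X + X⁻¹) ^ ε) * (8 ^ ε * (R * M * N) ^ ε) * (5 * Real.sqrt (KA * KB)) * 4 *
          Lreg X M N R * Real.sqrt nβ := by
        rw [h8]
        have h0 : 0 ≤ (1 + |Real.log X|) * ℓ := by positivity
        gcongr
    _ = _ := by ring

/-- `1 + |log X| ≤ (1 + 2/ε) (X + X⁻¹)^ε` for `X, ε > 0`. [folklore] -/
theorem one_add_abs_log_le {X ε : ℝ} (hX : 0 < X) (hε : 0 < ε) :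
    1 + |Real.log X| ≤ (1 + 2 / ε) * (X + X⁻¹) ^ ε := by
  set y := X + X⁻¹ with hy
  have hy2 : 2 ≤ y := two_le_add_inv hX
  have hy0 : 0 < y := by linarith
  have hy1 : 1 ≤ y := by linarith
  set u := Real.log y with hu
  have hlogX : |Real.log X| ≤ u := by
    rw [abs_le]
    constructor
    · have : Real.log X⁻¹ ≤ u := Real.log_le_log (inv_pos.2 hX) (by rw [hy]; linarith)
      rw [Real.log_inv] at this; linarith
    · exact Real.log_le_log hX (by rw [hy]; linarith [inv_pos.2 hX])
  have hup : u ≤ 2 / ε * y ^ ε := by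
    have h1 := Real.log_le_rpow_div hy0.le (half_pos hε)
    rw [← hu] at h1
    have h2 : y ^ (ε / 2) ≤ y ^ ε := Real.rpow_le_rpow_of_exponent_le hy1 (by linarith)
    calc u ≤ y ^ (ε / 2) / (ε / 2) := h1
      _ = 2 / ε * y ^ (ε / 2) := by field_simp
      _ ≤ 2 / ε * y ^ ε := mul_le_mul_of_nonneg_left h2 (by positivity)
  have hyp1 : 1 ≤ y ^ ε := Real.one_le_rpow hy1 hε.le
  calc 1 + |Real.log X| ≤ 1 + u := by linarith
    _ ≤ y ^ ε + 2 / ε * y ^ ε := by linarith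
    _ = (1 + 2 / ε) * (X + X⁻¹) ^ ε := by rw [hy]; ring

/-- **Final conversion, exceptional part.** [cite: DeshouillersIwaniec1982, §9.1 (9.5)–(9.8) p. 280] -/
theorem final_exc {X M N R ε A K₇ K₈ nβ Y₁ Y₂ : ℝ} (hX : 0 < X) (hM : 1 / 2 ≤ M) (hN : 1 / 2 ≤ N)
    (hR : 1 / 2 ≤ R) (hε : 0 < ε) (hA0 : 0 ≤ A) (hK₇ : 0 ≤ K₇) (hK₈ : 0 ≤ K₈) (hnβ : 0 ≤ nβ)
    (hY₂ : Y₂ = max 1 (R / N)) (hY₁ : Y₁ = max 1 (X⁻¹ ^ 2 / Y₂)) :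
    A * Real.sqrt 2 * LamT X * (Real.sqrt (16 * K₈ * (4 * R * M) ^ ε * (R + M + Real.sqrt (M * Y₁)) * M) *
        Real.sqrt (K₇ * (1 + Real.sqrt (N * Y₂ / R)) * (1 + Real.sqrt (N / R) * N ^ ε) * nβ)) ≤
      12 * Real.sqrt 2 * A * (1 + 2 / ε) * Real.sqrt (K₈ * K₇) * 8 ^ ε * ((X + X⁻¹) ^ ε * (R * M * N) ^ ε) *
        (Lreg X M N R + Lexc X M N R) * Real.sqrt nβ := by
  have hM0 : 0 < M := by linarith
  have hN0 : 0 < N := by linarith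
  have hR0 : 0 < R := by linarith
  have hY₂1 : 1 ≤ Y₂ := by rw [hY₂]; exact le_max_left _ _
  have hY₁1 : 1 ≤ Y₁ := by rw [hY₁]; exact le_max_left _ _
  have hLr : 0 ≤ Lreg X M N R := Lreg_nonneg hX.le
  have hLe : 0 ≤ Lexc X M N R := Lexc_nonneg hX.le
  set E1 := Real.sqrt ((R + M + Real.sqrt (M * Y₁)) * M) with hE1
  set E2 := Real.sqrt ((1 + Real.sqrt (N * Y₂ / R)) * (1 + Real.sqrt (N / R))) with hE2
  have halg : E1 * E2 ≤ 3 * (1 + X) * (Lreg X M N R + Lexc X M N R) := exc_algebra hX hM hN hR hY₂ hY₁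
  -- the two square roots
  have hs1 : Real.sqrt (16 * K₈ * (4 * R * M) ^ ε * (R + M + Real.sqrt (M * Y₁)) * M) =
      4 * Real.sqrt K₈ * (4 * R * M) ^ (ε / 2) * E1 := by
    have e : 16 * K₈ * (4 * R * M) ^ ε * (R + M + Real.sqrt (M * Y₁)) * M =
        (4 ^ 2 * (K₈ * (4 * R * M) ^ ε)) * ((R + M + Real.sqrt (M * Y₁)) * M) := by ring
    rw [e, Real.sqrt_mul (by positivity), Real.sqrt_mul (by positivity), Real.sqrt_sq (by norm_num),
      Real.sqrt_mul hK₈, Real.sqrt_eq_rpow ((4 * R * M) ^ ε), ← Real.rpow_mul (by positivity)]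
    rw [hE1]; ring_nf
  have hs2 : Real.sqrt (K₇ * (1 + Real.sqrt (N * Y₂ / R)) * (1 + Real.sqrt (N / R) * N ^ ε) * nβ) ≤
      Real.sqrt K₇ * (2 * N) ^ (ε / 2) * E2 * Real.sqrt nβ := by
    have h1 : K₇ * (1 + Real.sqrt (N * Y₂ / R)) * (1 + Real.sqrt (N / R) * N ^ ε) * nβ ≤
        K₇ * ((2 * N) ^ ε * ((1 + Real.sqrt (N * Y₂ / R)) * (1 + Real.sqrt (N / R)))) * nβ := by
      have h := one_add_sqrt_mul_rpow_le (R := R) hN hε.le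
      have h0 : 0 ≤ 1 + Real.sqrt (N * Y₂ / R) := by positivity
      have := mul_le_mul_of_nonneg_left h h0
      have : (1 + Real.sqrt (N * Y₂ / R)) * (1 + Real.sqrt (N / R) * N ^ ε) ≤
          (2 * N) ^ ε * ((1 + Real.sqrt (N * Y₂ / R)) * (1 + Real.sqrt (N / R))) := by linarith
      have := mul_le_mul_of_nonneg_left this hK₇
      have := mul_le_mul_of_nonneg_right this hnβ
      linarith
    calc Real.sqrt (K₇ * (1 + Real.sqrt (N * Y₂ / R)) * (1 + Real.sqrt (N / R) * N ^ ε) * nβ)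
        ≤ Real.sqrt (K₇ * ((2 * N) ^ ε * ((1 + Real.sqrt (N * Y₂ / R)) * (1 + Real.sqrt (N / R)))) * nβ) :=
          Real.sqrt_le_sqrt h1
      _ = Real.sqrt K₇ * (2 * N) ^ (ε / 2) * E2 * Real.sqrt nβ := by
          rw [Real.sqrt_mul (by positivity), Real.sqrt_mul hK₇, Real.sqrt_mul (by positivity),
            Real.sqrt_eq_rpow ((2 * N) ^ ε), ← Real.rpow_mul (by positivity), hE2]
          ring_nf
  obtain ⟨hpow, _⟩ := pow_cleanup hR hM hN hε
  have hXX : 1 + |Real.log X| ≤ (1 + 2 / ε) * (X + X⁻¹) ^ ε := one_add_abs_log_le hX hε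
  have hE10 : 0 ≤ E1 := Real.sqrt_nonneg _
  have hE20 : 0 ≤ E2 := Real.sqrt_nonneg _
  have hX1 : 0 < 1 + X := by linarith
  have hΛ : LamT X = (1 + |Real.log X|) / (1 + X) := rfl
  have hΛ0 : 0 ≤ LamT X := LamT_nonneg hX.le
  have hlog0 : 0 ≤ 1 + |Real.log X| := by positivity
  calc A * Real.sqrt 2 * LamT X * (Real.sqrt (16 * K₈ * (4 * R * M) ^ ε * (R + M + Real.sqrt (M * Y₁)) * M) *
        Real.sqrt (K₇ * (1 + Real.sqrt (N * Y₂ / R)) * (1 + Real.sqrt (N / R) * N ^ ε) * nβ))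
      ≤ A * Real.sqrt 2 * LamT X * ((4 * Real.sqrt K₈ * (4 * R * M) ^ (ε / 2) * E1) *
          (Real.sqrt K₇ * (2 * N) ^ (ε / 2) * E2 * Real.sqrt nβ)) := by
        rw [hs1]
        apply mul_le_mul_of_nonneg_left _ (by positivity)
        exact mul_le_mul_of_nonneg_left hs2 (by positivity)
    _ = A * Real.sqrt 2 * (4 * (Real.sqrt K₈ * Real.sqrt K₇)) * ((4 * R * M) ^ (ε / 2) * (2 * N) ^ (ε / 2)) *
          ((1 + |Real.log X|) * ((E1 * E2) / (1 + X))) * Real.sqrt nβ := by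
        rw [hΛ]
        field_simp
        try ring
    _ ≤ A * Real.sqrt 2 * (4 * (Real.sqrt K₈ * Real.sqrt K₇)) * (8 ^ ε * (R * M * N) ^ ε) *
          (((1 + 2 / ε) * (X + X⁻¹) ^ ε) * (3 * (Lreg X M N R + Lexc X M N R))) * Real.sqrt nβ := by
        have hq : (E1 * E2) / (1 + X) ≤ 3 * (Lreg X M N R + Lexc X M N R) := by
          rw [div_le_iff₀ hX1]; linarith
        have hq0 : 0 ≤ (E1 * E2) / (1 + X) := by positivity
        gcongr
    _ = 12 * Real.sqrt 2 * A * (1 + 2 / ε) * Real.sqrt (K₈ * K₇) * 8 ^ ε * ((X + X⁻¹) ^ ε * (R * M * N) ^ ε) *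
          (Lreg X M N R + Lexc X M N R) * Real.sqrt nβ := by
        rw [Real.sqrt_mul hK₈]; ring




/-! ### The main theorem: `H91At` from the Kuznetsov package -/

/-- `#(r ∼ R) ≤ 4R` for `R ≥ 1/2`. [folklore] -/
theorem card_dyadic_le_four_mul' {R : ℝ} (hR : 1 / 2 ≤ R) : ((dyadic R).card : ℝ) ≤ 4 * R := by
  have h := card_dyadic_le (show (0 : ℝ) ≤ R by linarith)
  linarith

/-- `(K₁ + K₃/(4π) + K₅) RF + K₁ (1 + D) ≤ (2K₁ + K₃/(4π) + K₅)(RF + 1 + D)`. [folklore] -/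
theorem W_le {K₁ K₃ K₅ RF Dv : ℝ} (hK₁ : 0 ≤ K₁) (hK₃ : 0 ≤ K₃) (hK₅ : 0 ≤ K₅) (hRF : 0 ≤ RF) (hD : 0 ≤ Dv) :
    (K₁ + K₃ / (4 * π) + K₅) * RF + K₁ * (1 + Dv) ≤ (2 * K₁ + K₃ / (4 * π) + K₅) * (RF + 1 + Dv) := by
  have hc : 0 ≤ K₃ / (4 * π) + K₅ := by positivity
  have e : (2 * K₁ + K₃ / (4 * π) + K₅) * (RF + 1 + Dv) - ((K₁ + K₃ / (4 * π) + K₅) * RF + K₁ * (1 + Dv)) =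
      K₁ * RF + (K₁ + (K₃ / (4 * π) + K₅)) * (1 + Dv) := by ring
  rw [← sub_nonneg, e]
  positivity

set_option maxHeartbeats 1600000 in
/-- **Deshouillers–Iwaniec §9.1 at `s = 1`: the Kuznetsov-shaped bound `H91At ε` (for every `ε > 0`)
from Kuznetsov's formula, the transform bounds, the large-sieve inequalities and the exceptional-spectrum
theorems, all taken as explicit hypotheses on abstract spectral data.**
Proof: (9.2) insert Kuznetsov's formula level by level (`bilinear_core`); (9.3)–(9.4) bound the regular
spectrum termwise by `A Λ(X) ω_X(t)` and the one-sided weighted sums by the large sieve through dyadic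
shells in `t` (`shell_disc`, `shell_eis`); (9.5)–(9.8) bound the exceptional spectrum with the weights
`X^{-2|t_f|} ≤ Y₁^{|t_f|} Y₂^{|t_f|}`, `Y₂ = max(1, R/N)`, `Y₁ = max(1, X⁻²/Y₂)`, by Theorem 7 on the
`m`-side (twisted interval, averaged over `r`) and Theorem 5 on the `n`-side; optimise the two AM–GM
parameters and convert to `L_reg + L_exc` (`final_reg`, `final_exc`).
[cite: DeshouillersIwaniec1982, §9.1 (9.2)–(9.8) pp. 278–280; Drappeau2017, Prop. 4.12] -/
theorem H91At_of_kuznetsov (D : ℕ → SpecData) (W : KuzTransforms) (hKp : KuzPlus D W) (hKm : KuzMinus D W)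
    (hW : TransformBound W) (hL1 : LSMaassInf D) (hL2 : LSMaassZero D) (hL3 : LSEisInf D)
    (hL4 : LSEisZero D) (hL5 : LSHolInf D) (hL6 : LSHolZero D) (hE5 : ExcFive D) (hE7 : ExcSeven D) :
    ∀ ε : ℝ, 0 < ε → H91At ε := by
  intro ε hε
  obtain ⟨A, hA0, hWA⟩ := hW
  obtain ⟨K₁, hK₁, hL1'⟩ := hL1 ε hε
  obtain ⟨K₂, hK₂, hL2'⟩ := hL2 ε hε
  obtain ⟨K₃, hK₃, hL3'⟩ := hL3 ε hε
  obtain ⟨K₄, hK₄, hL4'⟩ := hL4 ε hε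
  obtain ⟨K₅, hK₅, hL5'⟩ := hL5 ε hε
  obtain ⟨K₆, hK₆, hL6'⟩ := hL6 ε hε
  obtain ⟨K₇, hK₇, hE5'⟩ := hE5 ε hε
  obtain ⟨K₈, hK₈, hE7'⟩ := hE7 ε hε
  -- the constant
  set KA : ℝ := 2 * K₁ + K₃ / (4 * π) + K₅ with hKA
  set KB : ℝ := 2 * K₂ + K₄ / (4 * π) + K₆ with hKB
  have hKA0 : 0 ≤ KA := by positivity
  have hKB0 : 0 ≤ KB := by positivity
  set C₁ : ℝ := 120 * A * Real.sqrt (KA * KB) * (1 + 2 / ε) ^ 2 * 8 ^ ε with hC₁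
  set C₂ : ℝ := 12 * Real.sqrt 2 * A * (1 + 2 / ε) * Real.sqrt (K₈ * K₇) * 8 ^ ε with hC₂
  have hC₁0 : 0 ≤ C₁ := by positivity
  have hC₂0 : 0 ≤ C₂ := by positivity
  refine ⟨C₁ + C₂, ?_⟩
  intro X hX φ hφ1 hφ2 hφ3 M N R hM hN hR θ β a u haM huM sgn hsgn cM hcM
  have hM0 : 0 < M := by linarith
  have hN0 : 0 < N := by linarith
  have hR0 : 0 < R := by linarith
  have hLr : 0 ≤ Lreg X M N R := Lreg_nonneg hX.le
  have hLe : 0 ≤ Lexc X M N R := Lexc_nonneg hX.le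
  have hRHS0 : 0 ≤ (C₁ + C₂) * ((X + X⁻¹) * R * M * N) ^ ε * (Lreg X M N R + Lexc X M N R) *
      Real.sqrt (∑ r ∈ dyadic R, ∑ n ∈ dyadic N, ‖β n r‖ ^ 2) := by
    have : 0 ≤ (X + X⁻¹) * R * M * N := by positivity
    positivity
  rcases le_or_gt u a with hua | hau
  · -- empty `m`-range
    have h0 : kuzSum φ θ R N a u sgn cM β = 0 := by
      rw [kuzSum_eq_sum_inner]
      refine Finset.sum_eq_zero fun r _ => Finset.sum_eq_zero fun n _ => ?_
      rw [Finset.Ioc_eq_empty (not_lt.2 hua), Finset.sum_empty]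
    rw [h0, norm_zero]; exact hRHS0
  -- the main case `a < u`
  have hadm := kuzAdmissible_of_support hX hφ1 hφ2
  obtain ⟨htpl, htmi, hthol, htx⟩ := hWA X hX φ hφ1 hφ2 hφ3
  -- the exceptional weights
  set Y₂ : ℝ := max 1 (R / N) with hY₂
  set Y₁ : ℝ := max 1 (X⁻¹ ^ 2 / Y₂) with hY₁
  have hY₂1 : 1 ≤ Y₂ := le_max_left _ _
  have hY₁1 : 1 ≤ Y₁ := le_max_left _ _
  have hY₂0 : 0 < Y₂ := by linarith
  have hXY : X⁻¹ ^ 2 ≤ Y₁ * Y₂ := by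
    have : X⁻¹ ^ 2 / Y₂ ≤ Y₁ := le_max_right _ _
    rwa [div_le_iff₀ hY₂0] at this
  -- the `m`-range
  set Sm := Finset.Ioc a u with hSmdef
  have hSm : Sm ⊆ dyadic M := by
    intro m hm
    rw [hSmdef, Finset.mem_Ioc] at hm
    rw [mem_dyadic hM0.le]
    constructor
    · have : (a : ℝ) + 1 ≤ m := by exact_mod_cast hm.1
      linarith
    · exact le_trans (by exact_mod_cast hm.2) huM
  set α : ℕ → ℂ := fun m => ((𝐞 (θ * m) : Circle) : ℂ) with hαdef
  have hαn : ∀ m, ‖α m‖ = 1 := fun m => Circle.norm_coe _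
  have hnA : (∑ m ∈ Sm, ‖α m‖ ^ 2) ≤ 2 * M := by
    simp only [hαn, one_pow, Finset.sum_const, nsmul_eq_mul, mul_one]
    rw [hSmdef, Nat.card_Ioc, Nat.cast_sub hau.le]
    have : (a : ℝ) ≥ 0 := Nat.cast_nonneg _
    linarith
  have hnA0 : 0 ≤ ∑ m ∈ Sm, ‖α m‖ ^ 2 := Finset.sum_nonneg fun m _ => by positivity
  -- vanishing beyond the cutoff
  have hvan : ∀ r ∈ dyadic R, ∀ m ∈ Sm, ∀ n ∈ dyadic N, ∀ c : ℕ, cM < c → φ (xK m n r c) = 0 := by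
    intro r hr m hm n hn c hc
    have hm' := (mem_dyadic hM0.le).1 (hSm hm)
    exact phi_xK_eq_zero hX hM0 hN0 hR0 hφ2 (pos_of_mem_dyadic hM0.le (hSm hm)) hm'.2 hn hr hcM hc
  -- the exceptional `A`-side: partial sums and their suprema
  set EA : ℝ := 16 * K₈ * (4 * R * M) ^ ε * (R + M + Real.sqrt (M * Y₁)) * M with hEA
  set sA : (r : ℕ) → Finset (D r).ιe → ℝ := fun r F =>
    ∑ f ∈ F, Y₁ ^ (2 * (D r).y f) * ‖∑ m ∈ Sm, α m * conj ((D r).Pe f m)‖ ^ 2 with hsA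
  have hsAall : ∀ Fsel : (r : ℕ) → Finset (D r).ιe, ∑ r ∈ dyadic R, sA r (Fsel r) ≤ EA := fun Fsel =>
    exc_A_bound D hε.le hK₈ hE7' hR hM θ hau huM hY₁1 Fsel
  have hsA1 : ∀ r ∈ dyadic R, ∀ F : Finset (D r).ιe, sA r F ≤ EA := by
    classical
    intro r hr F
    have h := hsAall (Function.update (fun q => (∅ : Finset (D q).ιe)) r F)
    rw [Finset.sum_eq_single_of_mem r hr] at h
    · simpa only [Function.update_self] using h
    · intro q _ hq
      rw [Function.update_of_ne hq]
      simp [hsA]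
  set UA : ℕ → ℝ := fun r => ⨆ F : Finset (D r).ιe, sA r F with hUA
  have hUA' : ∀ r ∈ dyadic R, ∀ F : Finset (D r).ιe, sA r F ≤ UA r := fun r hr F =>
    le_ciSup_finset (sA r) (hsA1 r hr) F
  have hUAsum : ∑ r ∈ dyadic R, UA r ≤ EA := sum_ciSup_le_of_forall sA (dyadic R) hsAall
  -- abbreviations
  set q : ℝ := A * LamT X with hq
  have hq0 : 0 ≤ q := by have := LamT_nonneg hX.le; positivity
  set WM : ℝ := (K₁ + K₃ / (4 * π) + K₅) * regFac X (M ^ (1 + ε) / R) + K₁ * (1 + M ^ (1 + ε) / R) with hWM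
  set WN : ℝ := (K₂ + K₄ / (4 * π) + K₆) * regFac X (N ^ (1 + ε) / R) + K₂ * (1 + N ^ (1 + ε) / R) with hWN
  set cB : ℝ := K₇ * (1 + Real.sqrt (N * Y₂ / R)) * (1 + Real.sqrt (N / R) * N ^ ε) with hcB
  set nA : ℝ := ∑ m ∈ Sm, ‖α m‖ ^ 2 with hnAdef
  set nβ : ℝ := ∑ r ∈ dyadic R, ∑ n ∈ dyadic N, ‖β n r‖ ^ 2 with hnβ
  have hDM : 0 ≤ M ^ (1 + ε) / R := by positivity
  have hDN : 0 ≤ N ^ (1 + ε) / R := by positivity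
  have hWM0 : 0 ≤ WM := by have := regFac_nonneg hX.le hDM; positivity
  have hWN0 : 0 ≤ WN := by have := regFac_nonneg hX.le hDN; positivity
  have hcB0 : 0 ≤ cB := by positivity
  have hnβ0 : 0 ≤ nβ := Finset.sum_nonneg fun r _ => Finset.sum_nonneg fun n _ => by positivity
  have hl2 : ∀ r, l2sq N (fun n => β n r) = ∑ n ∈ dyadic N, ‖β n r‖ ^ 2 := fun r => rfl
  set cX : ℝ := A * Real.sqrt 2 * LamT X with hcX
  have hcX0 : 0 ≤ cX := by have := LamT_nonneg hX.le; positivity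
  -- the per-level bounds
  have hlev : ∀ lam lam' : ℝ, 0 < lam → 0 < lam' → ∀ r ∈ dyadic R,
      ‖∑ n ∈ dyadic N, ∑ m ∈ Sm, β n r * α m *
          ∑ c ∈ (Finset.Icc 1 cM).filter (fun c => r.Coprime c),
            ((((c : ℝ) * Real.sqrt r)⁻¹ : ℝ) : ℂ) * φ (xK m n r c) * kl c r n (sgn * m)‖ ≤
        lam * (q * nA * WM) / 2 + lam⁻¹ * (q * l2sq N (fun n => β n r) * WN) / 2 +
          cX * (lam' * UA r + lam'⁻¹ * (cB * l2sq N (fun n => β n r))) / 2 := by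
    intro lam lam' hl hl' r hr
    exact level_final D W hA0 hK₁ hK₂ hK₃ hK₄ hK₅ hK₆ hK₇ hKp hKm hL1' hL2' hL3' hL4' hL5' hL6' hE5' hX hadm
      htpl htmi hthol htx hM hN hR hr hsgn Sm hSm α (fun n => β n r) cM (hvan r hr) hY₁1 hY₂1 hXY (hUA' r hr) hl hl'
  -- sum over the levels
  have hsum : ∀ lam lam' : ℝ, 0 < lam → 0 < lam' →
      ‖kuzSum φ θ R N a u sgn cM β‖ ≤
        (lam * ((dyadic R).card * q * nA * WM) + lam⁻¹ * (q * WN * nβ)) / 2 +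
          (lam' * (cX * EA) + lam'⁻¹ * (cX * (cB * nβ))) / 2 := by
    intro lam lam' hl hl'
    rw [kuzSum_eq_sum_inner]
    refine (norm_sum_le _ _).trans ?_
    refine (Finset.sum_le_sum fun r hr => hlev lam lam' hl hl' r hr).trans ?_
    have e : ∀ r : ℕ, lam * (q * nA * WM) / 2 + lam⁻¹ * (q * l2sq N (fun n => β n r) * WN) / 2 +
        cX * (lam' * UA r + lam'⁻¹ * (cB * l2sq N (fun n => β n r))) / 2 =
        lam * (q * nA * WM) / 2 + (lam⁻¹ * (q * WN) / 2 + cX * lam'⁻¹ * cB / 2) * (∑ n ∈ dyadic N, ‖β n r‖ ^ 2) +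
          (cX * lam' / 2) * UA r := by
      intro r; rw [hl2]; ring
    rw [Finset.sum_congr rfl fun r _ => e r, Finset.sum_add_distrib, Finset.sum_add_distrib, Finset.sum_const,
      nsmul_eq_mul, ← Finset.mul_sum, ← Finset.mul_sum]
    have h1 : cX * lam' / 2 * ∑ r ∈ dyadic R, UA r ≤ cX * lam' / 2 * EA :=
      mul_le_mul_of_nonneg_left hUAsum (by positivity)
    have h2 : (dyadic R).card * (lam * (q * nA * WM) / 2) +
        (lam⁻¹ * (q * WN) / 2 + cX * lam'⁻¹ * cB / 2) * nβ + cX * lam' / 2 * EA =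
        (lam * ((dyadic R).card * q * nA * WM) + lam⁻¹ * (q * WN * nβ)) / 2 +
          (lam' * (cX * EA) + lam'⁻¹ * (cX * (cB * nβ))) / 2 := by ring
    linarith only [h1, h2]
  -- optimise the two parameters
  have hU1 : 0 ≤ (dyadic R).card * q * nA * WM := by positivity
  have hU2 : 0 ≤ q * WN * nβ := by positivity
  have hEA0 : 0 ≤ EA := by positivity
  have hU3 : 0 ≤ cX * EA := by positivity
  have hU4 : 0 ≤ cX * (cB * nβ) := by positivity
  have hopt1 : ∀ lam' : ℝ, 0 < lam' →
      ‖kuzSum φ θ R N a u sgn cM β‖ - (lam' * (cX * EA) + lam'⁻¹ * (cX * (cB * nβ))) / 2 ≤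
        Real.sqrt ((dyadic R).card * q * nA * WM) * Real.sqrt (q * WN * nβ) := by
    intro lam' hl'
    refine le_sqrt_mul_sqrt_of_forall_param hU1 hU2 fun lam hl => ?_
    linarith only [hsum lam lam' hl hl']
  have hopt2 : ‖kuzSum φ θ R N a u sgn cM β‖ -
      Real.sqrt ((dyadic R).card * q * nA * WM) * Real.sqrt (q * WN * nβ) ≤
        Real.sqrt (cX * EA) * Real.sqrt (cX * (cB * nβ)) := by
    refine le_sqrt_mul_sqrt_of_forall_param hU3 hU4 fun lam' hl' => ?_
    linarith only [hopt1 lam' hl']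
  have hsq : Real.sqrt (cX * EA) * Real.sqrt (cX * (cB * nβ)) = cX * (Real.sqrt EA * Real.sqrt (cB * nβ)) := by
    rw [Real.sqrt_mul hcX0, Real.sqrt_mul hcX0]
    have : Real.sqrt cX * Real.sqrt cX = cX := Real.mul_self_sqrt hcX0
    calc Real.sqrt cX * Real.sqrt EA * (Real.sqrt cX * Real.sqrt (cB * nβ))
        = (Real.sqrt cX * Real.sqrt cX) * (Real.sqrt EA * Real.sqrt (cB * nβ)) := by ring
      _ = _ := by rw [this]
  -- the two final conversions
  have hreg : Real.sqrt ((dyadic R).card * q * nA * WM) * Real.sqrt (q * WN * nβ) ≤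
      C₁ * ((X + X⁻¹) ^ ε * (R * M * N) ^ ε) * Lreg X M N R * Real.sqrt nβ := by
    have hWMle : WM ≤ KA * (regFac X (M ^ (1 + ε) / R) + 1 + M ^ (1 + ε) / R) := by
      rw [hWM, hKA]; exact W_le hK₁ hK₃ hK₅ (regFac_nonneg hX.le hDM) hDM
    have hWNle : WN ≤ KB * (regFac X (N ^ (1 + ε) / R) + 1 + N ^ (1 + ε) / R) := by
      rw [hWN, hKB]; exact W_le hK₂ hK₄ hK₆ (regFac_nonneg hX.le hDN) hDN
    have h := final_reg hX hM hN hR hε hA0 hKA0 hKB0 (Nat.cast_nonneg _) (card_dyadic_le_four_mul' hR) hnA0 hnA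
      hWM0 hWN0 hWMle hWNle (A := A) (cR := ((dyadic R).card : ℝ)) (nA := nA) (nβ := nβ)
    rw [hC₁]
    exact h
  have hexc : cX * (Real.sqrt EA * Real.sqrt (cB * nβ)) ≤
      C₂ * ((X + X⁻¹) ^ ε * (R * M * N) ^ ε) * (Lreg X M N R + Lexc X M N R) * Real.sqrt nβ := by
    have h := final_exc hX hM hN hR hε hA0 hK₇ hK₈ hnβ0 hY₂ hY₁ (A := A)
    rw [hC₂, hcX, hEA, hcB]
    have e : K₇ * (1 + Real.sqrt (N * Y₂ / R)) * (1 + Real.sqrt (N / R) * N ^ ε) * nβ =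
        K₇ * (1 + Real.sqrt (N * Y₂ / R)) * (1 + Real.sqrt (N / R) * N ^ ε) * nβ := rfl
    simpa only [mul_assoc] using h
  -- conclusion
  have hXpow : ((X + X⁻¹) * R * M * N) ^ ε = (X + X⁻¹) ^ ε * (R * M * N) ^ ε := by
    rw [show (X + X⁻¹) * R * M * N = (X + X⁻¹) * (R * M * N) by ring]
    exact Real.mul_rpow (by positivity) (by positivity)
  have hfin : ‖kuzSum φ θ R N a u sgn cM β‖ ≤
      C₁ * ((X + X⁻¹) ^ ε * (R * M * N) ^ ε) * Lreg X M N R * Real.sqrt nβ +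
        C₂ * ((X + X⁻¹) ^ ε * (R * M * N) ^ ε) * (Lreg X M N R + Lexc X M N R) * Real.sqrt nβ := by
    rw [hsq] at hopt2
    linarith only [hopt2, hreg, hexc]
  calc ‖kuzSum φ θ R N a u sgn cM β‖
      ≤ C₁ * ((X + X⁻¹) ^ ε * (R * M * N) ^ ε) * Lreg X M N R * Real.sqrt nβ +
        C₂ * ((X + X⁻¹) ^ ε * (R * M * N) ^ ε) * (Lreg X M N R + Lexc X M N R) * Real.sqrt nβ := hfin
    _ ≤ C₁ * ((X + X⁻¹) ^ ε * (R * M * N) ^ ε) * (Lreg X M N R + Lexc X M N R) * Real.sqrt nβ +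
        C₂ * ((X + X⁻¹) ^ ε * (R * M * N) ^ ε) * (Lreg X M N R + Lexc X M N R) * Real.sqrt nβ := by
        have h0 : 0 ≤ C₁ * ((X + X⁻¹) ^ ε * (R * M * N) ^ ε) := by positivity
        have h1 : Lreg X M N R ≤ Lreg X M N R + Lexc X M N R := by linarith
        have h2 := mul_le_mul_of_nonneg_left h1 h0
        have h3 := mul_le_mul_of_nonneg_right h2 (Real.sqrt_nonneg nβ)
        linarith only [h3]
    _ = (C₁ + C₂) * ((X + X⁻¹) * R * M * N) ^ ε * (Lreg X M N R + Lexc X M N R) * Real.sqrt nβ := by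
        rw [hXpow]; ring

end L1

end BFI

open BFI

section Consequences

/-- **BFI 1986, Theorem 5 (§12, p. 237) from the Kuznetsov package** (Kuznetsov's formula for `Γ₀(r)`
at the cusps `∞, 0`, the transform bounds, the large sieve and the exceptional-spectrum theorems of
Deshouillers–Iwaniec, as explicit hypotheses on abstract spectral data).
[cite: BombieriFriedlanderIwaniecActa1986, §12 Theorem 5 p. 237; DeshouillersIwaniec1982, §9.1 pp. 278–280] -/
theorem BombieriFriedlanderIwaniecTheorem5_of_kuznetsov (D : ℕ → BFI.L1.SpecData) (W : BFI.L1.KuzTransforms)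
    (hKp : BFI.L1.KuzPlus D W) (hKm : BFI.L1.KuzMinus D W) (hW : BFI.L1.TransformBound W)
    (hL1 : BFI.L1.LSMaassInf D) (hL2 : BFI.L1.LSMaassZero D) (hL3 : BFI.L1.LSEisInf D)
    (hL4 : BFI.L1.LSEisZero D) (hL5 : BFI.L1.LSHolInf D) (hL6 : BFI.L1.LSHolZero D)
    (hE5 : BFI.L1.ExcFive D) (hE7 : BFI.L1.ExcSeven D) : BombieriFriedlanderIwaniecTheorem5 :=
  BombieriFriedlanderIwaniecTheorem5_of_H91
    (BFI.L1.H91At_of_kuznetsov D W hKp hKm hW hL1 hL2 hL3 hL4 hL5 hL6 hE5 hE7)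

/-- **BFI 1986, Theorem 1 (§8, p. 225) from the Kuznetsov package.**
[cite: BombieriFriedlanderIwaniecActa1986, §8 Theorem 1 p. 225; DeshouillersIwaniec1982, §9.1 pp. 278–280] -/
theorem BombieriFriedlanderIwaniecTheorem1_of_kuznetsov (D : ℕ → BFI.L1.SpecData) (W : BFI.L1.KuzTransforms)
    (hKp : BFI.L1.KuzPlus D W) (hKm : BFI.L1.KuzMinus D W) (hW : BFI.L1.TransformBound W)
    (hL1 : BFI.L1.LSMaassInf D) (hL2 : BFI.L1.LSMaassZero D) (hL3 : BFI.L1.LSEisInf D)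
    (hL4 : BFI.L1.LSEisZero D) (hL5 : BFI.L1.LSHolInf D) (hL6 : BFI.L1.LSHolZero D)
    (hE5 : BFI.L1.ExcFive D) (hE7 : BFI.L1.ExcSeven D) : BombieriFriedlanderIwaniecTheorem1 :=
  BombieriFriedlanderIwaniecTheorem1_of_H91
    (BFI.L1.H91At_of_kuznetsov D W hKp hKm hW hL1 hL2 hL3 hL4 hL5 hL6 hE5 hE7)

/-- **BFI 1986, Theorem 10 (p. 209) from the Kuznetsov package.**
[cite: BombieriFriedlanderIwaniecActa1986, Theorem 10 p. 209; DeshouillersIwaniec1982, §9.1 pp. 278–280] -/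
theorem BombieriFriedlanderIwaniecTheorem10_of_kuznetsov (D : ℕ → BFI.L1.SpecData) (W : BFI.L1.KuzTransforms)
    (hKp : BFI.L1.KuzPlus D W) (hKm : BFI.L1.KuzMinus D W) (hW : BFI.L1.TransformBound W)
    (hL1 : BFI.L1.LSMaassInf D) (hL2 : BFI.L1.LSMaassZero D) (hL3 : BFI.L1.LSEisInf D)
    (hL4 : BFI.L1.LSEisZero D) (hL5 : BFI.L1.LSHolInf D) (hL6 : BFI.L1.LSHolZero D)
    (hE5 : BFI.L1.ExcFive D) (hE7 : BFI.L1.ExcSeven D) : BombieriFriedlanderIwaniecTheorem10 :=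
  BombieriFriedlanderIwaniecTheorem10_of_H91
    (BFI.L1.H91At_of_kuznetsov D W hKp hKm hW hL1 hL2 hL3 hL4 hL5 hL6 hE5 hE7)

/-- **The level-`4/7` fact `bfi_wellFactorable_level` from the Kuznetsov package.**
[cite: BombieriFriedlanderIwaniecActa1986, Theorem 10 p. 209] -/
theorem bfi_wellFactorable_level_of_kuznetsov (D : ℕ → BFI.L1.SpecData) (W : BFI.L1.KuzTransforms)
    (hKp : BFI.L1.KuzPlus D W) (hKm : BFI.L1.KuzMinus D W) (hW : BFI.L1.TransformBound W)
    (hL1 : BFI.L1.LSMaassInf D) (hL2 : BFI.L1.LSMaassZero D) (hL3 : BFI.L1.LSEisInf D)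
    (hL4 : BFI.L1.LSEisZero D) (hL5 : BFI.L1.LSHolInf D) (hL6 : BFI.L1.LSHolZero D)
    (hE5 : BFI.L1.ExcFive D) (hE7 : BFI.L1.ExcSeven D) : bfi_wellFactorable_level :=
  bfi_wellFactorable_level_of_H91
    (BFI.L1.H91At_of_kuznetsov D W hKp hKm hW hL1 hL2 hL3 hL4 hL5 hL6 hE5 hE7)

/-- **The twin-prime sieve bound `twinSieve_bfi` from the Kuznetsov package.**
[cite: BombieriFriedlanderIwaniecActa1986, Theorem 10 p. 209] -/
theorem twinSieve_bfi_of_kuznetsov (D : ℕ → BFI.L1.SpecData) (W : BFI.L1.KuzTransforms)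
    (hKp : BFI.L1.KuzPlus D W) (hKm : BFI.L1.KuzMinus D W) (hW : BFI.L1.TransformBound W)
    (hL1 : BFI.L1.LSMaassInf D) (hL2 : BFI.L1.LSMaassZero D) (hL3 : BFI.L1.LSEisInf D)
    (hL4 : BFI.L1.LSEisZero D) (hL5 : BFI.L1.LSHolInf D) (hL6 : BFI.L1.LSHolZero D)
    (hE5 : BFI.L1.ExcFive D) (hE7 : BFI.L1.ExcSeven D) : twinSieve_bfi :=
  twinSieve_bfi_of_H91
    (BFI.L1.H91At_of_kuznetsov D W hKp hKm hW hL1 hL2 hL3 hL4 hL5 hL6 hE5 hE7)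

end Consequences

end Literature.NumberTheory.Sieve
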